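import Literature.MathematicalPhysics.QuantumFieldTheory.Balaban1983to89.B3Eq15OneSidedInteraction
import Literature.MathematicalPhysics.QuantumFieldTheory.Balaban1983to89.HiggsFluctMeasurePos

/-!
# `Balaban1983to89.B3Eq14Finite` — T. Bałaban, *(Higgs)₂,₃ quantum fields in a finite volume. III. Renormalization*,
Commun. Math. Phys. **88** (1983) 411–445 [Balaban1983Higgs3], (1.4)–(1.5) p. 412 [PDF 2]: **the auxiliary function
`E_k(e′, λ′, Ω, A^{(k)}, φ)` of (1.4) IS A GENUINE NUMBER ON `λ′ ≥ 0`** — the nested integral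
`Π_{j<k}∫dμ_{C^{(j),L^jη}}(A′_j) T^η_{a_k,L^k,e′g_kA′+A^{(k)}}[Ω, exp(…)](φ)` behind the typed `Data14.auxE` (typer g4,
`B3Eq14AuxFunction`, p250365) CONVERGES and is STRICTLY POSITIVE, so that `E_k = −log` of it is the honest logarithm of a
positive real (`exp(−E_k) = the integral`), in the two regimes in which the print uses (1.4): (A) `λ′λ(L^kε) > 0` (the
quartic term present — no condition on the mass counterterm), (B) the quartic term absent (`λ′λ(L^kε) = 0`, in particular
the base point `e′ = λ′ = 0` of (1.5)) and the total mass `m² + δm²(e′, λ′, x) > 0` on `Ω₁`.  Companion of the typer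
g24 SEMANTIC AUDIT `B3Eq15OneSidedInteraction` (p333689), which showed that for `λ′ < 0` the same fibre integral DIVERGES
and the typed `E_k` is Lean's junk value `0` there: together, **the domain of the typed (1.4) is exactly `λ′ ≥ 0`**, the
half-line on which the repaired one-sided (1.5) `interaction15R` (`iteratedDerivWithin … (Set.Ici 0) 0`) reads it
(`auxE_dichotomy`).

statement-level skeleton of published theorems with citation tags; proofs where landed; nothing here is a claim about
the Yang–Mills mass gap

WHAT IS PROVED (theorems only; no definition, no `Prop` fact; axioms standard):
* §1 joint CONTINUITY in the fluctuation family `A′ = (A′_j)_{j<k}` and the fibre field `φ′↾_Ω` of every piece of (1.4):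
  the zero extension, the pieces (1.2) `A′^{(j),η}` (`continuous_fluctPiece`), the external field `e′g_kA′ + A^{(k)}`,
  the contour functional (1.3), the averages `Q_k(e′g_kA′ + A^{(k)})φ′`, the Gaussian kernel `t(Ω; φ, φ′)` (I.2.5)/(I.2.10)
  (`continuous_kernel14`) and the density `exp[…]` of (1.4) (`continuous_density14`);
* §2 GAUSSIAN DOMINATION: `t(Ω; φ, φ′) ≤ (κ/2π)^{N|Ω^{(k)}|/2}` (`kernel14_le`) and, in regimes (A)/(B),
  `exp[…](φ′) ≤ e^K·exp(−cΣ_x|φ′(x)|²)` uniformly in `A′` (`density14_le_of_quartic`, `density14_le_of_mass`; the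
  Neumann form `⟨φ′,(−Δ^η_{𝒜,Ω})φ′⟩ ≥ 0`, `HiggsCovariancePos`);
* §3 THE FIBRE INTEGRAL `T^η[Ω, exp[…]](φ) = ∫dφ′↾_Ω t·exp[…]`: integrable (`integrable_fibre14`), strictly positive
  (`rt14_density14_pos`), bounded uniformly in `A′` and CONTINUOUS in `A′` (`continuous_integrand14`, dominated convergence);
* §4 THE OUTER INTEGRAL against the product Gaussian probability measure `Π_j dμ_{C^{(j)}}` (`HiggsFluctMeasure.fluctFamily`,
  a probability measure for `μ₀²(L^kε)² > 0`, `a > 0`, `L > 1`, `k ≤ K` by `HiggsFluctMeasurePos.fluctFamily_isProbability`):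
  integrable and STRICTLY POSITIVE (`integral_integrand14_pos`), hence **`exp(−E_k) = Π_j∫dμ_{C^{(j)}} T^η[Ω, exp[…]](φ) > 0`**
  (`exp_neg_auxE_eq`), the base point of (1.5) (`integral_integrand14_pos_zero`), and the DICHOTOMY with the g24 audit
  (`auxE_dichotomy`: `λ′ < 0 ⇒` integral `= 0 ∧ E_k = 0`; `λ′ > 0 ⇒` integral `> 0 ∧ exp(−E_k) =` integral);
* §5 (v1.1, append-only) CONTINUITY IN THE FIELDS: the kernel, the density, the fibre integral and the outer integral are
  jointly continuous in `(A^{(k)}, φ)` as well (`continuous_kernel14₄`, `continuous_density14₃`, `continuous_integrand14₃`,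
  `continuous_integral_integrand14`), hence **`(A^{(k)}, φ) ↦ E_k(e′, λ′, Ω, A^{(k)}, φ)` is continuous** on `λ′ ≥ 0`
  (`continuous_auxE`) — the zeroth-order regularity in the new fields that every downstream integral over `φ` of the
  effective interaction presupposes;
* §6 (v1.2, append-only) A PRIORI BOUNDS UNIFORM IN THE FIELDS on `λ′ ≥ 0`: `∃ E₀, E₀ ≤ E_k(e′,λ′,Ω,A^{(k)},φ)` for all
  `(A^{(k)}, φ)` (`exists_le_auxE`) and `∃ C, E_k(e′,λ′,Ω,A^{(k)},φ) ≤ C + κΣ_{y∈Ω^{(k)}}|φ(y)|²`, `κ = a_k(L^kη)^{d−2}`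
  (`exists_auxE_le`, from the kernel lower bound of the g24 file and `density14_ge_quartic`): the typed effective
  interaction is bounded below and grows at most quadratically in the new field (ours; properties of the typed (1.4));
* §7 (v1.3, append-only) THE RIGHT `λ′`-DERIVATIVE AT `λ′ = 0⁺` — what the `β = 1` term of the REPAIRED (1.5)
  (`B3Eq15OneSidedInteraction.interaction15R`) denotes: with the `λ′`-vertex `lamVertex` (`V = λ(L^kε)Σ_{Ω₁}η^d|φ′|⁴ +
  ½Σ_{Ω₁}η^d∂_{λ′}δm²·(L^kε)²|φ′|² + ∂_{λ′}E₁`, the vertices (1.6)/(1.7) p. 413 differentiated once in `λ′`; a `def`),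
  for data `δm²(e′,·,x)`, `E₁(e′,·)` of class `C¹` in `λ′`, `λ(L^kε) ≥ 0` and a renormalized mass uniformly positive on
  `λ′ ∈ [0, δ]`: `hasDerivAt_density14_lam`, `density14_le_explicit`, `hasDerivWithinAt_integral_integrand14_lam_Ici`
  (`d⁺/dλ′ ∫∫ t·exp[…] = −∫∫ V·t·exp[…]` at `λ′ = 0`, ONE dominated convergence on the product of the fluctuation
  measure with the fibre Lebesgue measure, mean-value majorant), `hasDerivWithinAt_auxE_lam_Ici` and
  `derivWithin_auxE_lam_Ici` (`∂⁺_{λ′}E_k|₀ = iteratedDerivWithin 1 (λ′ ↦ E_k) [0,∞) 0 = ⟨V⟩`, the normalized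
  expectation) — the `φ⁴` vertex IS produced by the one-sided reading, where §3 of `B3Eq15OneSidedInteraction` showed
  the two-sided instance loses it;
* §8 (v1.4, append-only) THE REPAIRED (1.5) TO FIRST ORDER: `idx15_one` (`{(0,1),(1,0)}`), `interaction15R_one_eq`
  (`interaction15R 1 = ∂_{e′}E_k(·,0)|₀ + ⟨V⟩` at the expansion point `e′ = 0`, hypotheses of §7 there) and
  `interaction15R_one_sub_interaction15_one` (it exceeds g4's two-sided instance `interaction15 1` by exactly `⟨V⟩`
  under the g24 audit hypotheses `N ≥ 1`, `λ(L^kε) > 0`, a site of `Ω ∩ Ω₁`);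
* §9 (v1.5, append-only) `C¹` ON `[0, δ]`: `integral_integrand14_eq_integral_prod` (Fubini form of the nested
  integral), `exists_lamDeriv_majorant` (the Gaussian majorant of `V·t·exp[…]` uniform on `[0, δ]`),
  `hasDerivWithinAt_integral_integrand14_lam_Icc` (derivative `−∫∫V(λ′₀)·t·exp[…]` at EVERY `λ′₀ ∈ [0, δ]`),
  `continuousOn_integral_lamVertex_mul` (continuity of that derivative), `hasDerivWithinAt_auxE_lam_Icc`
  (`∂E_k/∂λ′(λ′₀) = ⟨V⟩_{λ′₀}`);
* §10 (v1.6, append-only) THE SECOND RIGHT `λ′`-DERIVATIVE AT `0⁺` — what the `β = 2` term of the repaired (1.5)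
  denotes: second def `lamVertex2` (`∂_{λ′}V = ½Σ_{Ω₁}η^d∂²_{λ′}δm²·(L^kε)²|φ′|² + ∂²_{λ′}E₁`), `hasDerivAt_lamVertex`,
  `hasDerivWithinAt_integral_lamVertex_mul_Icc` (`d/dλ′ ∫∫V·t·exp[…] = ∫∫(∂_{λ′}V − V²)·t·exp[…]` at every
  `λ′₀ ∈ [0, δ]`, data `C²`), and **`iteratedDerivWithin_two_auxE_lam_Ici`**:
  `iteratedDerivWithin 2 (λ′ ↦ E_k) [0,∞) 0 = ⟨∂_{λ′}V⟩₀ − (⟨V²⟩₀ − ⟨V⟩₀²)` — the differentiated vertex minus the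
  VARIANCE of the `λ′`-vertex in the normalized `λ′ = 0` measure (the connected two-vertex expectation: the first
  "propagator" structure of p. 412's graphical description), via a private dominated-differentiation lemma on `[0, δ]`.
HONEST SCOPE: existence of the (one-sided) DERIVATIVES of `E_k` in `(e′, λ′)` — the content of (1.5) — is not shown in
§1–§6 (it needs, beyond those sections, the regularity of the supplied counterterm data `δm²(e′,λ′,x)`, `E₁(e′,λ′)` of
`Data14`); §1–§6 settle finiteness/positivity of the zeroth-order object only, §7–§9 (v1.3–v1.5) the FIRST
`λ′`-derivative under `C¹` data and §10 (v1.6) the SECOND at `0⁺` under `C²` data — nothing about orders `≥ 3` or any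
`e′`-derivative (the charge direction needs moments of the fluctuation measure: `∂_{e′}` of the kernel carries
factors `|A′|`).  Regime (B) at the base point asks
`m² + δm²(0, 0, x) > 0`, a hypothesis on the data (the printed counterterms (1.29) have no constant term, cf.
`B3Eq14AuxFunction.withTotals_dm2_zero`).

PDF held: `paper:balaban1983-higgs-2-3-quantum-fields-finite-volume` (journal page = PDF page + 410); (1.4)–(1.5) p. 412
[PDF 2] read from the render `run/shared/lean/pub/pub-balaban/b2b-balaban-ref1/pages/` (paper III p002) by typer g4/g24.

CITATION HEADER (lean-in-tree rule).  lit-balaban TYPED SKELETON (HOME `run/shared/lean/pub/lit-balaban/`), rows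
**B3.Eq1.4** / **B3.Eq1.5** (owner r15; decls of record `B3Eq14AuxFunction.Data14.auxE`, `B3Eq15OneSidedInteraction.interaction15R`);
unit `lit-balaban-typer` (literature-prover-lit-balaban-typer-g25-0).  Nothing of any other seat is touched; no row
changes head (a well-definedness result about the typed instance).  v1.1 (same unit): §5 appended, v1.0 declarations
byte-identical.  v1.2 (same unit): §6 appended, v1.1 declarations byte-identical.  v1.3 (same unit): §7 appended
(first `def` of the file: `lamVertex`), v1.2 declarations byte-identical; NOT shown: higher `λ′`-derivatives, any
`e′`-derivative (the charge enters through `U(e′𝒜(Γ))` and `Δ^η_{e′𝒜}`), or the existence of `interaction15R`'s terms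
with `α ≥ 1`.  v1.4 (same unit): §8 appended, v1.3 declarations byte-identical.  v1.5 (same unit): §9 appended,
v1.4 declarations byte-identical.  v1.6 (same unit): §10 appended (second def `lamVertex2`), v1.5 declarations
byte-identical.
-/

open _root_.MeasureTheory

namespace Literature.MathematicalPhysics.QuantumFieldTheory.Balaban1983to89.B3Eq14Finite

open Literature.MathematicalPhysics.QuantumFieldTheory.Balaban1983to89.HiggsLattice
open Literature.MathematicalPhysics.QuantumFieldTheory.Balaban1983to89.HiggsAveraging
open Literature.MathematicalPhysics.QuantumFieldTheory.Balaban1983to89.HiggsCovariance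
open Literature.MathematicalPhysics.QuantumFieldTheory.Balaban1983to89.B3MultiscaleFields
open Literature.MathematicalPhysics.QuantumFieldTheory.Balaban1983to89.HiggsFluctMeasure
open Literature.MathematicalPhysics.QuantumFieldTheory.Balaban1983to89.B1RT
open Literature.MathematicalPhysics.QuantumFieldTheory.Balaban1983to89.B3Eq14AuxFunction
open Literature.MathematicalPhysics.QuantumFieldTheory.Balaban1983to89.B3Eq15OneSidedInteraction
  (sqSum sqSum_nonneg prec_pos)
open Literature.MathematicalPhysics.QuantumFieldTheory.Balaban1983to89.B1Eq31Concrete (continuous_chargeU)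
open Set Filter Topology
open scoped BigOperators

noncomputable section

variable {P : HiggsLattice.Params} {N : ℕ}

/-! ## 1. Joint continuity of the pieces of (1.4) in the fluctuation family and the fibre field -/

section Continuity

/-- The zero extension `φ′↾_Ω ↦ φ′` (integration variable of `∫dφ′↾_Ω`, (I.2.4) p. 608) is continuous.
[cite: Balaban1982Higgs1, (2.4) p.608] -/
theorem continuous_extendZero (Ω : Finset (HiggsLattice.Site P 0)) :
    Continuous (extendZero (N := N) Ω) := by
  refine continuous_pi fun x => ?_
  by_cases hx : x ∈ Ω
  · exact (continuous_apply (⟨x, hx⟩ : ↥Ω)).congr fun φΩ => (extendZero_of_mem Ω φΩ hx).symm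
  · exact continuous_const.congr fun φΩ => (extendZero_of_not_mem Ω φΩ hx).symm

/-- The re-indexing `ofSite` (site function ↦ bond function, paper I p. 608) is continuous.
[cite: Balaban1982Higgs1, p.608] -/
theorem continuous_ofSite {j : ℕ} :
    Continuous (ofSite : HiggsLattice.ScalarField P j P.d → HiggsLattice.VecField P j) := by
  refine continuous_pi fun b => ?_
  show Continuous fun f : HiggsLattice.ScalarField P j P.d => f b.src b.dir
  exact (EuclideanSpace.proj b.dir).continuous.comp (continuous_apply b.src)

/-- The operator `a_j(L^jη)^{−2}G^η_jQ^*_j` of (1.2) is continuous (a linear map of finite-dimensional spaces).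
[cite: Balaban1983Higgs3, (1.2) p.412] -/
theorem continuous_fluctOp (msq a : ℝ) (j : ℕ) : Continuous (fluctOp (P := P) msq a j) := by
  have h1 : Continuous fun g : HiggsLattice.ScalarField P j P.d =>
      avgQkAdj (zeroCharge P.d) (0 : HiggsLattice.VecField P 0) j g :=
    LinearMap.continuous_of_finiteDimensional _
  have h2 : Continuous fun f : HiggsLattice.ScalarField P 0 P.d =>
      propagatorK (zeroCharge P.d) Finset.univ (0 : HiggsLattice.VecField P 0) msq a j f :=
    LinearMap.continuous_of_finiteDimensional _
  exact ((h2.comp h1).const_smul (B1.aSeq a P.L j * (P.mesh j ^ 2)⁻¹)).congr fun g => (fluctOp_eq msq a j g).symm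

/-- **The pieces `A′_j ↦ A′^{(j),η}` of (1.2) are continuous.** [cite: Balaban1983Higgs3, (1.2) p.412] -/
theorem continuous_fluctPiece (msq a : ℝ) : ∀ j : ℕ, Continuous (fluctPiece (P := P) msq a j)
  | 0 => continuous_id.congr fun A => (fluctPiece_zero msq a A).symm
  | j + 1 => (continuous_ofSite.comp ((continuous_fluctOp msq a (j + 1)).comp continuous_toSite)).congr
      fun A => (fluctPiece_succ msq a j A).symm

/-- `A ↦ g·A` (the cut-off multiplying a bond field) is continuous. [cite: Balaban1983Higgs3, (1.4) p.412] -/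
theorem continuous_siteMul (g : HiggsLattice.Site P 0 → ℝ) :
    Continuous fun A : HiggsLattice.VecField P 0 => siteMul g A :=
  continuous_pi fun b => continuous_const.mul (continuous_apply b)

variable {k : ℕ} (D : Data14 P N k)

/-- `A′ ↦ A′ = Σ_{j<k} A′^{(j),η}` (1.1) is continuous. [cite: Balaban1983Higgs3, (1.1) p.412] -/
theorem continuous_fluctSum : Continuous D.fluctSum := by
  unfold Data14.fluctSum
  exact continuous_finsetSum _ fun j _ => (continuous_fluctPiece D.msq D.a j).comp (continuous_apply j)

/-- `A′ ↦ e′g_kA′ + A^{(k)}` (the external field of (1.4)) is continuous. [cite: Balaban1983Higgs3, (1.4) p.412] -/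
theorem continuous_extField (Ak : HiggsLattice.VecField P 0) (e' : ℝ) : Continuous (D.extField Ak e') := by
  have h : Continuous fun A' : (j : Fin k) → HiggsLattice.VecField P j => e' • siteMul D.g (D.fluctSum A') + Ak :=
    (((continuous_siteMul D.g).comp (continuous_fluctSum D)).const_smul e').add continuous_const
  exact h.congr fun A' => (D.extField_eq Ak e' A').symm

/-- `A′ ↦ (e′g_kA′)^{(j),η}` (the pieces entering (1.3)) is continuous. [cite: Balaban1983Higgs3, (1.3) p.412] -/
theorem continuous_extPieces (e' : ℝ) (j : ℕ) :
    Continuous fun A' : (i : Fin k) → HiggsLattice.VecField P i => D.extPieces e' A' j := by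
  by_cases h : j < k
  · have hc : Continuous fun A' : (i : Fin k) → HiggsLattice.VecField P i =>
        e' • siteMul D.g (fluctPiece D.msq D.a j (A' ⟨j, h⟩)) := by
      refine Continuous.fun_const_smul ?_ e'
      exact (continuous_siteMul D.g).comp
        ((continuous_fluctPiece D.msq D.a j).comp (continuous_apply (⟨j, h⟩ : Fin k)))
    exact hc.congr fun A' => (D.extPieces_of_lt e' A' h).symm
  · have h0 : ∀ A' : (i : Fin k) → HiggsLattice.VecField P i, D.extPieces e' A' j = 0 := fun A' => by
      simp [Data14.extPieces, h]
    exact continuous_const.congr fun A' => (h0 A').symm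

/-- `A′ ↦ 𝒜(Γ^{(k)}_{y,x})` — the contour functional (1.3) of the external field of (1.4) — is continuous.
[cite: Balaban1983Higgs3, (1.3) p.412] -/
theorem continuous_contour13_extPieces (Ak : HiggsLattice.VecField P 0) (e' : ℝ) (x : HiggsLattice.Site P 0) :
    Continuous fun A' : (j : Fin k) → HiggsLattice.VecField P j => contour13 k (D.extPieces e' A') Ak x := by
  have h : Continuous fun A' : (j : Fin k) → HiggsLattice.VecField P j =>
      (∑ j ∈ Finset.range k, P.mesh 0 * multiContourSum (D.extPieces e' A' j) (j + 1) x)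
        + P.mesh 0 * multiContourSum Ak k x :=
    (continuous_finsetSum _ fun j _ => continuous_const.mul
      ((HiggsCovarianceCont.continuous_multiContourSum (j + 1) x).comp (continuous_extPieces D e' j))).add
      continuous_const
  exact h.congr fun A' => rfl

variable {X : Type*} [TopologicalSpace X]

/-- **`(A′, φ′) ↦ Q_k(e′g_kA′ + A^{(k)})φ′` is jointly continuous** (the transports `U(𝒜(Γ))` are continuous in the
field, (I.2.11) p. 609 with (1.3)). [cite: Balaban1983Higgs3, (1.3)–(1.4) p.412] -/
theorem continuous_avgQ14 (Ak : HiggsLattice.VecField P 0) (e' : ℝ)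
    {A' : X → ((j : Fin k) → HiggsLattice.VecField P j)} {φ' : X → HiggsLattice.ScalarField P 0 N}
    (hA : Continuous A') (hφ : Continuous φ') : Continuous fun t => D.avgQ14 Ak e' (A' t) (φ' t) := by
  refine continuous_pi fun y => ?_
  simp_rw [Data14.avgQ14_apply]
  refine Continuous.fun_const_smul (continuous_finsetSum _ fun x _ => ?_) _
  unfold holK13
  exact ((continuous_chargeU D.C 1).comp ((continuous_contour13_extPieces D Ak e' x).comp hA)).clm_apply
    ((continuous_apply x).comp hφ)

/-- **The Gaussian kernel `t(Ω; φ, φ′)` of (1.4) ((I.2.5)/(I.2.10)) is jointly continuous in `(A′, φ′↾_Ω)`.**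
[cite: Balaban1982Higgs1, (2.10) p.609] -/
theorem continuous_kernel14 (Ak : HiggsLattice.VecField P 0) (e' : ℝ) (φ : HiggsLattice.ScalarField P k N)
    {A' : X → ((j : Fin k) → HiggsLattice.VecField P j)} {φΩ : X → (↥D.Ω → EuclideanSpace ℝ (Fin N))}
    (hA : Continuous A') (hφΩ : Continuous φΩ) : Continuous fun t => D.kernel14 Ak e' (A' t) φ (φΩ t) := by
  simp_rw [Data14.kernel14_eq]
  refine continuous_finsetProd _ fun y _ => (continuous_rtKernel _).comp ?_
  exact continuous_const.sub ((continuous_apply y.1).comp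
    (continuous_avgQ14 D Ak e' hA ((continuous_extendZero D.Ω).comp hφΩ)))

/-- `(A′, φ′) ↦ (−Δ^η_{e′g_kA′+A^{(k)},Ω} + m²(L^kε)²)φ′` is jointly continuous (`HiggsCovarianceCont.continuous_covLaplacianN`).
[cite: Balaban1983Higgs3, (1.4) p.412] -/
theorem continuous_scalarOp_apply (Ak : HiggsLattice.VecField P 0) (e' : ℝ)
    {A' : X → ((j : Fin k) → HiggsLattice.VecField P j)} {φ' : X → HiggsLattice.ScalarField P 0 N}
    (hA : Continuous A') (hφ : Continuous φ') : Continuous fun t => D.scalarOp Ak e' (A' t) (φ' t) := by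
  have h : Continuous fun t =>
      covLaplacianN D.C D.Ω (D.extField Ak e' (A' t)) (φ' t) + (D.m2 * D.ell ^ 2) • φ' t :=
    (HiggsCovarianceCont.continuous_covLaplacianN D.C D.Ω ((continuous_extField D Ak e').comp hA) hφ).add
      (hφ.fun_const_smul (D.m2 * D.ell ^ 2))
  refine h.congr fun t => ?_
  rw [Data14.scalarOp_eq, LinearMap.add_apply, LinearMap.smul_apply, LinearMap.id_apply]

/-- **The density `exp[…](φ′)` of (1.4) is jointly continuous in `(A′, φ′)`.** [cite: Balaban1983Higgs3, (1.4) p.412] -/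
theorem continuous_density14 (Ak : HiggsLattice.VecField P 0) (e' lam' : ℝ)
    {A' : X → ((j : Fin k) → HiggsLattice.VecField P j)} {φ' : X → HiggsLattice.ScalarField P 0 N}
    (hA : Continuous A') (hφ : Continuous φ') : Continuous fun t => D.density14 Ak e' lam' (A' t) (φ' t) := by
  have hφx : ∀ x : HiggsLattice.Site P 0, Continuous fun t => ‖φ' t x‖ :=
    fun x => ((continuous_apply x).comp hφ).norm
  have h1 : Continuous fun t => siteInner (φ' t) (D.scalarOp Ak e' (A' t) (φ' t)) :=
    HiggsFluctMeasure.continuous_siteInner hφ (continuous_scalarOp_apply D Ak e' hA hφ)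
  have h2 : Continuous fun t => ∑ x ∈ D.Ω₁, P.mesh 0 ^ P.d * ‖φ' t x‖ ^ 4 :=
    continuous_finsetSum _ fun x _ => continuous_const.mul ((hφx x).pow 4)
  have h3 : Continuous fun t => ∑ x ∈ D.Ω₁, P.mesh 0 ^ P.d * D.dm2 e' lam' x * D.ell ^ 2 * ‖φ' t x‖ ^ 2 :=
    continuous_finsetSum _ fun x _ => continuous_const.mul ((hφx x).pow 2)
  have h12 : Continuous fun t => -(1 / 2 : ℝ) * siteInner (φ' t) (D.scalarOp Ak e' (A' t) (φ' t))
      - lam' * D.lamRun * ∑ x ∈ D.Ω₁, P.mesh 0 ^ P.d * ‖φ' t x‖ ^ 4 :=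
    (continuous_const.mul h1).sub (continuous_const.mul h2)
  have h123 : Continuous fun t => -(1 / 2 : ℝ) * siteInner (φ' t) (D.scalarOp Ak e' (A' t) (φ' t))
      - lam' * D.lamRun * ∑ x ∈ D.Ω₁, P.mesh 0 ^ P.d * ‖φ' t x‖ ^ 4
      - (1 / 2 : ℝ) * ∑ x ∈ D.Ω₁, P.mesh 0 ^ P.d * D.dm2 e' lam' x * D.ell ^ 2 * ‖φ' t x‖ ^ 2 :=
    h12.sub (continuous_const.mul h3)
  have h : Continuous fun t => Real.exp (-(1 / 2 : ℝ) * siteInner (φ' t) (D.scalarOp Ak e' (A' t) (φ' t))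
      - lam' * D.lamRun * ∑ x ∈ D.Ω₁, P.mesh 0 ^ P.d * ‖φ' t x‖ ^ 4
      - (1 / 2 : ℝ) * ∑ x ∈ D.Ω₁, P.mesh 0 ^ P.d * D.dm2 e' lam' x * D.ell ^ 2 * ‖φ' t x‖ ^ 2
      - D.E1 e' lam') :=
    (h123.sub continuous_const).rexp
  exact h.congr fun t => (D.density14_eq Ak e' lam' (A' t) (φ' t)).symm

/-- **The fibre integrand `t(Ω; φ, φ′)·exp[…](φ′)` of `T^η[Ω, exp[…]](φ)` in (1.4) is jointly continuous in
`(A′, φ′↾_Ω)`** (hence measurable on the product and continuous in each variable). [cite: Balaban1983Higgs3, (1.4) p.412] -/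
theorem continuous_fibre14 (Ak : HiggsLattice.VecField P 0) (e' lam' : ℝ) (φ : HiggsLattice.ScalarField P k N)
    {A' : X → ((j : Fin k) → HiggsLattice.VecField P j)} {φΩ : X → (↥D.Ω → EuclideanSpace ℝ (Fin N))}
    (hA : Continuous A') (hφΩ : Continuous φΩ) :
    Continuous fun t => D.kernel14 Ak e' (A' t) φ (φΩ t) * D.density14 Ak e' lam' (A' t) (extendZero D.Ω (φΩ t)) :=
  (continuous_kernel14 D Ak e' φ hA hφΩ).mul
    (continuous_density14 D Ak e' lam' hA ((continuous_extendZero D.Ω).comp hφΩ))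

end Continuity

/-! ## 2. Gaussian domination of the kernel and of the density -/

section Bounds

variable {k : ℕ} (D : Data14 P N k)

/-- The one-site Gaussian kernel is bounded by its prefactor: `(κ/2π)^{N/2}exp(−½κ|v|²) ≤ (κ/2π)^{N/2}` for `κ ≥ 0`.
[cite: Balaban1982Higgs1, (2.6) p.608] -/
theorem rtKernel_le {κ : ℝ} (hκ : 0 ≤ κ) (v : EuclideanSpace ℝ (Fin N)) :
    rtKernel κ v ≤ (κ / (2 * Real.pi)) ^ ((Module.finrank ℝ (EuclideanSpace ℝ (Fin N)) : ℝ) / 2) := by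
  rw [rtKernel_eq]
  have hc : 0 ≤ (κ / (2 * Real.pi)) ^ ((Module.finrank ℝ (EuclideanSpace ℝ (Fin N)) : ℝ) / 2) :=
    Real.rpow_nonneg (by positivity) _
  have he : Real.exp (-(κ / 2) * ‖v‖ ^ 2) ≤ 1 :=
    Real.exp_le_one_iff.2 (by nlinarith [sq_nonneg ‖v‖])
  exact mul_le_of_le_one_right hc he

/-- **`t(Ω; φ, φ′) ≤ (κ/2π)^{N|Ω^{(k)}|/2}`**, `κ = a_k(L^kη)^{d−2} ≥ 0` (for `a ≥ 0`): the kernel of (1.4) is bounded,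
uniformly in all fields. [cite: Balaban1982Higgs1, (2.10) p.609] -/
theorem kernel14_le (ha : 0 ≤ D.a) (Ak : HiggsLattice.VecField P 0) (e' : ℝ)
    (A' : (j : Fin k) → HiggsLattice.VecField P j) (φ : HiggsLattice.ScalarField P k N)
    (φΩ : ↥D.Ω → EuclideanSpace ℝ (Fin N)) :
    D.kernel14 Ak e' A' φ φΩ
      ≤ ((prec (B1.aSeq D.a P.L k) (P.mesh k) P.d / (2 * Real.pi))
          ^ ((Module.finrank ℝ (EuclideanSpace ℝ (Fin N)) : ℝ) / 2)) ^ Fintype.card ↥D.Ωk := by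
  have hκ : 0 ≤ prec (B1.aSeq D.a P.L k) (P.mesh k) P.d := by
    unfold prec
    exact mul_nonneg (D.aSeq_nonneg' ha k) (zpow_nonneg (P.mesh_pos k).le _)
  rw [Data14.kernel14_eq, ← Finset.card_univ, ← Finset.prod_const]
  exact Finset.prod_le_prod (fun y _ => rtKernel_nonneg hκ _) fun y _ => rtKernel_le hκ _

/-- **Lower bound of the quadratic form of (1.4)**: `⟨φ′, (−Δ^η_{𝒜,Ω} + m²(L^kε)²)φ′⟩ ≥ m²(L^kε)²·η^d·Σ_x|φ′(x)|²`
(the Neumann covariant Laplacian is non-negative, `HiggsCovariancePos.siteInner_covLaplacianN_nonneg`), uniformly in the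
external field. [cite: Balaban1983Higgs3, (1.4) p.412] -/
theorem siteInner_scalarOp_ge (Ak : HiggsLattice.VecField P 0) (e' : ℝ) (A' : (j : Fin k) → HiggsLattice.VecField P j)
    (φ' : HiggsLattice.ScalarField P 0 N) :
    D.m2 * D.ell ^ 2 * (P.mesh 0 ^ P.d * sqSum φ') ≤ siteInner φ' (D.scalarOp Ak e' A' φ') := by
  have hself : siteInner φ' φ' = P.mesh 0 ^ P.d * sqSum φ' := by
    rw [HiggsCovariancePos.siteInner_self_eq, sqSum, Finset.mul_sum]
  have h1 := HiggsCovariancePos.siteInner_covLaplacianN_nonneg D.C D.Ω (D.extField Ak e' A') φ'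
  have h2 : siteInner φ' (D.scalarOp Ak e' A' φ')
      = siteInner φ' (covLaplacianN D.C D.Ω (D.extField Ak e' A') φ') + D.m2 * D.ell ^ 2 * siteInner φ' φ' := by
    rw [Data14.scalarOp_eq, LinearMap.add_apply, LinearMap.smul_apply, LinearMap.id_apply]
    unfold siteInner
    rw [Finset.mul_sum, ← Finset.sum_add_distrib]
    refine Finset.sum_congr rfl fun x _ => ?_
    rw [Pi.add_apply, inner_add_right, Pi.smul_apply, inner_smul_right]
    ring
  rw [h2, hself]
  linarith

/-- complete the square: `c r⁴ − C r² ≥ −C²/(4c)` for `c > 0`. [folklore] -/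
private theorem quartic_lower {c : ℝ} (hc : 0 < c) (C r : ℝ) : -(C ^ 2 / (4 * c)) ≤ c * r ^ 4 - C * r ^ 2 := by
  have h : c * r ^ 4 - C * r ^ 2 + C ^ 2 / (4 * c) = (c * r ^ 2 - C / 2) ^ 2 / c := by
    field_simp
    ring
  have h' : 0 ≤ (c * r ^ 2 - C / 2) ^ 2 / c := by positivity
  linarith

/-- a finite family of positive reals and a positive number have a common positive lower bound. [folklore] -/
private theorem exists_pos_le_of_forall_pos {α : Type*} (s : Finset α) (f : α → ℝ) (h : ∀ x ∈ s, 0 < f x) {m : ℝ}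
    (hm : 0 < m) : ∃ c : ℝ, 0 < c ∧ c ≤ m ∧ ∀ x ∈ s, c ≤ f x := by
  classical
  induction s using Finset.induction_on with
  | empty => exact ⟨m, hm, le_rfl, fun x hx => absurd hx (Finset.notMem_empty x)⟩
  | insert a s ha ih =>
    obtain ⟨c, hc, hcm, hcs⟩ := ih fun x hx => h x (Finset.mem_insert_of_mem hx)
    refine ⟨min c (f a), lt_min hc (h a (Finset.mem_insert_self a s)), (min_le_left _ _).trans hcm, ?_⟩
    intro x hx
    rcases Finset.mem_insert.1 hx with rfl | hx
    · exact min_le_right _ _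
    · exact (min_le_left _ _).trans (hcs x hx)

/-- **Regime (A) — the quartic present, `λ′λ(L^kε) > 0`: Gaussian domination of the density of (1.4)**, uniformly in
the fields `A′`, `A^{(k)}` and WITHOUT any condition on the mass counterterm: there are `K` and `c > 0` with
`exp[…](φ′) ≤ exp(K − cΣ_x|φ′(x)|²)` (sitewise `−λ′λη^d r⁴ − ½η^dδm²ℓ²r² ≤ (½η^dℓ²|δm²|)²/(4λ′λη^d)` on `Ω₁`, and the mass
term `½m²ℓ²η^dΣ|φ′|²` of `siteInner_scalarOp_ge` is kept; `ℓ = L^kε`). [cite: Balaban1983Higgs3, (1.4) p.412] -/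
theorem density14_le_of_quartic (hm2 : 0 < D.m2) (hℓ : D.ell ≠ 0) {e' lam' : ℝ} (hq : 0 < lam' * D.lamRun) :
    ∃ K c : ℝ, 0 < c ∧ ∀ (Ak : HiggsLattice.VecField P 0) (A' : (j : Fin k) → HiggsLattice.VecField P j)
      (φ' : HiggsLattice.ScalarField P 0 N), D.density14 Ak e' lam' A' φ' ≤ Real.exp (K - c * sqSum φ') := by
  have hη : 0 < P.mesh 0 ^ P.d := pow_pos (P.mesh_pos 0) _
  have hℓ2 : 0 < D.ell ^ 2 := by positivity
  set q : ℝ := lam' * D.lamRun * P.mesh 0 ^ P.d with hqdef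
  have hqpos : 0 < q := mul_pos hq hη
  set Cx : HiggsLattice.Site P 0 → ℝ := fun x => P.mesh 0 ^ P.d * D.ell ^ 2 * |D.dm2 e' lam' x| / 2 with hCx
  refine ⟨(∑ x ∈ D.Ω₁, Cx x ^ 2 / (4 * q)) - D.E1 e' lam', D.m2 * D.ell ^ 2 * P.mesh 0 ^ P.d / 2,
    by positivity, ?_⟩
  intro Ak A' φ'
  rw [Data14.density14_eq, Real.exp_le_exp]
  have hS := siteInner_scalarOp_ge D Ak e' A' φ'
  -- sitewise control of the quartic and counterterm pieces on `Ω₁`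
  have hsite : ∀ x ∈ D.Ω₁,
      -(lam' * D.lamRun * (P.mesh 0 ^ P.d * ‖φ' x‖ ^ 4))
        - (1 / 2 : ℝ) * (P.mesh 0 ^ P.d * D.dm2 e' lam' x * D.ell ^ 2 * ‖φ' x‖ ^ 2) ≤ Cx x ^ 2 / (4 * q) := by
    intro x _
    have hql := quartic_lower hqpos (Cx x) ‖φ' x‖
    have habs : -D.dm2 e' lam' x ≤ |D.dm2 e' lam' x| := neg_le_abs _
    have hr2 : 0 ≤ P.mesh 0 ^ P.d * D.ell ^ 2 * ‖φ' x‖ ^ 2 := by positivity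
    have hdm : -((1 / 2 : ℝ) * (P.mesh 0 ^ P.d * D.dm2 e' lam' x * D.ell ^ 2 * ‖φ' x‖ ^ 2)) ≤ Cx x * ‖φ' x‖ ^ 2 := by
      have := mul_le_mul_of_nonneg_left habs hr2
      have e1 : Cx x * ‖φ' x‖ ^ 2 = (P.mesh 0 ^ P.d * D.ell ^ 2 * ‖φ' x‖ ^ 2) * |D.dm2 e' lam' x| / 2 := by
        rw [hCx]; ring
      have e2 : -((1 / 2 : ℝ) * (P.mesh 0 ^ P.d * D.dm2 e' lam' x * D.ell ^ 2 * ‖φ' x‖ ^ 2))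
          = (P.mesh 0 ^ P.d * D.ell ^ 2 * ‖φ' x‖ ^ 2) * (-D.dm2 e' lam' x) / 2 := by ring
      rw [e1, e2]
      linarith
    have e3 : lam' * D.lamRun * (P.mesh 0 ^ P.d * ‖φ' x‖ ^ 4) = q * ‖φ' x‖ ^ 4 := by rw [hqdef]; ring
    rw [e3]
    linarith
  have hsum := Finset.sum_le_sum hsite
  rw [Finset.sum_sub_distrib] at hsum
  -- hsum : Σ −(λ′λ_run η r⁴) − Σ ½(η δm² ℓ² r²) ≤ Σ Cx²/(4q)
  have e4 : ∑ x ∈ D.Ω₁, -(lam' * D.lamRun * (P.mesh 0 ^ P.d * ‖φ' x‖ ^ 4))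
      = -(lam' * D.lamRun * ∑ x ∈ D.Ω₁, P.mesh 0 ^ P.d * ‖φ' x‖ ^ 4) := by
    rw [Finset.mul_sum, Finset.sum_neg_distrib]
  have e5 : ∑ x ∈ D.Ω₁, (1 / 2 : ℝ) * (P.mesh 0 ^ P.d * D.dm2 e' lam' x * D.ell ^ 2 * ‖φ' x‖ ^ 2)
      = (1 / 2 : ℝ) * ∑ x ∈ D.Ω₁, P.mesh 0 ^ P.d * D.dm2 e' lam' x * D.ell ^ 2 * ‖φ' x‖ ^ 2 := by
    rw [Finset.mul_sum]
  have hc : D.m2 * D.ell ^ 2 * P.mesh 0 ^ P.d / 2 * sqSum φ'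
      = (1 / 2 : ℝ) * (D.m2 * D.ell ^ 2 * (P.mesh 0 ^ P.d * sqSum φ')) := by
    ring
  rw [hc]
  linarith [hsum, hS, e4, e5]

/-- **Regime (B) — the quartic absent or merely non-negative, positive total mass: Gaussian domination of the density
of (1.4)**, uniformly in the fields: for `λ′λ(L^kε) ≥ 0` and `m² + δm²(e′,λ′,x) > 0` for every `x ∈ Ω₁` (with `m² > 0`
off `Ω₁`) there are `K` and `c > 0` with `exp[…](φ′) ≤ exp(K − cΣ_x|φ′(x)|²)` — in particular at the base point
`e′ = λ′ = 0` of (1.5). [cite: Balaban1983Higgs3, (1.4) p.412] -/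
theorem density14_le_of_mass (hm2 : 0 < D.m2) (hℓ : D.ell ≠ 0) {e' lam' : ℝ} (hq : 0 ≤ lam' * D.lamRun)
    (hmass : ∀ x ∈ D.Ω₁, 0 < D.m2 + D.dm2 e' lam' x) :
    ∃ K c : ℝ, 0 < c ∧ ∀ (Ak : HiggsLattice.VecField P 0) (A' : (j : Fin k) → HiggsLattice.VecField P j)
      (φ' : HiggsLattice.ScalarField P 0 N), D.density14 Ak e' lam' A' φ' ≤ Real.exp (K - c * sqSum φ') := by
  classical
  have hη : 0 < P.mesh 0 ^ P.d := pow_pos (P.mesh_pos 0) _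
  have hℓ2 : 0 < D.ell ^ 2 := by positivity
  obtain ⟨c₀, hc₀, hc₀m, hc₀x⟩ := exists_pos_le_of_forall_pos D.Ω₁ (fun x => D.m2 + D.dm2 e' lam' x) hmass hm2
  refine ⟨-D.E1 e' lam', c₀ * D.ell ^ 2 * P.mesh 0 ^ P.d / 2, by positivity, ?_⟩
  intro Ak A' φ'
  rw [Data14.density14_eq, Real.exp_le_exp]
  have hS := siteInner_scalarOp_ge D Ak e' A' φ'
  -- the quartic term is non-negative
  have hQ : 0 ≤ lam' * D.lamRun * ∑ x ∈ D.Ω₁, P.mesh 0 ^ P.d * ‖φ' x‖ ^ 4 :=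
    mul_nonneg hq (Finset.sum_nonneg fun x _ => by positivity)
  -- split the mass term over `Ω₁` and its complement
  have hsplit : D.m2 * sqSum φ'
      = ∑ x ∈ D.Ω₁, D.m2 * ‖φ' x‖ ^ 2 + ∑ x ∈ D.Ω₁ᶜ, D.m2 * ‖φ' x‖ ^ 2 := by
    rw [sqSum, Finset.mul_sum, ← Finset.sum_add_sum_compl D.Ω₁]
  have hin : ∑ x ∈ D.Ω₁, c₀ * ‖φ' x‖ ^ 2
      ≤ ∑ x ∈ D.Ω₁, D.m2 * ‖φ' x‖ ^ 2 + ∑ x ∈ D.Ω₁, D.dm2 e' lam' x * ‖φ' x‖ ^ 2 := by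
    rw [← Finset.sum_add_distrib]
    refine Finset.sum_le_sum fun x hx => ?_
    have := mul_le_mul_of_nonneg_right (hc₀x x hx) (sq_nonneg ‖φ' x‖)
    linarith
  have hout : ∑ x ∈ D.Ω₁ᶜ, c₀ * ‖φ' x‖ ^ 2 ≤ ∑ x ∈ D.Ω₁ᶜ, D.m2 * ‖φ' x‖ ^ 2 :=
    Finset.sum_le_sum fun x _ => mul_le_mul_of_nonneg_right hc₀m (sq_nonneg ‖φ' x‖)
  have hc₀sum : c₀ * sqSum φ' = ∑ x ∈ D.Ω₁, c₀ * ‖φ' x‖ ^ 2 + ∑ x ∈ D.Ω₁ᶜ, c₀ * ‖φ' x‖ ^ 2 := by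
    rw [sqSum, Finset.mul_sum, ← Finset.sum_add_sum_compl D.Ω₁]
  have hM : ∑ x ∈ D.Ω₁, P.mesh 0 ^ P.d * D.dm2 e' lam' x * D.ell ^ 2 * ‖φ' x‖ ^ 2
      = P.mesh 0 ^ P.d * D.ell ^ 2 * ∑ x ∈ D.Ω₁, D.dm2 e' lam' x * ‖φ' x‖ ^ 2 := by
    rw [Finset.mul_sum]
    refine Finset.sum_congr rfl fun x _ => ?_
    ring
  -- assemble: ½η^dℓ²(m² Σ + Σ_{Ω₁} δm² r²) ≥ ½η^dℓ² c₀ Σ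
  have hkey : c₀ * sqSum φ' ≤ D.m2 * sqSum φ' + ∑ x ∈ D.Ω₁, D.dm2 e' lam' x * ‖φ' x‖ ^ 2 := by
    rw [hc₀sum, hsplit]
    linarith [hin, hout]
  have hkey' := mul_le_mul_of_nonneg_left hkey (mul_nonneg hη.le hℓ2.le)
  have e1 : c₀ * D.ell ^ 2 * P.mesh 0 ^ P.d / 2 * sqSum φ' = (1 / 2 : ℝ) * (P.mesh 0 ^ P.d * D.ell ^ 2 * (c₀ * sqSum φ')) := by
    ring
  have e2 : D.m2 * D.ell ^ 2 * (P.mesh 0 ^ P.d * sqSum φ') + ∑ x ∈ D.Ω₁, P.mesh 0 ^ P.d * D.dm2 e' lam' x * D.ell ^ 2 * ‖φ' x‖ ^ 2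
      = P.mesh 0 ^ P.d * D.ell ^ 2 * (D.m2 * sqSum φ' + ∑ x ∈ D.Ω₁, D.dm2 e' lam' x * ‖φ' x‖ ^ 2) := by
    rw [hM]; ring
  rw [e1]
  linarith [hkey', hS, hQ, e2]

/-- `Σ_x|φ′(x)|²` of the zero extension of a fibre field is the sum over the fibre sites. [cite: Balaban1982Higgs1, (2.4) p.608] -/
theorem sqSum_extendZero (Ω : Finset (HiggsLattice.Site P 0)) (φΩ : ↥Ω → EuclideanSpace ℝ (Fin N)) :
    sqSum (extendZero Ω φΩ) = ∑ x : ↥Ω, ‖φΩ x‖ ^ 2 := by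
  classical
  rw [sqSum]
  have h1 : ∑ x : HiggsLattice.Site P 0, ‖extendZero Ω φΩ x‖ ^ 2 = ∑ x ∈ Ω, ‖extendZero Ω φΩ x‖ ^ 2 := by
    refine (Finset.sum_subset (Finset.subset_univ Ω) fun x _ hx => ?_).symm
    rw [extendZero_of_not_mem Ω φΩ hx, norm_zero]
    ring
  rw [h1, ← Finset.sum_coe_sort Ω]
  refine Finset.sum_congr rfl fun x _ => ?_
  rw [extendZero_of_mem Ω φΩ x.2]

end Bounds

/-! ## 3. The fibre integral `T^η[Ω, exp[…]](φ)`: integrable, positive, bounded, continuous in `A′` -/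

section Fibre

variable {k : ℕ} (D : Data14 P N k)

/-- The Gaussian `exp(−c|v|²)`, `c > 0`, is integrable on `ℝ^N`. [folklore] -/
private theorem integrable_exp_neg_mul_sq_norm {c : ℝ} (hc : 0 < c) :
    Integrable fun v : EuclideanSpace ℝ (Fin N) => Real.exp (-c * ‖v‖ ^ 2) := by
  refine Integrable.of_integral_ne_zero ?_
  rw [GaussianFourier.integral_rexp_neg_mul_sq_norm hc]
  exact (Real.rpow_pos_of_pos (div_pos Real.pi_pos hc) _).ne'

/-- The product Gaussian `Π_{x∈Ω} exp(−c|φ′(x)|²)` is integrable for the product Lebesgue measure `dφ′↾_Ω`.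
[cite: Balaban1982Higgs1, (2.4) p.608] -/
theorem integrable_gauss_fibre {c : ℝ} (hc : 0 < c) :
    Integrable fun φΩ : ↥D.Ω → EuclideanSpace ℝ (Fin N) => ∏ x, Real.exp (-c * ‖φΩ x‖ ^ 2) :=
  Integrable.fintype_prod (f := fun (_ : ↥D.Ω) (v : EuclideanSpace ℝ (Fin N)) => Real.exp (-c * ‖v‖ ^ 2))
    fun _ => integrable_exp_neg_mul_sq_norm hc

/-- **A uniform integrable majorant of the fibre integrand of (1.4)** in regimes (A)/(B): there are `M ≥ 0` and `c > 0`
with `t(Ω; φ, φ′)·exp[…](φ′) ≤ M·Π_{x∈Ω}exp(−c|φ′(x)|²)` for ALL `A′`, `φ`, `φ′↾_Ω`.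
[cite: Balaban1983Higgs3, (1.4) p.412] -/
theorem exists_fibre14_le (ha : 0 ≤ D.a) (hm2 : 0 < D.m2) (hℓ : D.ell ≠ 0) {e' lam' : ℝ}
    (hq : 0 ≤ lam' * D.lamRun) (hreg : 0 < lam' * D.lamRun ∨ ∀ x ∈ D.Ω₁, 0 < D.m2 + D.dm2 e' lam' x)
    (Ak : HiggsLattice.VecField P 0) :
    ∃ M c : ℝ, 0 ≤ M ∧ 0 < c ∧ ∀ (A' : (j : Fin k) → HiggsLattice.VecField P j) (φ : HiggsLattice.ScalarField P k N)
      (φΩ : ↥D.Ω → EuclideanSpace ℝ (Fin N)),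
      D.kernel14 Ak e' A' φ φΩ * D.density14 Ak e' lam' A' (extendZero D.Ω φΩ)
        ≤ M * ∏ x, Real.exp (-c * ‖φΩ x‖ ^ 2) := by
  obtain ⟨K, c, hc, hK⟩ : ∃ K c : ℝ, 0 < c ∧ ∀ (Ak : HiggsLattice.VecField P 0)
      (A' : (j : Fin k) → HiggsLattice.VecField P j) (φ' : HiggsLattice.ScalarField P 0 N),
      D.density14 Ak e' lam' A' φ' ≤ Real.exp (K - c * sqSum φ') := by
    rcases hreg with hA | hB
    · exact density14_le_of_quartic D hm2 hℓ hA
    · exact density14_le_of_mass D hm2 hℓ hq hB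
  set Cκ : ℝ := ((prec (B1.aSeq D.a P.L k) (P.mesh k) P.d / (2 * Real.pi))
      ^ ((Module.finrank ℝ (EuclideanSpace ℝ (Fin N)) : ℝ) / 2)) ^ Fintype.card ↥D.Ωk with hCκ
  have hκ0 : 0 ≤ prec (B1.aSeq D.a P.L k) (P.mesh k) P.d := by
    unfold prec
    exact mul_nonneg (D.aSeq_nonneg' ha k) (zpow_nonneg (P.mesh_pos k).le _)
  have hCκ0 : 0 ≤ Cκ := pow_nonneg (Real.rpow_nonneg (by positivity) _) _
  refine ⟨Cκ * Real.exp K, c, by positivity, hc, fun A' φ φΩ => ?_⟩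
  have h1 := kernel14_le D ha Ak e' A' φ φΩ
  have h2 := hK Ak A' (extendZero D.Ω φΩ)
  have h3 : Real.exp (K - c * sqSum (extendZero D.Ω φΩ)) = Real.exp K * ∏ x, Real.exp (-c * ‖φΩ x‖ ^ 2) := by
    rw [sqSum_extendZero, ← Real.exp_sum, ← Real.exp_add, Finset.mul_sum, sub_eq_add_neg, ← Finset.sum_neg_distrib]
    refine congrArg Real.exp (congrArg _ (Finset.sum_congr rfl fun x _ => ?_))
    ring
  calc D.kernel14 Ak e' A' φ φΩ * D.density14 Ak e' lam' A' (extendZero D.Ω φΩ)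
      ≤ Cκ * Real.exp (K - c * sqSum (extendZero D.Ω φΩ)) :=
        mul_le_mul h1 h2 (D.density14_pos Ak e' lam' A' _).le hCκ0
    _ = Cκ * Real.exp K * ∏ x, Real.exp (-c * ‖φΩ x‖ ^ 2) := by rw [h3, mul_assoc]

/-- **The fibre integrand of (1.4) is integrable over `φ′↾_Ω ∈ (Ω → ℝ^N)`** in regimes (A)/(B) (continuity + the
Gaussian majorant) — the convergent counterpart of `B3Eq15OneSidedInteraction.not_integrable_kernel14_mul_density14`
(`λ′ < 0`). [cite: Balaban1983Higgs3, (1.4) p.412] -/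
theorem integrable_fibre14 (ha : 0 ≤ D.a) (hm2 : 0 < D.m2) (hℓ : D.ell ≠ 0) {e' lam' : ℝ}
    (hq : 0 ≤ lam' * D.lamRun) (hreg : 0 < lam' * D.lamRun ∨ ∀ x ∈ D.Ω₁, 0 < D.m2 + D.dm2 e' lam' x)
    (Ak : HiggsLattice.VecField P 0) (A' : (j : Fin k) → HiggsLattice.VecField P j)
    (φ : HiggsLattice.ScalarField P k N) :
    Integrable fun φΩ : ↥D.Ω → EuclideanSpace ℝ (Fin N) =>
      D.kernel14 Ak e' A' φ φΩ * D.density14 Ak e' lam' A' (extendZero D.Ω φΩ) := by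
  obtain ⟨M, c, hM, hc, hle⟩ := exists_fibre14_le D ha hm2 hℓ hq hreg Ak
  have hcont : Continuous fun φΩ : ↥D.Ω → EuclideanSpace ℝ (Fin N) =>
      D.kernel14 Ak e' A' φ φΩ * D.density14 Ak e' lam' A' (extendZero D.Ω φΩ) :=
    continuous_fibre14 D Ak e' lam' φ continuous_const continuous_id
  refine ((integrable_gauss_fibre D hc).const_mul M).mono' hcont.aestronglyMeasurable
    (Filter.Eventually.of_forall fun φΩ => ?_)
  rw [Real.norm_eq_abs, abs_of_nonneg (mul_nonneg (D.kernel14_nonneg ha Ak e' A' φ φΩ) (D.density14_pos Ak e' lam' A' _).le)]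
  exact hle A' φ φΩ

/-- **`T^η[Ω, exp[…]](φ) > 0`**: the fibre integral of (1.4) is strictly positive (a positive continuous integrable
function against Lebesgue measure), for a non-degenerate kernel `κ = a_k(L^kη)^{d−2} > 0`.
[cite: Balaban1983Higgs3, (1.4) p.412] -/
theorem rt14_density14_pos (ha : 0 < D.a) (hκ : 0 < prec (B1.aSeq D.a P.L k) (P.mesh k) P.d) (hm2 : 0 < D.m2)
    (hℓ : D.ell ≠ 0) {e' lam' : ℝ} (hq : 0 ≤ lam' * D.lamRun)
    (hreg : 0 < lam' * D.lamRun ∨ ∀ x ∈ D.Ω₁, 0 < D.m2 + D.dm2 e' lam' x)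
    (Ak : HiggsLattice.VecField P 0) (A' : (j : Fin k) → HiggsLattice.VecField P j)
    (φ : HiggsLattice.ScalarField P k N) :
    0 < D.rt14 Ak e' A' (D.density14 Ak e' lam' A') φ := by
  rw [Data14.rt14_eq]
  have hpos : ∀ φΩ : ↥D.Ω → EuclideanSpace ℝ (Fin N),
      0 < D.kernel14 Ak e' A' φ φΩ * D.density14 Ak e' lam' A' (extendZero D.Ω φΩ) := fun φΩ => by
    refine mul_pos ?_ (D.density14_pos Ak e' lam' A' _)
    rw [Data14.kernel14_eq]
    exact Finset.prod_pos fun y _ => rtKernel_pos hκ _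
  rw [integral_pos_iff_support_of_nonneg (fun φΩ => (hpos φΩ).le)
    (integrable_fibre14 D ha.le hm2 hℓ hq hreg Ak A' φ)]
  have hsupp : Function.support (fun φΩ : ↥D.Ω → EuclideanSpace ℝ (Fin N) =>
      D.kernel14 Ak e' A' φ φΩ * D.density14 Ak e' lam' A' (extendZero D.Ω φΩ)) = univ :=
    Set.eq_univ_of_forall fun φΩ => (hpos φΩ).ne'
  rw [hsupp]
  exact IsOpen.measure_pos volume isOpen_univ univ_nonempty

/-- **A bound of the fibre integral uniform in the fluctuation family**: `0 < T^η[Ω, exp[…]](φ) ≤ M₀` for all `A′`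
(the integral of the Gaussian majorant). [cite: Balaban1983Higgs3, (1.4) p.412] -/
theorem exists_rt14_density14_le (ha : 0 ≤ D.a) (hm2 : 0 < D.m2) (hℓ : D.ell ≠ 0) {e' lam' : ℝ}
    (hq : 0 ≤ lam' * D.lamRun) (hreg : 0 < lam' * D.lamRun ∨ ∀ x ∈ D.Ω₁, 0 < D.m2 + D.dm2 e' lam' x)
    (Ak : HiggsLattice.VecField P 0) (φ : HiggsLattice.ScalarField P k N) :
    ∃ M₀ : ℝ, ∀ A' : (j : Fin k) → HiggsLattice.VecField P j, D.rt14 Ak e' A' (D.density14 Ak e' lam' A') φ ≤ M₀ := by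
  obtain ⟨M, c, hM, hc, hle⟩ := exists_fibre14_le D ha hm2 hℓ hq hreg Ak
  refine ⟨∫ φΩ : ↥D.Ω → EuclideanSpace ℝ (Fin N), M * ∏ x, Real.exp (-c * ‖φΩ x‖ ^ 2), fun A' => ?_⟩
  rw [Data14.rt14_eq]
  exact integral_mono (integrable_fibre14 D ha hm2 hℓ hq hreg Ak A' φ) ((integrable_gauss_fibre D hc).const_mul M)
    fun φΩ => hle A' φ φΩ

/-- **`A′ ↦ T^η_{a_k,L^k,e′g_kA′+A^{(k)}}[Ω, exp[…]](φ)` is continuous** (dominated convergence with the Gaussian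
majorant; the integrand of the outer Gaussian integrals of (1.4), `Data14.integrand14`).
[cite: Balaban1983Higgs3, (1.4) p.412] -/
theorem continuous_integrand14 (ha : 0 ≤ D.a) (hm2 : 0 < D.m2) (hℓ : D.ell ≠ 0) {e' lam' : ℝ}
    (hq : 0 ≤ lam' * D.lamRun) (hreg : 0 < lam' * D.lamRun ∨ ∀ x ∈ D.Ω₁, 0 < D.m2 + D.dm2 e' lam' x)
    (Ak : HiggsLattice.VecField P 0) (φ : HiggsLattice.ScalarField P k N) :
    Continuous (D.integrand14 e' lam' Ak φ) := by
  obtain ⟨M, c, hM, hc, hle⟩ := exists_fibre14_le D ha hm2 hℓ hq hreg Ak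
  have h := MeasureTheory.continuous_of_dominated
    (F := fun (A' : (j : Fin k) → HiggsLattice.VecField P j) (φΩ : ↥D.Ω → EuclideanSpace ℝ (Fin N)) =>
      D.kernel14 Ak e' A' φ φΩ * D.density14 Ak e' lam' A' (extendZero D.Ω φΩ))
    (bound := fun φΩ => M * ∏ x, Real.exp (-c * ‖φΩ x‖ ^ 2)) (μ := volume)
    (fun A' => (continuous_fibre14 D Ak e' lam' φ continuous_const continuous_id).aestronglyMeasurable)
    (fun A' => Filter.Eventually.of_forall fun φΩ => by
      rw [Real.norm_eq_abs, abs_of_nonneg (mul_nonneg (D.kernel14_nonneg ha Ak e' A' φ φΩ)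
        (D.density14_pos Ak e' lam' A' _).le)]
      exact hle A' φ φΩ)
    ((integrable_gauss_fibre D hc).const_mul M)
    (Filter.Eventually.of_forall fun φΩ =>
      continuous_fibre14 D Ak e' lam' φ continuous_id continuous_const)
  refine h.congr fun A' => ?_
  rw [Data14.integrand14, Data14.rt14_eq]

end Fibre

/-! ## 4. The outer Gaussian integrals: `exp(−E_k)` is a positive convergent integral -/

section Outer

variable {k : ℕ} (D : Data14 P N k)

/-- **The integrand `A′ ↦ T^η[Ω, exp[…]](φ)` of (1.4) is integrable against `Π_{j<k} dμ_{C^{(j),L^jη}}`** (bounded and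
continuous; the product Gaussian measure is a probability measure for `μ₀²(L^kε)² > 0`, `a > 0`, `L > 1`, `k ≤ K`).
[cite: Balaban1983Higgs3, (1.4) p.412] -/
theorem integrable_integrand14 (hmsq : 0 < D.msq) (ha : 0 < D.a) (hL : 1 < (P.L : ℝ)) (hk : k ≤ P.K)
    (hm2 : 0 < D.m2) (hℓ : D.ell ≠ 0) {e' lam' : ℝ} (hq : 0 ≤ lam' * D.lamRun)
    (hreg : 0 < lam' * D.lamRun ∨ ∀ x ∈ D.Ω₁, 0 < D.m2 + D.dm2 e' lam' x)
    (Ak : HiggsLattice.VecField P 0) (φ : HiggsLattice.ScalarField P k N) :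
    Integrable (D.integrand14 e' lam' Ak φ) (fluctFamily P D.msq D.a k) := by
  haveI := HiggsFluctMeasurePos.fluctFamily_isProbability (P := P) hmsq ha hL hk
  obtain ⟨M₀, hM₀⟩ := exists_rt14_density14_le D ha.le hm2 hℓ hq hreg Ak φ
  refine (integrable_const M₀).mono' (continuous_integrand14 D ha.le hm2 hℓ hq hreg Ak φ).aestronglyMeasurable
    (Filter.Eventually.of_forall fun A' => ?_)
  have h0 : 0 ≤ D.integrand14 e' lam' Ak φ A' := by
    rw [Data14.integrand14, Data14.rt14_eq]
    exact integral_nonneg fun φΩ => mul_nonneg (D.kernel14_nonneg ha.le Ak e' A' φ φΩ)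
      (D.density14_pos Ak e' lam' A' _).le
  rw [Real.norm_eq_abs, abs_of_nonneg h0]
  exact hM₀ A'

/-- **`Π_{j<k}∫dμ_{C^{(j),L^jη}}(A′_j) T^η[Ω, exp[…]](φ) > 0`: the integral behind (1.4) CONVERGES and is STRICTLY
POSITIVE** on the half-line `λ′ ≥ 0` (regimes (A)/(B)), for every `e′`, `A^{(k)}`, `φ`.
[cite: Balaban1983Higgs3, (1.4) p.412] -/
theorem integral_integrand14_pos (hmsq : 0 < D.msq) (ha : 0 < D.a) (hL : 1 < (P.L : ℝ)) (hk1 : 1 ≤ k)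
    (hk : k ≤ P.K) (hm2 : 0 < D.m2) (hℓ : D.ell ≠ 0) {e' lam' : ℝ} (hq : 0 ≤ lam' * D.lamRun)
    (hreg : 0 < lam' * D.lamRun ∨ ∀ x ∈ D.Ω₁, 0 < D.m2 + D.dm2 e' lam' x)
    (Ak : HiggsLattice.VecField P 0) (φ : HiggsLattice.ScalarField P k N) :
    0 < ∫ A', D.integrand14 e' lam' Ak φ A' ∂(fluctFamily P D.msq D.a k) := by
  haveI := HiggsFluctMeasurePos.fluctFamily_isProbability (P := P) hmsq ha hL hk
  have hκ := prec_pos D ha hL hk1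
  have hpos : ∀ A', 0 < D.integrand14 e' lam' Ak φ A' := fun A' => by
    rw [Data14.integrand14]
    exact rt14_density14_pos D ha hκ hm2 hℓ hq hreg Ak A' φ
  rw [integral_pos_iff_support_of_nonneg (fun A' => (hpos A').le)
    (integrable_integrand14 D hmsq ha hL hk hm2 hℓ hq hreg Ak φ)]
  have hsupp : Function.support (D.integrand14 e' lam' Ak φ) = univ :=
    Set.eq_univ_of_forall fun A' => (hpos A').ne'
  rw [hsupp, measure_univ]
  exact zero_lt_one

/-- **(1.4) IS WELL DEFINED ON `λ′ ≥ 0`: `exp(−E_k(e′, λ′, Ω, A^{(k)}, φ)) = Π_{j<k}∫dμ_{C^{(j)}}(A′_j) T^η[Ω, exp[…]](φ)`**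
— the typed `Data14.auxE` is the logarithm of a genuinely positive number (not a Lebesgue junk value) in regimes (A)/(B).
[cite: Balaban1983Higgs3, (1.4) p.412] -/
theorem exp_neg_auxE_eq (hmsq : 0 < D.msq) (ha : 0 < D.a) (hL : 1 < (P.L : ℝ)) (hk1 : 1 ≤ k) (hk : k ≤ P.K)
    (hm2 : 0 < D.m2) (hℓ : D.ell ≠ 0) {e' lam' : ℝ} (hq : 0 ≤ lam' * D.lamRun)
    (hreg : 0 < lam' * D.lamRun ∨ ∀ x ∈ D.Ω₁, 0 < D.m2 + D.dm2 e' lam' x)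
    (Ak : HiggsLattice.VecField P 0) (φ : HiggsLattice.ScalarField P k N) :
    Real.exp (-(D.auxE e' lam' Ak φ)) = ∫ A', D.integrand14 e' lam' Ak φ A' ∂(fluctFamily P D.msq D.a k) := by
  rw [Data14.auxE, neg_neg, Real.exp_log (integral_integrand14_pos D hmsq ha hL hk1 hk hm2 hℓ hq hreg Ak φ)]

/-- **The base point of (1.5).**  At `e′ = λ′ = 0` (where the one-sided derivatives of the repaired (1.5)
`interaction15R` are taken and whose value `E_k(0, 0, Ω, A^{(k)}, φ)` is subtracted) the integral of (1.4) is positive and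
`exp(−E_k(0,0,…))` equals it, given a positive total mass `m² + δm²(0, 0, x) > 0` on `Ω₁`.
[cite: Balaban1983Higgs3, (1.5) p.412] -/
theorem integral_integrand14_pos_zero (hmsq : 0 < D.msq) (ha : 0 < D.a) (hL : 1 < (P.L : ℝ)) (hk1 : 1 ≤ k)
    (hk : k ≤ P.K) (hm2 : 0 < D.m2) (hℓ : D.ell ≠ 0) (hmass : ∀ x ∈ D.Ω₁, 0 < D.m2 + D.dm2 0 0 x)
    (Ak : HiggsLattice.VecField P 0) (φ : HiggsLattice.ScalarField P k N) :
    0 < ∫ A', D.integrand14 0 0 Ak φ A' ∂(fluctFamily P D.msq D.a k) ∧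
      Real.exp (-(D.auxE 0 0 Ak φ)) = ∫ A', D.integrand14 0 0 Ak φ A' ∂(fluctFamily P D.msq D.a k) :=
  ⟨integral_integrand14_pos D hmsq ha hL hk1 hk hm2 hℓ (by rw [zero_mul]) (Or.inr hmass) Ak φ,
    exp_neg_auxE_eq D hmsq ha hL hk1 hk hm2 hℓ (by rw [zero_mul]) (Or.inr hmass) Ak φ⟩

/-- **THE DICHOTOMY of the typed (1.4) in the sign of `λ′`** (with the typer g24 audit
`B3Eq15OneSidedInteraction.auxE_eq_zero_of_neg`): for `N ≥ 1`, `λ(L^kε) > 0`, `Ω ∩ Ω₁ ≠ ∅` and the standing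
non-degeneracy of the model (`μ₀²(L^kε)² > 0`, `a > 0`, `L > 1`, `1 ≤ k ≤ K`, `m² > 0`, `L^kε ≠ 0`):
`λ′ < 0 ⇒` the integral of (1.4) is Lean's `0` and `E_k = 0`; `λ′ > 0 ⇒` the integral is `> 0` and `exp(−E_k)` equals
it — the typed `E_k` is the printed object exactly on `λ′ ≥ 0`, the half-line of the repaired one-sided (1.5).
[cite: Balaban1983Higgs3, (1.4)–(1.5) p.412] -/
theorem auxE_dichotomy (hN : 1 ≤ N) (hmsq : 0 < D.msq) (ha : 0 < D.a) (hL : 1 < (P.L : ℝ)) (hk1 : 1 ≤ k)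
    (hk : k ≤ P.K) (hm2 : 0 < D.m2) (hℓ : D.ell ≠ 0) (hrun : 0 < D.lamRun) {x₀ : HiggsLattice.Site P 0}
    (hx₀Ω : x₀ ∈ D.Ω) (hx₀1 : x₀ ∈ D.Ω₁) (e' : ℝ) (Ak : HiggsLattice.VecField P 0)
    (φ : HiggsLattice.ScalarField P k N) (lam' : ℝ) :
    (lam' < 0 →
        (∫ A', D.integrand14 e' lam' Ak φ A' ∂(fluctFamily P D.msq D.a k)) = 0 ∧ D.auxE e' lam' Ak φ = 0) ∧
      (0 < lam' →
        0 < (∫ A', D.integrand14 e' lam' Ak φ A' ∂(fluctFamily P D.msq D.a k)) ∧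
          Real.exp (-(D.auxE e' lam' Ak φ)) = ∫ A', D.integrand14 e' lam' Ak φ A' ∂(fluctFamily P D.msq D.a k)) := by
  have hκ := prec_pos D ha hL hk1
  refine ⟨fun hlam => ?_, fun hlam => ?_⟩
  · have h0 : ∀ A', D.integrand14 e' lam' Ak φ A' = 0 := fun A' => by
      rw [Data14.integrand14]
      exact B3Eq15OneSidedInteraction.rt14_density14_eq_zero_of_neg D hN hκ hlam hrun hx₀Ω hx₀1 Ak e' A' φ
    refine ⟨?_, B3Eq15OneSidedInteraction.auxE_eq_zero_of_neg D hN hκ hlam hrun hx₀Ω hx₀1 e' Ak φ⟩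
    simp only [h0, integral_zero]
  · have hq : 0 < lam' * D.lamRun := mul_pos hlam hrun
    exact ⟨integral_integrand14_pos D hmsq ha hL hk1 hk hm2 hℓ hq.le (Or.inl hq) Ak φ,
      exp_neg_auxE_eq D hmsq ha hL hk1 hk hm2 hℓ hq.le (Or.inl hq) Ak φ⟩

end Outer

/-! ## 5. `E_k(e′, λ′, Ω, ·, ·)` is a CONTINUOUS function of the fields `(A^{(k)}, φ)` on `λ′ ≥ 0` (v1.1) -/

section FieldContinuity

variable {k : ℕ} (D : Data14 P N k)
variable {X : Type*} [TopologicalSpace X]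

/-- `(A^{(k)}, A′) ↦ e′g_kA′ + A^{(k)}` is jointly continuous. [cite: Balaban1983Higgs3, (1.4) p.412] -/
theorem continuous_extField₂ (e' : ℝ) {Ak : X → HiggsLattice.VecField P 0}
    {A' : X → ((j : Fin k) → HiggsLattice.VecField P j)} (hAk : Continuous Ak) (hA : Continuous A') :
    Continuous fun t => D.extField (Ak t) e' (A' t) := by
  have h : Continuous fun t => e' • siteMul D.g (D.fluctSum (A' t)) + Ak t :=
    (Continuous.fun_const_smul ((continuous_siteMul D.g).comp ((continuous_fluctSum D).comp hA)) e').add hAk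
  exact h.congr fun t => (D.extField_eq (Ak t) e' (A' t)).symm

/-- `(A^{(k)}, A′) ↦ 𝒜(Γ^{(k)}_{y,x})` (1.3) is jointly continuous (the top field enters (1.3) linearly).
[cite: Balaban1983Higgs3, (1.3) p.412] -/
theorem continuous_contour13₂ (e' : ℝ) (x : HiggsLattice.Site P 0) {Ak : X → HiggsLattice.VecField P 0}
    {A' : X → ((j : Fin k) → HiggsLattice.VecField P j)} (hAk : Continuous Ak) (hA : Continuous A') :
    Continuous fun t => contour13 k (D.extPieces e' (A' t)) (Ak t) x := by
  have h : Continuous fun t =>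
      (∑ j ∈ Finset.range k, P.mesh 0 * multiContourSum (D.extPieces e' (A' t) j) (j + 1) x)
        + P.mesh 0 * multiContourSum (Ak t) k x :=
    (continuous_finsetSum _ fun j _ => continuous_const.mul
      ((HiggsCovarianceCont.continuous_multiContourSum (j + 1) x).comp ((continuous_extPieces D e' j).comp hA))).add
      (continuous_const.mul ((HiggsCovarianceCont.continuous_multiContourSum k x).comp hAk))
  exact h.congr fun t => rfl

/-- **`(A^{(k)}, A′, φ′) ↦ Q_k(e′g_kA′ + A^{(k)})φ′` is jointly continuous.** [cite: Balaban1983Higgs3, (1.3)–(1.4) p.412] -/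
theorem continuous_avgQ14₃ (e' : ℝ) {Ak : X → HiggsLattice.VecField P 0}
    {A' : X → ((j : Fin k) → HiggsLattice.VecField P j)} {φ' : X → HiggsLattice.ScalarField P 0 N}
    (hAk : Continuous Ak) (hA : Continuous A') (hφ : Continuous φ') :
    Continuous fun t => D.avgQ14 (Ak t) e' (A' t) (φ' t) := by
  refine continuous_pi fun y => ?_
  simp_rw [Data14.avgQ14_apply]
  refine Continuous.fun_const_smul (continuous_finsetSum _ fun x _ => ?_) _
  unfold holK13
  exact ((continuous_chargeU D.C 1).comp (continuous_contour13₂ D e' x hAk hA)).clm_apply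
    ((continuous_apply x).comp hφ)

/-- **The kernel `t(Ω; φ, φ′)` of (1.4) is jointly continuous in ALL its fields `(A^{(k)}, A′, φ, φ′↾_Ω)`.**
[cite: Balaban1982Higgs1, (2.10) p.609] -/
theorem continuous_kernel14₄ (e' : ℝ) {Ak : X → HiggsLattice.VecField P 0}
    {A' : X → ((j : Fin k) → HiggsLattice.VecField P j)} {φ : X → HiggsLattice.ScalarField P k N}
    {φΩ : X → (↥D.Ω → EuclideanSpace ℝ (Fin N))} (hAk : Continuous Ak) (hA : Continuous A')
    (hφ : Continuous φ) (hφΩ : Continuous φΩ) :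
    Continuous fun t => D.kernel14 (Ak t) e' (A' t) (φ t) (φΩ t) := by
  simp_rw [Data14.kernel14_eq]
  refine continuous_finsetProd _ fun y _ => (continuous_rtKernel _).comp ?_
  exact ((continuous_apply y.1).comp hφ).sub ((continuous_apply y.1).comp
    (continuous_avgQ14₃ D e' hAk hA ((continuous_extendZero D.Ω).comp hφΩ)))

/-- **The density `exp[…](φ′)` of (1.4) is jointly continuous in `(A^{(k)}, A′, φ′)`.** [cite: Balaban1983Higgs3, (1.4) p.412] -/
theorem continuous_density14₃ (e' lam' : ℝ) {Ak : X → HiggsLattice.VecField P 0}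
    {A' : X → ((j : Fin k) → HiggsLattice.VecField P j)} {φ' : X → HiggsLattice.ScalarField P 0 N}
    (hAk : Continuous Ak) (hA : Continuous A') (hφ : Continuous φ') :
    Continuous fun t => D.density14 (Ak t) e' lam' (A' t) (φ' t) := by
  have hφx : ∀ x : HiggsLattice.Site P 0, Continuous fun t => ‖φ' t x‖ :=
    fun x => ((continuous_apply x).comp hφ).norm
  have hop : Continuous fun t => D.scalarOp (Ak t) e' (A' t) (φ' t) := by
    have h : Continuous fun t =>
        covLaplacianN D.C D.Ω (D.extField (Ak t) e' (A' t)) (φ' t) + (D.m2 * D.ell ^ 2) • φ' t :=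
      (HiggsCovarianceCont.continuous_covLaplacianN D.C D.Ω (continuous_extField₂ D e' hAk hA) hφ).add
        (hφ.fun_const_smul (D.m2 * D.ell ^ 2))
    refine h.congr fun t => ?_
    rw [Data14.scalarOp_eq, LinearMap.add_apply, LinearMap.smul_apply, LinearMap.id_apply]
  have h1 : Continuous fun t => siteInner (φ' t) (D.scalarOp (Ak t) e' (A' t) (φ' t)) :=
    HiggsFluctMeasure.continuous_siteInner hφ hop
  have h2 : Continuous fun t => ∑ x ∈ D.Ω₁, P.mesh 0 ^ P.d * ‖φ' t x‖ ^ 4 :=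
    continuous_finsetSum _ fun x _ => continuous_const.mul ((hφx x).pow 4)
  have h3 : Continuous fun t => ∑ x ∈ D.Ω₁, P.mesh 0 ^ P.d * D.dm2 e' lam' x * D.ell ^ 2 * ‖φ' t x‖ ^ 2 :=
    continuous_finsetSum _ fun x _ => continuous_const.mul ((hφx x).pow 2)
  have h12 : Continuous fun t => -(1 / 2 : ℝ) * siteInner (φ' t) (D.scalarOp (Ak t) e' (A' t) (φ' t))
      - lam' * D.lamRun * ∑ x ∈ D.Ω₁, P.mesh 0 ^ P.d * ‖φ' t x‖ ^ 4 :=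
    (continuous_const.mul h1).sub (continuous_const.mul h2)
  have h123 : Continuous fun t => -(1 / 2 : ℝ) * siteInner (φ' t) (D.scalarOp (Ak t) e' (A' t) (φ' t))
      - lam' * D.lamRun * ∑ x ∈ D.Ω₁, P.mesh 0 ^ P.d * ‖φ' t x‖ ^ 4
      - (1 / 2 : ℝ) * ∑ x ∈ D.Ω₁, P.mesh 0 ^ P.d * D.dm2 e' lam' x * D.ell ^ 2 * ‖φ' t x‖ ^ 2 :=
    h12.sub (continuous_const.mul h3)
  have h : Continuous fun t => Real.exp (-(1 / 2 : ℝ) * siteInner (φ' t) (D.scalarOp (Ak t) e' (A' t) (φ' t))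
      - lam' * D.lamRun * ∑ x ∈ D.Ω₁, P.mesh 0 ^ P.d * ‖φ' t x‖ ^ 4
      - (1 / 2 : ℝ) * ∑ x ∈ D.Ω₁, P.mesh 0 ^ P.d * D.dm2 e' lam' x * D.ell ^ 2 * ‖φ' t x‖ ^ 2
      - D.E1 e' lam') :=
    (h123.sub continuous_const).rexp
  exact h.congr fun t => (D.density14_eq (Ak t) e' lam' (A' t) (φ' t)).symm

/-- **The fibre integrand of (1.4) is jointly continuous in `(A^{(k)}, A′, φ, φ′↾_Ω)`.** [cite: Balaban1983Higgs3, (1.4) p.412] -/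
theorem continuous_fibre14₄ (e' lam' : ℝ) {Ak : X → HiggsLattice.VecField P 0}
    {A' : X → ((j : Fin k) → HiggsLattice.VecField P j)} {φ : X → HiggsLattice.ScalarField P k N}
    {φΩ : X → (↥D.Ω → EuclideanSpace ℝ (Fin N))} (hAk : Continuous Ak) (hA : Continuous A')
    (hφ : Continuous φ) (hφΩ : Continuous φΩ) :
    Continuous fun t => D.kernel14 (Ak t) e' (A' t) (φ t) (φΩ t)
      * D.density14 (Ak t) e' lam' (A' t) (extendZero D.Ω (φΩ t)) :=
  (continuous_kernel14₄ D e' hAk hA hφ hφΩ).mul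
    (continuous_density14₃ D e' lam' hAk hA ((continuous_extendZero D.Ω).comp hφΩ))

/-- The Gaussian majorant of §3 is uniform in ALL fields (`A^{(k)}`, `A′`, `φ`, `φ′↾_Ω`).
[cite: Balaban1983Higgs3, (1.4) p.412] -/
theorem exists_fibre14_le_unif (ha : 0 ≤ D.a) (hm2 : 0 < D.m2) (hℓ : D.ell ≠ 0) {e' lam' : ℝ}
    (hq : 0 ≤ lam' * D.lamRun) (hreg : 0 < lam' * D.lamRun ∨ ∀ x ∈ D.Ω₁, 0 < D.m2 + D.dm2 e' lam' x) :
    ∃ M c : ℝ, 0 ≤ M ∧ 0 < c ∧ ∀ (Ak : HiggsLattice.VecField P 0) (A' : (j : Fin k) → HiggsLattice.VecField P j)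
      (φ : HiggsLattice.ScalarField P k N) (φΩ : ↥D.Ω → EuclideanSpace ℝ (Fin N)),
      D.kernel14 Ak e' A' φ φΩ * D.density14 Ak e' lam' A' (extendZero D.Ω φΩ)
        ≤ M * ∏ x, Real.exp (-c * ‖φΩ x‖ ^ 2) := by
  obtain ⟨K, c, hc, hK⟩ : ∃ K c : ℝ, 0 < c ∧ ∀ (Ak : HiggsLattice.VecField P 0)
      (A' : (j : Fin k) → HiggsLattice.VecField P j) (φ' : HiggsLattice.ScalarField P 0 N),
      D.density14 Ak e' lam' A' φ' ≤ Real.exp (K - c * sqSum φ') := by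
    rcases hreg with hA | hB
    · exact density14_le_of_quartic D hm2 hℓ hA
    · exact density14_le_of_mass D hm2 hℓ hq hB
  set Cκ : ℝ := ((prec (B1.aSeq D.a P.L k) (P.mesh k) P.d / (2 * Real.pi))
      ^ ((Module.finrank ℝ (EuclideanSpace ℝ (Fin N)) : ℝ) / 2)) ^ Fintype.card ↥D.Ωk with hCκ
  have hκ0 : 0 ≤ prec (B1.aSeq D.a P.L k) (P.mesh k) P.d := by
    unfold prec
    exact mul_nonneg (D.aSeq_nonneg' ha k) (zpow_nonneg (P.mesh_pos k).le _)
  have hCκ0 : 0 ≤ Cκ := pow_nonneg (Real.rpow_nonneg (by positivity) _) _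
  refine ⟨Cκ * Real.exp K, c, by positivity, hc, fun Ak A' φ φΩ => ?_⟩
  have h1 := kernel14_le D ha Ak e' A' φ φΩ
  have h2 := hK Ak A' (extendZero D.Ω φΩ)
  have h3 : Real.exp (K - c * sqSum (extendZero D.Ω φΩ)) = Real.exp K * ∏ x, Real.exp (-c * ‖φΩ x‖ ^ 2) := by
    rw [sqSum_extendZero, ← Real.exp_sum, ← Real.exp_add, Finset.mul_sum, sub_eq_add_neg, ← Finset.sum_neg_distrib]
    refine congrArg Real.exp (congrArg _ (Finset.sum_congr rfl fun x _ => ?_))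
    ring
  calc D.kernel14 Ak e' A' φ φΩ * D.density14 Ak e' lam' A' (extendZero D.Ω φΩ)
      ≤ Cκ * Real.exp (K - c * sqSum (extendZero D.Ω φΩ)) :=
        mul_le_mul h1 h2 (D.density14_pos Ak e' lam' A' _).le hCκ0
    _ = Cκ * Real.exp K * ∏ x, Real.exp (-c * ‖φΩ x‖ ^ 2) := by rw [h3, mul_assoc]

/-- **`(A^{(k)}, φ, A′) ↦ T^η_{a_k,L^k,e′g_kA′+A^{(k)}}[Ω, exp[…]](φ)` is jointly continuous** along any continuous
family of fields (dominated convergence, the majorant being uniform in all fields). [cite: Balaban1983Higgs3, (1.4) p.412] -/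
theorem continuous_integrand14₃ [FirstCountableTopology X] (ha : 0 ≤ D.a) (hm2 : 0 < D.m2) (hℓ : D.ell ≠ 0)
    {e' lam' : ℝ} (hq : 0 ≤ lam' * D.lamRun) (hreg : 0 < lam' * D.lamRun ∨ ∀ x ∈ D.Ω₁, 0 < D.m2 + D.dm2 e' lam' x)
    {Ak : X → HiggsLattice.VecField P 0} {φ : X → HiggsLattice.ScalarField P k N}
    {A' : X → ((j : Fin k) → HiggsLattice.VecField P j)} (hAk : Continuous Ak) (hφ : Continuous φ)
    (hA : Continuous A') : Continuous fun t => D.integrand14 e' lam' (Ak t) (φ t) (A' t) := by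
  obtain ⟨M, c, hM, hc, hle⟩ := exists_fibre14_le_unif D ha hm2 hℓ hq hreg
  have h := MeasureTheory.continuous_of_dominated
    (F := fun (t : X) (φΩ : ↥D.Ω → EuclideanSpace ℝ (Fin N)) =>
      D.kernel14 (Ak t) e' (A' t) (φ t) φΩ * D.density14 (Ak t) e' lam' (A' t) (extendZero D.Ω φΩ))
    (bound := fun φΩ => M * ∏ x, Real.exp (-c * ‖φΩ x‖ ^ 2)) (μ := volume)
    (fun t => (continuous_fibre14₄ D e' lam' continuous_const continuous_const continuous_const
      continuous_id).aestronglyMeasurable)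
    (fun t => Filter.Eventually.of_forall fun φΩ => by
      rw [Real.norm_eq_abs, abs_of_nonneg (mul_nonneg (D.kernel14_nonneg ha (Ak t) e' (A' t) (φ t) φΩ)
        (D.density14_pos (Ak t) e' lam' (A' t) _).le)]
      exact hle (Ak t) (A' t) (φ t) φΩ)
    ((integrable_gauss_fibre D hc).const_mul M)
    (Filter.Eventually.of_forall fun φΩ => continuous_fibre14₄ D e' lam' hAk hA hφ continuous_const)
  refine h.congr fun t => ?_
  rw [Data14.integrand14, Data14.rt14_eq]

/-- **`(A^{(k)}, φ) ↦ Π_{j<k}∫dμ_{C^{(j),L^jη}}(A′_j) T^η[Ω, exp[…]](φ)` — the integral behind (1.4) — is jointly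
continuous in the fields** (dominated convergence against the probability measure `fluctFamily`, constant majorant).
[cite: Balaban1983Higgs3, (1.4) p.412] -/
theorem continuous_integral_integrand14 (hmsq : 0 < D.msq) (ha : 0 < D.a) (hL : 1 < (P.L : ℝ)) (hk : k ≤ P.K)
    (hm2 : 0 < D.m2) (hℓ : D.ell ≠ 0) {e' lam' : ℝ} (hq : 0 ≤ lam' * D.lamRun)
    (hreg : 0 < lam' * D.lamRun ∨ ∀ x ∈ D.Ω₁, 0 < D.m2 + D.dm2 e' lam' x) :
    Continuous fun p : HiggsLattice.VecField P 0 × HiggsLattice.ScalarField P k N =>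
      ∫ A', D.integrand14 e' lam' p.1 p.2 A' ∂(fluctFamily P D.msq D.a k) := by
  haveI := HiggsFluctMeasurePos.fluctFamily_isProbability (P := P) hmsq ha hL hk
  obtain ⟨M, c, hM, hc, hle⟩ := exists_fibre14_le_unif D ha.le hm2 hℓ hq hreg
  set M₀ : ℝ := ∫ φΩ : ↥D.Ω → EuclideanSpace ℝ (Fin N), M * ∏ x, Real.exp (-c * ‖φΩ x‖ ^ 2) with hM₀
  have hbd : ∀ (Ak : HiggsLattice.VecField P 0) (φ : HiggsLattice.ScalarField P k N)
      (A' : (j : Fin k) → HiggsLattice.VecField P j), ‖D.integrand14 e' lam' Ak φ A'‖ ≤ M₀ := by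
    intro Ak φ A'
    have h0 : 0 ≤ D.integrand14 e' lam' Ak φ A' := by
      rw [Data14.integrand14, Data14.rt14_eq]
      exact integral_nonneg fun φΩ => mul_nonneg (D.kernel14_nonneg ha.le Ak e' A' φ φΩ)
        (D.density14_pos Ak e' lam' A' _).le
    rw [Real.norm_eq_abs, abs_of_nonneg h0, Data14.integrand14, Data14.rt14_eq, hM₀]
    exact integral_mono (integrable_fibre14 D ha.le hm2 hℓ hq hreg Ak A' φ)
      ((integrable_gauss_fibre D hc).const_mul M) fun φΩ => hle Ak A' φ φΩ
  exact MeasureTheory.continuous_of_dominated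
    (F := fun (p : HiggsLattice.VecField P 0 × HiggsLattice.ScalarField P k N)
      (A' : (j : Fin k) → HiggsLattice.VecField P j) => D.integrand14 e' lam' p.1 p.2 A')
    (bound := fun _ => M₀)
    (fun p => (continuous_integrand14₃ D ha.le hm2 hℓ hq hreg continuous_const continuous_const
      continuous_id).aestronglyMeasurable)
    (fun p => Filter.Eventually.of_forall fun A' => hbd p.1 p.2 A')
    (integrable_const M₀)
    (Filter.Eventually.of_forall fun A' =>
      continuous_integrand14₃ D ha.le hm2 hℓ hq hreg continuous_fst continuous_snd continuous_const)

/-- **`E_k(e′, λ′, Ω, A^{(k)}, φ)` is a CONTINUOUS function of the fields `(A^{(k)}, φ)`** on `λ′ ≥ 0` (regimes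
(A)/(B)): `−log` of a positive continuous function.  (The effective interaction is integrated against the new fields
downstream; this is the zeroth-order regularity the typed (1.4) has.) [cite: Balaban1983Higgs3, (1.4) p.412] -/
theorem continuous_auxE (hmsq : 0 < D.msq) (ha : 0 < D.a) (hL : 1 < (P.L : ℝ)) (hk1 : 1 ≤ k) (hk : k ≤ P.K)
    (hm2 : 0 < D.m2) (hℓ : D.ell ≠ 0) {e' lam' : ℝ} (hq : 0 ≤ lam' * D.lamRun)
    (hreg : 0 < lam' * D.lamRun ∨ ∀ x ∈ D.Ω₁, 0 < D.m2 + D.dm2 e' lam' x) :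
    Continuous fun p : HiggsLattice.VecField P 0 × HiggsLattice.ScalarField P k N => D.auxE e' lam' p.1 p.2 := by
  have hZ := continuous_integral_integrand14 D hmsq ha hL hk hm2 hℓ hq hreg
  have hpos : ∀ p : HiggsLattice.VecField P 0 × HiggsLattice.ScalarField P k N,
      0 < ∫ A', D.integrand14 e' lam' p.1 p.2 A' ∂(fluctFamily P D.msq D.a k) :=
    fun p => integral_integrand14_pos D hmsq ha hL hk1 hk hm2 hℓ hq hreg p.1 p.2
  have hlog : Continuous fun p : HiggsLattice.VecField P 0 × HiggsLattice.ScalarField P k N =>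
      Real.log (∫ A', D.integrand14 e' lam' p.1 p.2 A' ∂(fluctFamily P D.msq D.a k)) :=
    hZ.log fun p => (hpos p).ne'
  have e : (fun p : HiggsLattice.VecField P 0 × HiggsLattice.ScalarField P k N => D.auxE e' lam' p.1 p.2)
      = fun p => -Real.log (∫ A', D.integrand14 e' lam' p.1 p.2 A' ∂(fluctFamily P D.msq D.a k)) := by
    funext p; rfl
  rw [e]
  exact hlog.neg

end FieldContinuity

/-! ## 6. A priori bounds uniform in the fields: `E₀ ≤ E_k ≤ C + a_k(L^kη)^{d−2}Σ_{y∈Ω^{(k)}}|φ(y)|²` (v1.2) -/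

section Bounds2

variable {k : ℕ} (D : Data14 P N k)

/-- **`E_k` is BOUNDED BELOW uniformly in the fields** `(A^{(k)}, φ)` on `λ′ ≥ 0` (regimes (A)/(B)): `∃ E₀, E₀ ≤
E_k(e′, λ′, Ω, A^{(k)}, φ)` for all `A^{(k)}, φ` — equivalently the Boltzmann factor `exp(−E_k) ≤ exp(−E₀)` (the nested
integral of (1.4) is bounded by the integral of the field-uniform Gaussian majorant). (ours; a property of the typed
(1.4), not a printed display) [cite: Balaban1983Higgs3, (1.4) p.412] -/
theorem exists_le_auxE (hmsq : 0 < D.msq) (ha : 0 < D.a) (hL : 1 < (P.L : ℝ)) (hk1 : 1 ≤ k) (hk : k ≤ P.K)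
    (hm2 : 0 < D.m2) (hℓ : D.ell ≠ 0) {e' lam' : ℝ} (hq : 0 ≤ lam' * D.lamRun)
    (hreg : 0 < lam' * D.lamRun ∨ ∀ x ∈ D.Ω₁, 0 < D.m2 + D.dm2 e' lam' x) :
    ∃ E₀ : ℝ, ∀ (Ak : HiggsLattice.VecField P 0) (φ : HiggsLattice.ScalarField P k N), E₀ ≤ D.auxE e' lam' Ak φ := by
  haveI := HiggsFluctMeasurePos.fluctFamily_isProbability (P := P) hmsq ha hL hk
  obtain ⟨M, c, hM, hc, hle⟩ := exists_fibre14_le_unif D ha.le hm2 hℓ hq hreg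
  set M₀ : ℝ := ∫ φΩ : ↥D.Ω → EuclideanSpace ℝ (Fin N), M * ∏ x, Real.exp (-c * ‖φΩ x‖ ^ 2) with hM₀
  refine ⟨-Real.log M₀, fun Ak φ => ?_⟩
  have hpt : ∀ A' : (j : Fin k) → HiggsLattice.VecField P j, D.integrand14 e' lam' Ak φ A' ≤ M₀ := by
    intro A'
    rw [Data14.integrand14, Data14.rt14_eq, hM₀]
    exact integral_mono (integrable_fibre14 D ha.le hm2 hℓ hq hreg Ak A' φ)
      ((integrable_gauss_fibre D hc).const_mul M) fun φΩ => hle Ak A' φ φΩ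
  have hZle : (∫ A', D.integrand14 e' lam' Ak φ A' ∂(fluctFamily P D.msq D.a k)) ≤ M₀ := by
    have h := integral_mono (integrable_integrand14 D hmsq ha hL hk hm2 hℓ hq hreg Ak φ)
      (integrable_const M₀) hpt
    simpa [integral_const, measure_univ] using h
  have hZpos := integral_integrand14_pos D hmsq ha hL hk1 hk hm2 hℓ hq hreg Ak φ
  have hlog := Real.log_le_log hZpos hZle
  have e : D.auxE e' lam' Ak φ = -Real.log (∫ A', D.integrand14 e' lam' Ak φ A' ∂(fluctFamily P D.msq D.a k)) := rfl
  rw [e]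
  linarith

/-- **Lower bound of the density of (1.4) at ANY `λ′`, keeping the quartic term**: `exp[…](φ′) ≥
exp(−λ′λ(L^kε)Σ_{x∈Ω₁}η^d|φ′(x)|⁴ − C₂Σ_x|φ′(x)|² − E₁(e′,λ′))` with the explicit
`C₂ = ½(4dη⁻² + |m²|(L^kε)²)η^d + ½η^d(L^kε)²Σ_{x∈Ω₁}|δm²(e′,λ′,x)|` (the quadratic form from above by
`B3Eq15OneSidedInteraction.siteInner_scalarOp_le`, the counterterm sitewise), uniformly in `A′`, `A^{(k)}`.
[cite: Balaban1983Higgs3, (1.4) p.412] -/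
theorem density14_ge_quartic (Ak : HiggsLattice.VecField P 0) (e' lam' : ℝ) (A' : (j : Fin k) → HiggsLattice.VecField P j)
    (φ' : HiggsLattice.ScalarField P 0 N) :
    Real.exp (-(lam' * D.lamRun * ∑ x ∈ D.Ω₁, P.mesh 0 ^ P.d * ‖φ' x‖ ^ 4)
        - (((4 * P.d * (P.mesh 0)⁻¹ ^ 2 + |D.m2| * D.ell ^ 2) * P.mesh 0 ^ P.d) / 2
            + (P.mesh 0 ^ P.d * D.ell ^ 2 * ∑ x ∈ D.Ω₁, |D.dm2 e' lam' x|) / 2) * sqSum φ'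
        - D.E1 e' lam')
      ≤ D.density14 Ak e' lam' A' φ' := by
  have hη : 0 < P.mesh 0 ^ P.d := pow_pos (P.mesh_pos 0) _
  rw [Data14.density14_eq, Real.exp_le_exp]
  have h1 := B3Eq15OneSidedInteraction.siteInner_scalarOp_le D Ak e' A' φ'
  have h3 : ∑ x ∈ D.Ω₁, P.mesh 0 ^ P.d * D.dm2 e' lam' x * D.ell ^ 2 * ‖φ' x‖ ^ 2
      ≤ (P.mesh 0 ^ P.d * D.ell ^ 2 * ∑ x ∈ D.Ω₁, |D.dm2 e' lam' x|) * sqSum φ' := by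
    rw [Finset.mul_sum, Finset.sum_mul]
    refine Finset.sum_le_sum fun x _ => ?_
    have ha : D.dm2 e' lam' x * ‖φ' x‖ ^ 2 ≤ |D.dm2 e' lam' x| * sqSum φ' :=
      (mul_le_mul_of_nonneg_right (le_abs_self _) (sq_nonneg _)).trans
        (mul_le_mul_of_nonneg_left (B3Eq15OneSidedInteraction.sq_le_sqSum φ' x) (abs_nonneg _))
    have := mul_le_mul_of_nonneg_left ha (mul_nonneg hη.le (sq_nonneg D.ell))
    calc P.mesh 0 ^ P.d * D.dm2 e' lam' x * D.ell ^ 2 * ‖φ' x‖ ^ 2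
        = P.mesh 0 ^ P.d * D.ell ^ 2 * (D.dm2 e' lam' x * ‖φ' x‖ ^ 2) := by ring
      _ ≤ P.mesh 0 ^ P.d * D.ell ^ 2 * (|D.dm2 e' lam' x| * sqSum φ') := this
      _ = P.mesh 0 ^ P.d * D.ell ^ 2 * |D.dm2 e' lam' x| * sqSum φ' := by ring
  nlinarith [h1, h3, sqSum_nonneg φ']

/-- **`E_k` GROWS AT MOST QUADRATICALLY in the new field**, uniformly in `A^{(k)}`: on `λ′ ≥ 0` (regimes (A)/(B))
`∃ C, E_k(e′, λ′, Ω, A^{(k)}, φ) ≤ C + κΣ_{y∈Ω^{(k)}}|φ(y)|²` with `κ = a_k(L^kη)^{d−2}` the precision of the kernel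
(I.2.10) — from the kernel lower bound `B3Eq15OneSidedInteraction.kernel14_ge` and `density14_ge_quartic`: the nested
integral is `≥ exp(−κΣ|φ(y)|²)` times a positive constant. (ours; a property of the typed (1.4))
[cite: Balaban1983Higgs3, (1.4) p.412] -/
theorem exists_auxE_le (hmsq : 0 < D.msq) (ha : 0 < D.a) (hL : 1 < (P.L : ℝ)) (hk1 : 1 ≤ k) (hk : k ≤ P.K)
    (hm2 : 0 < D.m2) (hℓ : D.ell ≠ 0) {e' lam' : ℝ} (hq : 0 ≤ lam' * D.lamRun)
    (hreg : 0 < lam' * D.lamRun ∨ ∀ x ∈ D.Ω₁, 0 < D.m2 + D.dm2 e' lam' x) :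
    ∃ C : ℝ, ∀ (Ak : HiggsLattice.VecField P 0) (φ : HiggsLattice.ScalarField P k N),
      D.auxE e' lam' Ak φ ≤ C + prec (B1.aSeq D.a P.L k) (P.mesh k) P.d * ∑ y : ↥D.Ωk, ‖φ y.1‖ ^ 2 := by
  haveI := HiggsFluctMeasurePos.fluctFamily_isProbability (P := P) hmsq ha hL hk
  have hη : 0 < P.mesh 0 ^ P.d := pow_pos (P.mesh_pos 0) _
  set κ : ℝ := prec (B1.aSeq D.a P.L k) (P.mesh k) P.d with hκdef
  have hκ : 0 < κ := prec_pos D ha hL hk1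
  -- the constants of the two lower bounds
  set C₁ : ℝ := κ * Fintype.card ↥D.Ωk * ((((P.L : ℝ) ^ (k * P.d))⁻¹) ^ 2
    * Fintype.card (HiggsLattice.Site P 0)) with hC₁
  set C₂ : ℝ := ((4 * P.d * (P.mesh 0)⁻¹ ^ 2 + |D.m2| * D.ell ^ 2) * P.mesh 0 ^ P.d) / 2
    + (P.mesh 0 ^ P.d * D.ell ^ 2 * ∑ x ∈ D.Ω₁, |D.dm2 e' lam' x|) / 2 with hC₂
  set K₀ : ℝ := ((κ / (2 * Real.pi)) ^ ((Module.finrank ℝ (EuclideanSpace ℝ (Fin N)) : ℝ) / 2))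
      ^ Fintype.card ↥D.Ωk with hK₀
  have hK₀pos : 0 < K₀ := pow_pos (Real.rpow_pos_of_pos (by positivity) _) _
  -- the field-independent minorant `G(φ′↾_Ω)` of the fibre integrand divided by `exp(−κΣ|φ(y)|²)`
  set G : (↥D.Ω → EuclideanSpace ℝ (Fin N)) → ℝ := fun φΩ =>
    K₀ * Real.exp (-(C₁ * sqSum (extendZero D.Ω φΩ)))
      * Real.exp (-(lam' * D.lamRun * ∑ x ∈ D.Ω₁, P.mesh 0 ^ P.d * ‖extendZero D.Ω φΩ x‖ ^ 4)
          - C₂ * sqSum (extendZero D.Ω φΩ) - D.E1 e' lam') with hG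
  have hGpos : ∀ φΩ, 0 < G φΩ := fun φΩ => by positivity
  -- `exp(−κΣ|φ(y)|²)·G ≤ fibre integrand`
  have hGle : ∀ (Ak : HiggsLattice.VecField P 0) (A' : (j : Fin k) → HiggsLattice.VecField P j)
      (φ : HiggsLattice.ScalarField P k N) (φΩ : ↥D.Ω → EuclideanSpace ℝ (Fin N)),
      Real.exp (-(κ * ∑ y : ↥D.Ωk, ‖φ y.1‖ ^ 2)) * G φΩ
        ≤ D.kernel14 Ak e' A' φ φΩ * D.density14 Ak e' lam' A' (extendZero D.Ω φΩ) := by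
    intro Ak A' φ φΩ
    have hk' := B3Eq15OneSidedInteraction.kernel14_ge D hκdef hκ Ak e' A' φ φΩ
    have hd := density14_ge_quartic D Ak e' lam' A' (extendZero D.Ω φΩ)
    have hd0 : 0 ≤ Real.exp (-(lam' * D.lamRun * ∑ x ∈ D.Ω₁, P.mesh 0 ^ P.d * ‖extendZero D.Ω φΩ x‖ ^ 4)
        - C₂ * sqSum (extendZero D.Ω φΩ) - D.E1 e' lam') := (Real.exp_pos _).le
    have hkern0 : 0 ≤ D.kernel14 Ak e' A' φ φΩ := D.kernel14_nonneg ha.le Ak e' A' φ φΩ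
    have e1 : Real.exp (-(κ * ∑ y : ↥D.Ωk, ‖φ y.1‖ ^ 2)) * G φΩ
        = (K₀ * Real.exp (-(κ * ∑ y : ↥D.Ωk, ‖φ y.1‖ ^ 2)) * Real.exp (-(C₁ * sqSum (extendZero D.Ω φΩ))))
          * Real.exp (-(lam' * D.lamRun * ∑ x ∈ D.Ω₁, P.mesh 0 ^ P.d * ‖extendZero D.Ω φΩ x‖ ^ 4)
              - C₂ * sqSum (extendZero D.Ω φΩ) - D.E1 e' lam') := by
      rw [hG]; ring
    have e2 : -(κ * Fintype.card ↥D.Ωk * ((((P.L : ℝ) ^ (k * P.d))⁻¹) ^ 2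
        * (Fintype.card (HiggsLattice.Site P 0) * sqSum (extendZero D.Ω φΩ)))) = -(C₁ * sqSum (extendZero D.Ω φΩ)) := by
      rw [hC₁]; ring
    rw [e2] at hk'
    rw [e1]
    exact mul_le_mul hk' hd hd0 hkern0
  -- `G` is integrable (dominated by a Gaussian since `λ′λ(L^kε) ≥ 0`, `C₁ + C₂ > 0`) and has positive integral
  have hC₁0 : 0 ≤ C₁ := by rw [hC₁]; positivity
  have hC₂pos : 0 < C₂ := by
    rw [hC₂]
    have h4 : 0 < (4 * P.d * (P.mesh 0)⁻¹ ^ 2 + |D.m2| * D.ell ^ 2) * P.mesh 0 ^ P.d := by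
      have hd : (0 : ℝ) < P.d := by exact_mod_cast P.hd
      have hm : 0 < (P.mesh 0)⁻¹ ^ 2 := pow_pos (inv_pos.2 (P.mesh_pos 0)) _
      positivity
    have h5 : 0 ≤ P.mesh 0 ^ P.d * D.ell ^ 2 * ∑ x ∈ D.Ω₁, |D.dm2 e' lam' x| :=
      mul_nonneg (mul_nonneg hη.le (sq_nonneg _)) (Finset.sum_nonneg fun x _ => abs_nonneg _)
    linarith
  have hGcont : Continuous G := by
    rw [hG]
    have hsq : Continuous fun φΩ : ↥D.Ω → EuclideanSpace ℝ (Fin N) => sqSum (extendZero D.Ω φΩ) := by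
      unfold sqSum
      exact continuous_finsetSum _ fun x _ => (((continuous_apply x).comp (continuous_extendZero D.Ω)).norm).pow 2
    have hQ : Continuous fun φΩ : ↥D.Ω → EuclideanSpace ℝ (Fin N) =>
        ∑ x ∈ D.Ω₁, P.mesh 0 ^ P.d * ‖extendZero D.Ω φΩ x‖ ^ 4 :=
      continuous_finsetSum _ fun x _ =>
        continuous_const.mul ((((continuous_apply x).comp (continuous_extendZero D.Ω)).norm).pow 4)
    exact (continuous_const.mul (continuous_const.mul hsq).neg.rexp).mul
      (((continuous_const.mul hQ).neg.sub (continuous_const.mul hsq)).sub continuous_const).rexp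
  have hGle' : ∀ φΩ : ↥D.Ω → EuclideanSpace ℝ (Fin N),
      G φΩ ≤ K₀ * Real.exp (-D.E1 e' lam') * ∏ x, Real.exp (-C₂ * ‖φΩ x‖ ^ 2) := by
    intro φΩ
    have hQ0 : 0 ≤ lam' * D.lamRun * ∑ x ∈ D.Ω₁, P.mesh 0 ^ P.d * ‖extendZero D.Ω φΩ x‖ ^ 4 :=
      mul_nonneg hq (Finset.sum_nonneg fun x _ => by positivity)
    have hS0 : 0 ≤ C₁ * sqSum (extendZero D.Ω φΩ) := mul_nonneg hC₁0 (sqSum_nonneg _)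
    have e3 : (∏ x, Real.exp (-C₂ * ‖φΩ x‖ ^ 2)) = Real.exp (-(C₂ * sqSum (extendZero D.Ω φΩ))) := by
      rw [← Real.exp_sum, sqSum_extendZero, Finset.mul_sum, ← Finset.sum_neg_distrib]
      refine congrArg Real.exp (Finset.sum_congr rfl fun x _ => ?_)
      ring
    have key : Real.exp (-(C₁ * sqSum (extendZero D.Ω φΩ)))
        * Real.exp (-(lam' * D.lamRun * ∑ x ∈ D.Ω₁, P.mesh 0 ^ P.d * ‖extendZero D.Ω φΩ x‖ ^ 4)
            - C₂ * sqSum (extendZero D.Ω φΩ) - D.E1 e' lam')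
        ≤ Real.exp (-D.E1 e' lam') * Real.exp (-(C₂ * sqSum (extendZero D.Ω φΩ))) := by
      rw [← Real.exp_add, ← Real.exp_add]
      exact Real.exp_le_exp.2 (by linarith)
    calc G φΩ = K₀ * (Real.exp (-(C₁ * sqSum (extendZero D.Ω φΩ)))
        * Real.exp (-(lam' * D.lamRun * ∑ x ∈ D.Ω₁, P.mesh 0 ^ P.d * ‖extendZero D.Ω φΩ x‖ ^ 4)
            - C₂ * sqSum (extendZero D.Ω φΩ) - D.E1 e' lam')) := by simp only [hG]; ring
      _ ≤ K₀ * (Real.exp (-D.E1 e' lam') * Real.exp (-(C₂ * sqSum (extendZero D.Ω φΩ)))) :=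
        mul_le_mul_of_nonneg_left key hK₀pos.le
      _ = K₀ * Real.exp (-D.E1 e' lam') * ∏ x, Real.exp (-C₂ * ‖φΩ x‖ ^ 2) := by rw [e3]; ring
  have hGint : Integrable G := by
    refine (((integrable_gauss_fibre D hC₂pos).const_mul (K₀ * Real.exp (-D.E1 e' lam'))).mono'
      hGcont.aestronglyMeasurable (Filter.Eventually.of_forall fun φΩ => ?_))
    rw [Real.norm_eq_abs, abs_of_pos (hGpos φΩ)]
    exact hGle' φΩ
  have hIpos : 0 < ∫ φΩ, G φΩ := by
    have hsupp : Function.support G = univ := Set.eq_univ_of_forall fun φΩ => (hGpos φΩ).ne'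
    rw [integral_pos_iff_support_of_nonneg (fun φΩ => (hGpos φΩ).le) hGint, hsupp]
    exact IsOpen.measure_pos volume isOpen_univ univ_nonempty
  refine ⟨-Real.log (∫ φΩ, G φΩ), fun Ak φ => ?_⟩
  -- the fibre integral and then the outer integral are `≥ exp(−κΣ|φ(y)|²)·∫G`
  have hfib : ∀ A' : (j : Fin k) → HiggsLattice.VecField P j,
      Real.exp (-(κ * ∑ y : ↥D.Ωk, ‖φ y.1‖ ^ 2)) * ∫ φΩ, G φΩ ≤ D.integrand14 e' lam' Ak φ A' := by
    intro A'
    rw [Data14.integrand14, Data14.rt14_eq, ← integral_const_mul]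
    exact integral_mono (hGint.const_mul _) (integrable_fibre14 D ha.le hm2 hℓ hq hreg Ak A' φ)
      fun φΩ => hGle Ak A' φ φΩ
  have hZge : Real.exp (-(κ * ∑ y : ↥D.Ωk, ‖φ y.1‖ ^ 2)) * ∫ φΩ, G φΩ
      ≤ ∫ A', D.integrand14 e' lam' Ak φ A' ∂(fluctFamily P D.msq D.a k) := by
    have h := integral_mono (integrable_const _) (integrable_integrand14 D hmsq ha hL hk hm2 hℓ hq hreg Ak φ) hfib
    simpa [integral_const, measure_univ] using h
  have hlow : 0 < Real.exp (-(κ * ∑ y : ↥D.Ωk, ‖φ y.1‖ ^ 2)) * ∫ φΩ, G φΩ := mul_pos (Real.exp_pos _) hIpos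
  have hlog := Real.log_le_log hlow hZge
  rw [Real.log_mul (Real.exp_pos _).ne' hIpos.ne', Real.log_exp] at hlog
  have e : D.auxE e' lam' Ak φ = -Real.log (∫ A', D.integrand14 e' lam' Ak φ A' ∂(fluctFamily P D.msq D.a k)) := rfl
  rw [e]
  linarith

end Bounds2

/-! ## 7. The RIGHT λ′-derivative at `λ′ = 0⁺` (v1.3): what the `β = 1` term of the repaired (1.5) denotes

For the typed (1.4) the `λ′`-dependence sits in the quartic `−λ′λ(L^kε)Σ_{x∈Ω₁}η^d|φ′(x)|⁴` AND in the supplied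
counterterms `δm²(e′,λ′,x)`, `E₁(e′,λ′)`.  Under `C¹` dependence of the data on `λ′` and a renormalized mass that stays
uniformly positive for `λ′ ∈ [0, δ]`, the nested integral `Z(λ′) = exp(−E_k(e′,λ′,…))` has a right derivative at
`λ′ = 0`, computed by differentiating under BOTH integrals (one dominated-convergence argument on the product of the
fluctuation measure with the fibre Lebesgue measure), and `∂⁺E_k/∂λ′|_{λ′=0}` is the normalized expectation of the
`λ′`-vertex `λ(L^kε)Σ_{x∈Ω₁}η^d|φ′(x)|⁴ + ½Σ_{x∈Ω₁}η^d ∂_{λ′}δm²(e′,0,x)(L^kε)²|φ′(x)|² + ∂_{λ′}E₁(e′,0)` — the `φ⁴`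
vertex (1.6) and the mass-counterterm vertex (1.7) of p. 413 differentiated once in `λ′`.  (ours; what the printed
`β = 1` term of (1.5) denotes for the typed instance, cf. `B3Eq15OneSidedInteraction.interaction15R`.) -/

section LamDerivative

variable {k : ℕ} (D : Data14 P N k)

/-- The `λ′`-VERTEX of (1.4) at bookkeeping parameter `l`: the `λ′`-derivative of minus the exponent of the density,
`V(e′,l,φ′) = λ(L^kε)Σ_{x∈Ω₁}η^d|φ′(x)|⁴ + ½Σ_{x∈Ω₁}η^d (∂_{λ′}δm²)(e′,l,x)(L^kε)²|φ′(x)|² + (∂_{λ′}E₁)(e′,l)` — the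
`φ⁴` self-interaction vertex (1.6) with its running coupling, the mass-counterterm vertex (1.7) and the vacuum
counterterm, each differentiated once in `λ′` (ours, for the typed data of `B3Eq14AuxFunction.Data14`).
[cite: Balaban1983Higgs3, (1.4)–(1.7) pp.412–413] -/
noncomputable def lamVertex (e' l : ℝ) (φ' : HiggsLattice.ScalarField P 0 N) : ℝ :=
  D.lamRun * ∑ x ∈ D.Ω₁, P.mesh 0 ^ P.d * ‖φ' x‖ ^ 4
    + (1 / 2 : ℝ) * ∑ x ∈ D.Ω₁, P.mesh 0 ^ P.d * deriv (fun s => D.dm2 e' s x) l * D.ell ^ 2 * ‖φ' x‖ ^ 2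
    + deriv (fun s => D.E1 e' s) l

/-- Unfolding of `lamVertex`. [cite: Balaban1983Higgs3, (1.4)–(1.7) pp.412–413] -/
theorem lamVertex_def (e' l : ℝ) (φ' : HiggsLattice.ScalarField P 0 N) :
    lamVertex D e' l φ' = D.lamRun * ∑ x ∈ D.Ω₁, P.mesh 0 ^ P.d * ‖φ' x‖ ^ 4
      + (1 / 2 : ℝ) * ∑ x ∈ D.Ω₁, P.mesh 0 ^ P.d * deriv (fun s => D.dm2 e' s x) l * D.ell ^ 2 * ‖φ' x‖ ^ 2
      + deriv (fun s => D.E1 e' s) l := rfl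

/-- **The density of (1.4) is differentiable in `λ′`**, with derivative `−V·exp[…]`, wherever the data
`δm²(e′,·,x)` (`x ∈ Ω₁`) and `E₁(e′,·)` are differentiable. [cite: Balaban1983Higgs3, (1.4) p.412] -/
theorem hasDerivAt_density14_lam (Ak : HiggsLattice.VecField P 0) (e' : ℝ)
    (A' : (j : Fin k) → HiggsLattice.VecField P j) (φ' : HiggsLattice.ScalarField P 0 N) {l : ℝ}
    (hdm2 : ∀ x ∈ D.Ω₁, DifferentiableAt ℝ (fun s => D.dm2 e' s x) l)
    (hE1 : DifferentiableAt ℝ (fun s => D.E1 e' s) l) :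
    HasDerivAt (fun s => D.density14 Ak e' s A' φ') (-lamVertex D e' l φ' * D.density14 Ak e' l A' φ') l := by
  -- the exponent and its derivative
  have h2 : HasDerivAt (fun s : ℝ => s * D.lamRun * ∑ x ∈ D.Ω₁, P.mesh 0 ^ P.d * ‖φ' x‖ ^ 4)
      (1 * D.lamRun * ∑ x ∈ D.Ω₁, P.mesh 0 ^ P.d * ‖φ' x‖ ^ 4) l :=
    ((hasDerivAt_id l).mul_const D.lamRun).mul_const (∑ x ∈ D.Ω₁, P.mesh 0 ^ P.d * ‖φ' x‖ ^ 4)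
  have h3 : HasDerivAt (fun s : ℝ => ∑ x ∈ D.Ω₁, P.mesh 0 ^ P.d * D.dm2 e' s x * D.ell ^ 2 * ‖φ' x‖ ^ 2)
      (∑ x ∈ D.Ω₁, P.mesh 0 ^ P.d * deriv (fun s => D.dm2 e' s x) l * D.ell ^ 2 * ‖φ' x‖ ^ 2) l := by
    refine HasDerivAt.fun_sum (u := D.Ω₁)
      (A := fun x s => P.mesh 0 ^ P.d * D.dm2 e' s x * D.ell ^ 2 * ‖φ' x‖ ^ 2)
      (A' := fun x => P.mesh 0 ^ P.d * deriv (fun s => D.dm2 e' s x) l * D.ell ^ 2 * ‖φ' x‖ ^ 2)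
      fun x hx => ?_
    exact (((hdm2 x hx).hasDerivAt.const_mul (P.mesh 0 ^ P.d)).mul_const (D.ell ^ 2)).mul_const (‖φ' x‖ ^ 2)
  have h4 : HasDerivAt (fun s : ℝ => D.E1 e' s) (deriv (fun s => D.E1 e' s) l) l := hE1.hasDerivAt
  have hexp : HasDerivAt (fun s : ℝ => -(1 / 2 : ℝ) * siteInner φ' (D.scalarOp Ak e' A' φ')
        - s * D.lamRun * ∑ x ∈ D.Ω₁, P.mesh 0 ^ P.d * ‖φ' x‖ ^ 4
        - (1 / 2 : ℝ) * ∑ x ∈ D.Ω₁, P.mesh 0 ^ P.d * D.dm2 e' s x * D.ell ^ 2 * ‖φ' x‖ ^ 2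
        - D.E1 e' s) (-lamVertex D e' l φ') l := by
    have h := (((hasDerivAt_const l (-(1 / 2 : ℝ) * siteInner φ' (D.scalarOp Ak e' A' φ'))).sub h2).sub
      (h3.const_mul (1 / 2 : ℝ))).sub h4
    refine h.congr_deriv ?_
    rw [lamVertex_def]
    ring
  have h := hexp.exp
  refine (h.congr_deriv ?_).congr_of_eventuallyEq (Filter.Eventually.of_forall fun s => rfl)
  rw [Data14.density14_eq]
  ring

/-- The density majorant of regime (B) with EXPLICIT constants: if `0 < c₀ ≤ m²`, `c₀ ≤ m² + δm²(e′,l,x)` on `Ω₁`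
and `λ′λ(L^kε) ≥ 0`, then `exp[…](φ′) ≤ exp(−E₁(e′,l) − (c₀(L^kε)²η^d/2)Σ_x|φ′(x)|²)`, uniformly in `A^{(k)}`, `A′`.
[cite: Balaban1983Higgs3, (1.4) p.412] -/
theorem density14_le_explicit (hℓ : D.ell ≠ 0) {e' l c₀ : ℝ} (hc₀ : 0 < c₀) (hc₀m : c₀ ≤ D.m2)
    (hc₀x : ∀ x ∈ D.Ω₁, c₀ ≤ D.m2 + D.dm2 e' l x) (hq : 0 ≤ l * D.lamRun)
    (Ak : HiggsLattice.VecField P 0) (A' : (j : Fin k) → HiggsLattice.VecField P j)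
    (φ' : HiggsLattice.ScalarField P 0 N) :
    D.density14 Ak e' l A' φ' ≤ Real.exp (-D.E1 e' l - c₀ * D.ell ^ 2 * P.mesh 0 ^ P.d / 2 * sqSum φ') := by
  classical
  have hη : 0 < P.mesh 0 ^ P.d := pow_pos (P.mesh_pos 0) _
  have hℓ2 : 0 < D.ell ^ 2 := by positivity
  have hm2 : 0 < D.m2 := lt_of_lt_of_le hc₀ hc₀m
  rw [Data14.density14_eq, Real.exp_le_exp]
  have hS := siteInner_scalarOp_ge D Ak e' A' φ'
  have hQ : 0 ≤ l * D.lamRun * ∑ x ∈ D.Ω₁, P.mesh 0 ^ P.d * ‖φ' x‖ ^ 4 :=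
    mul_nonneg hq (Finset.sum_nonneg fun x _ => by positivity)
  have hsplit : D.m2 * sqSum φ'
      = ∑ x ∈ D.Ω₁, D.m2 * ‖φ' x‖ ^ 2 + ∑ x ∈ D.Ω₁ᶜ, D.m2 * ‖φ' x‖ ^ 2 := by
    rw [sqSum, Finset.mul_sum, ← Finset.sum_add_sum_compl D.Ω₁]
  have hin : ∑ x ∈ D.Ω₁, c₀ * ‖φ' x‖ ^ 2
      ≤ ∑ x ∈ D.Ω₁, D.m2 * ‖φ' x‖ ^ 2 + ∑ x ∈ D.Ω₁, D.dm2 e' l x * ‖φ' x‖ ^ 2 := by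
    rw [← Finset.sum_add_distrib]
    refine Finset.sum_le_sum fun x hx => ?_
    have := mul_le_mul_of_nonneg_right (hc₀x x hx) (sq_nonneg ‖φ' x‖)
    linarith
  have hout : ∑ x ∈ D.Ω₁ᶜ, c₀ * ‖φ' x‖ ^ 2 ≤ ∑ x ∈ D.Ω₁ᶜ, D.m2 * ‖φ' x‖ ^ 2 :=
    Finset.sum_le_sum fun x _ => mul_le_mul_of_nonneg_right hc₀m (sq_nonneg ‖φ' x‖)
  have hc₀sum : c₀ * sqSum φ' = ∑ x ∈ D.Ω₁, c₀ * ‖φ' x‖ ^ 2 + ∑ x ∈ D.Ω₁ᶜ, c₀ * ‖φ' x‖ ^ 2 := by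
    rw [sqSum, Finset.mul_sum, ← Finset.sum_add_sum_compl D.Ω₁]
  have hM : ∑ x ∈ D.Ω₁, P.mesh 0 ^ P.d * D.dm2 e' l x * D.ell ^ 2 * ‖φ' x‖ ^ 2
      = P.mesh 0 ^ P.d * D.ell ^ 2 * ∑ x ∈ D.Ω₁, D.dm2 e' l x * ‖φ' x‖ ^ 2 := by
    rw [Finset.mul_sum]
    refine Finset.sum_congr rfl fun x _ => ?_
    ring
  have hkey : c₀ * sqSum φ' ≤ D.m2 * sqSum φ' + ∑ x ∈ D.Ω₁, D.dm2 e' l x * ‖φ' x‖ ^ 2 := by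
    rw [hc₀sum, hsplit]
    linarith [hin, hout]
  have hkey' := mul_le_mul_of_nonneg_left hkey (mul_nonneg hη.le hℓ2.le)
  have e1 : c₀ * D.ell ^ 2 * P.mesh 0 ^ P.d / 2 * sqSum φ' = (1 / 2 : ℝ) * (P.mesh 0 ^ P.d * D.ell ^ 2 * (c₀ * sqSum φ')) := by
    ring
  have e2 : D.m2 * D.ell ^ 2 * (P.mesh 0 ^ P.d * sqSum φ') + ∑ x ∈ D.Ω₁, P.mesh 0 ^ P.d * D.dm2 e' l x * D.ell ^ 2 * ‖φ' x‖ ^ 2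
      = P.mesh 0 ^ P.d * D.ell ^ 2 * (D.m2 * sqSum φ' + ∑ x ∈ D.Ω₁, D.dm2 e' l x * ‖φ' x‖ ^ 2) := by
    rw [hM]; ring
  rw [e1]
  linarith [hkey', hS, hQ, e2, hm2]

/-- `y ≤ t⁻¹·e^{ty}` (`t > 0`) and `y² ≤ 2t⁻²·e^{ty}` (`y ≥ 0 < t`). [folklore] -/
private theorem le_inv_mul_exp {t : ℝ} (ht : 0 < t) (y : ℝ) : y ≤ t⁻¹ * Real.exp (t * y) := by
  have h := Real.add_one_le_exp (t * y)
  rw [le_inv_mul_iff₀ ht]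
  nlinarith [Real.exp_pos (t * y)]

/-- `y² ≤ 2t⁻²·e^{ty}` for `y ≥ 0 < t`. [folklore] -/
private theorem sq_le_inv_sq_mul_exp {t y : ℝ} (ht : 0 < t) (hy : 0 ≤ y) : y ^ 2 ≤ 2 * (t⁻¹) ^ 2 * Real.exp (t * y) := by
  have h := Real.pow_div_factorial_le_exp (t * y) (mul_nonneg ht.le hy) 2
  have hf : ((Nat.factorial 2 : ℕ) : ℝ) = 2 := by norm_num
  rw [hf, div_le_iff₀ (by norm_num : (0 : ℝ) < 2), mul_pow] at h
  have ht2 : 0 < t ^ 2 := pow_pos ht 2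
  calc y ^ 2 = (t⁻¹) ^ 2 * (t ^ 2 * y ^ 2) := by field_simp
    _ ≤ (t⁻¹) ^ 2 * (Real.exp (t * y) * 2) := mul_le_mul_of_nonneg_left h (sq_nonneg _)
    _ = 2 * (t⁻¹) ^ 2 * Real.exp (t * y) := by ring

/-- The quartic of `Ω₁` is at most `η^d(Σ_x|φ′(x)|²)²`. [folklore] -/
private theorem quartic_le_sqSum_sq (φ' : HiggsLattice.ScalarField P 0 N) :
    ∑ x ∈ D.Ω₁, P.mesh 0 ^ P.d * ‖φ' x‖ ^ 4 ≤ P.mesh 0 ^ P.d * (sqSum φ') ^ 2 := by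
  have hη : 0 < P.mesh 0 ^ P.d := pow_pos (P.mesh_pos 0) _
  rw [← Finset.mul_sum]
  refine mul_le_mul_of_nonneg_left ?_ hη.le
  have h1 : ∑ x ∈ D.Ω₁, ‖φ' x‖ ^ 4 ≤ ∑ x ∈ D.Ω₁, sqSum φ' * ‖φ' x‖ ^ 2 := by
    refine Finset.sum_le_sum fun x _ => ?_
    have hx := B3Eq15OneSidedInteraction.sq_le_sqSum φ' x
    nlinarith [sq_nonneg ‖φ' x‖]
  have h2 : ∑ x ∈ D.Ω₁, sqSum φ' * ‖φ' x‖ ^ 2 ≤ sqSum φ' * sqSum φ' := by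
    rw [← Finset.mul_sum]
    refine mul_le_mul_of_nonneg_left ?_ (sqSum_nonneg φ')
    unfold sqSum
    exact Finset.sum_le_sum_of_subset_of_nonneg (Finset.subset_univ _) fun x _ _ => sq_nonneg _
  nlinarith [h1, h2]

/-- **THE RIGHT DERIVATIVE OF `exp(−E_k)` AT `λ′ = 0⁺` EXISTS and is minus the integral of the `λ′`-vertex against
the `λ′ = 0` integrand of (1.4)**, the nested integral written on the product of the fluctuation measure
`Π_j dμ_{C^{(j)}}(A′_j)` with the fibre Lebesgue measure `dφ′↾_Ω`.  Hypotheses: the well-definedness hypotheses of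
§4, `λ(L^kε) ≥ 0`, data `δm²(e′,·,x)` (`x ∈ Ω₁`) and `E₁(e′,·)` of class `C¹` in `λ′`, and a renormalized mass
uniformly positive for `λ′ ∈ [0, δ]`: `m₀ ≤ m² + δm²(e′,λ′,x)`, `m₀ > 0` (so regime (B) holds near `λ′ = 0`).
Dominated convergence for the difference quotients along `λ′ → 0⁺`, the majorant coming from the mean value theorem,
`density14_le_explicit`, `kernel14_le` and `Σ|φ′|⁴, Σ|φ′|² ≲ exp(½c·Σ|φ′|²)`. (ours; the `β = 1` content of the printed
(1.5) for the typed instance) [cite: Balaban1983Higgs3, (1.4)–(1.5) p.412] -/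
theorem hasDerivWithinAt_integral_integrand14_lam_Ici (hmsq : 0 < D.msq) (ha : 0 < D.a) (hL : 1 < (P.L : ℝ))
    (hk1 : 1 ≤ k) (hk : k ≤ P.K) (hℓ : D.ell ≠ 0) (hrun : 0 ≤ D.lamRun) {e' δ m₀ : ℝ} (hδ : 0 < δ) (hm₀ : 0 < m₀)
    (hm₀m : m₀ ≤ D.m2) (hmass : ∀ s ∈ Set.Icc (0 : ℝ) δ, ∀ x ∈ D.Ω₁, m₀ ≤ D.m2 + D.dm2 e' s x)
    (hdm2 : ∀ x ∈ D.Ω₁, ContDiff ℝ 1 (fun s => D.dm2 e' s x)) (hE1 : ContDiff ℝ 1 (fun s => D.E1 e' s))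
    (Ak : HiggsLattice.VecField P 0) (φ : HiggsLattice.ScalarField P k N) :
    HasDerivWithinAt (fun s => ∫ A', D.integrand14 e' s Ak φ A' ∂(fluctFamily P D.msq D.a k))
      (-(∫ z, lamVertex D e' 0 (extendZero D.Ω z.2)
          * (D.kernel14 Ak e' z.1 φ z.2 * D.density14 Ak e' 0 z.1 (extendZero D.Ω z.2))
          ∂((fluctFamily P D.msq D.a k).prod volume))) (Set.Ici 0) 0 := by
  haveI := HiggsFluctMeasurePos.fluctFamily_isProbability (P := P) hmsq ha hL hk
  set μ := fluctFamily P D.msq D.a k with hμ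
  have hη : 0 < P.mesh 0 ^ P.d := pow_pos (P.mesh_pos 0) _
  have hm2 : 0 < D.m2 := lt_of_lt_of_le hm₀ hm₀m
  -- differentiability of the data everywhere, continuity of the derivatives
  have hdm2d : ∀ x ∈ D.Ω₁, ∀ s, DifferentiableAt ℝ (fun s => D.dm2 e' s x) s :=
    fun x hx s => ((hdm2 x hx).differentiable one_ne_zero).differentiableAt
  have hE1d : ∀ s, DifferentiableAt ℝ (fun s => D.E1 e' s) s := fun s => (hE1.differentiable one_ne_zero).differentiableAt
  -- the integrand on the product space and its `λ′`-derivative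
  set Pf : ℝ → ((j : Fin k) → HiggsLattice.VecField P j) × (↥D.Ω → EuclideanSpace ℝ (Fin N)) → ℝ :=
    fun s z => D.kernel14 Ak e' z.1 φ z.2 * D.density14 Ak e' s z.1 (extendZero D.Ω z.2) with hPf
  set Pd : ℝ → ((j : Fin k) → HiggsLattice.VecField P j) × (↥D.Ω → EuclideanSpace ℝ (Fin N)) → ℝ :=
    fun s z => -lamVertex D e' s (extendZero D.Ω z.2) * Pf s z with hPd
  have hderiv : ∀ z s, HasDerivAt (fun s => Pf s z) (Pd s z) s := by
    intro z s
    have h := (hasDerivAt_density14_lam D Ak e' z.1 (extendZero D.Ω z.2) (fun x hx => hdm2d x hx s)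
      (hE1d s)).const_mul (D.kernel14 Ak e' z.1 φ z.2)
    refine h.congr_deriv ?_
    simp only [hPd, hPf]
    ring
  -- uniform bounds on `[0, δ]`: `−E₁ ≤ K₁`, `|∂δm²(·,x)| ≤ B x`, `|∂E₁| ≤ B₁`
  obtain ⟨K₁, hK₁⟩ : ∃ K₁ : ℝ, ∀ s ∈ Set.Icc (0 : ℝ) δ, -D.E1 e' s ≤ K₁ := by
    obtain ⟨C, hC⟩ := isCompact_Icc.exists_bound_of_continuousOn (hE1.continuous.neg.continuousOn (s := Set.Icc 0 δ))
    exact ⟨C, fun s hs => (le_abs_self _).trans ((Real.norm_eq_abs _).symm.le.trans (hC s hs))⟩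
  have hbdx : ∀ x : HiggsLattice.Site P 0, ∃ B : ℝ, 0 ≤ B ∧ (x ∈ D.Ω₁ → ∀ s ∈ Set.Icc (0 : ℝ) δ,
      |deriv (fun s => D.dm2 e' s x) s| ≤ B) := by
    intro x
    by_cases hx : x ∈ D.Ω₁
    · obtain ⟨C, hC⟩ := isCompact_Icc.exists_bound_of_continuousOn
        (((hdm2 x hx).continuous_deriv le_rfl).continuousOn (s := Set.Icc 0 δ))
      exact ⟨max C 0, le_max_right _ _, fun _ s hs =>
        ((Real.norm_eq_abs _).symm.le.trans (hC s hs)).trans (le_max_left _ _)⟩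
    · exact ⟨0, le_rfl, fun h => absurd h hx⟩
  choose B hB0 hB using hbdx
  obtain ⟨B₁, hB₁0, hB₁⟩ : ∃ B₁ : ℝ, 0 ≤ B₁ ∧ ∀ s ∈ Set.Icc (0 : ℝ) δ, |deriv (fun s => D.E1 e' s) s| ≤ B₁ := by
    obtain ⟨C, hC⟩ := isCompact_Icc.exists_bound_of_continuousOn
      ((hE1.continuous_deriv le_rfl).continuousOn (s := Set.Icc 0 δ))
    exact ⟨max C 0, le_max_right _ _, fun s hs => ((Real.norm_eq_abs _).symm.le.trans (hC s hs)).trans (le_max_left _ _)⟩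
  -- the constants of the majorant
  set κ : ℝ := prec (B1.aSeq D.a P.L k) (P.mesh k) P.d with hκdef
  set Cκ : ℝ := ((κ / (2 * Real.pi)) ^ ((Module.finrank ℝ (EuclideanSpace ℝ (Fin N)) : ℝ) / 2))
      ^ Fintype.card ↥D.Ωk with hCκ
  have hκ0 : 0 ≤ κ := (prec_pos D ha hL hk1).le
  have hCκ0 : 0 ≤ Cκ := pow_nonneg (Real.rpow_nonneg (by positivity) _) _
  set c : ℝ := m₀ * D.ell ^ 2 * P.mesh 0 ^ P.d / 2 with hcdef
  have hℓ2 : 0 < D.ell ^ 2 := by positivity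
  have hc : 0 < c := by positivity
  set t : ℝ := c / 2 with htdef
  have ht : 0 < t := by positivity
  set A₀ : ℝ := D.lamRun * P.mesh 0 ^ P.d * (2 * (t⁻¹) ^ 2)
      + (1 / 2 : ℝ) * (P.mesh 0 ^ P.d * D.ell ^ 2 * ∑ x ∈ D.Ω₁, B x) * t⁻¹ + B₁ with hA₀
  have hA₀0 : 0 ≤ A₀ := by
    have : 0 ≤ ∑ x ∈ D.Ω₁, B x := Finset.sum_nonneg fun x _ => hB0 x
    positivity
  set bound : ((j : Fin k) → HiggsLattice.VecField P j) × (↥D.Ω → EuclideanSpace ℝ (Fin N)) → ℝ :=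
    fun z => Cκ * A₀ * Real.exp K₁ * ∏ x, Real.exp (-t * ‖z.2 x‖ ^ 2) with hbound
  -- (i) the vertex is bounded by `A₀·exp(t·Σ|φ′|²)` on `[0, δ]`
  have hV : ∀ s ∈ Set.Icc (0 : ℝ) δ, ∀ φ' : HiggsLattice.ScalarField P 0 N,
      |lamVertex D e' s φ'| ≤ A₀ * Real.exp (t * sqSum φ') := by
    intro s hs φ'
    have hS0 := sqSum_nonneg φ'
    have hex1 : 1 ≤ Real.exp (t * sqSum φ') := Real.one_le_exp (mul_nonneg ht.le hS0)
    have hq4 : |D.lamRun * ∑ x ∈ D.Ω₁, P.mesh 0 ^ P.d * ‖φ' x‖ ^ 4|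
        ≤ D.lamRun * P.mesh 0 ^ P.d * (2 * (t⁻¹) ^ 2) * Real.exp (t * sqSum φ') := by
      rw [abs_of_nonneg (mul_nonneg hrun (Finset.sum_nonneg fun x _ => by positivity))]
      have h1 := quartic_le_sqSum_sq D φ'
      have h2 := sq_le_inv_sq_mul_exp ht hS0
      calc D.lamRun * ∑ x ∈ D.Ω₁, P.mesh 0 ^ P.d * ‖φ' x‖ ^ 4
          ≤ D.lamRun * (P.mesh 0 ^ P.d * (sqSum φ') ^ 2) := mul_le_mul_of_nonneg_left h1 hrun
        _ ≤ D.lamRun * (P.mesh 0 ^ P.d * (2 * (t⁻¹) ^ 2 * Real.exp (t * sqSum φ'))) :=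
            mul_le_mul_of_nonneg_left (mul_le_mul_of_nonneg_left h2 hη.le) hrun
        _ = D.lamRun * P.mesh 0 ^ P.d * (2 * (t⁻¹) ^ 2) * Real.exp (t * sqSum φ') := by ring
    have hmass2 : |(1 / 2 : ℝ) * ∑ x ∈ D.Ω₁, P.mesh 0 ^ P.d * deriv (fun s => D.dm2 e' s x) s * D.ell ^ 2 * ‖φ' x‖ ^ 2|
        ≤ (1 / 2 : ℝ) * (P.mesh 0 ^ P.d * D.ell ^ 2 * ∑ x ∈ D.Ω₁, B x) * t⁻¹ * Real.exp (t * sqSum φ') := by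
      rw [abs_mul, abs_of_pos (by norm_num : (0 : ℝ) < 1 / 2)]
      have h1 : |∑ x ∈ D.Ω₁, P.mesh 0 ^ P.d * deriv (fun s => D.dm2 e' s x) s * D.ell ^ 2 * ‖φ' x‖ ^ 2|
          ≤ ∑ x ∈ D.Ω₁, P.mesh 0 ^ P.d * B x * D.ell ^ 2 * sqSum φ' := by
        refine (Finset.abs_sum_le_sum_abs _ _).trans (Finset.sum_le_sum fun x hx => ?_)
        rw [abs_mul, abs_mul, abs_mul, abs_of_pos hη, abs_of_pos hℓ2, abs_of_nonneg (sq_nonneg ‖φ' x‖)]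
        have hb := hB x hx s hs
        have hr := B3Eq15OneSidedInteraction.sq_le_sqSum φ' x
        have := mul_le_mul hb hr (sq_nonneg _) (hB0 x)
        calc P.mesh 0 ^ P.d * |deriv (fun s => D.dm2 e' s x) s| * D.ell ^ 2 * ‖φ' x‖ ^ 2
            = P.mesh 0 ^ P.d * D.ell ^ 2 * (|deriv (fun s => D.dm2 e' s x) s| * ‖φ' x‖ ^ 2) := by ring
          _ ≤ P.mesh 0 ^ P.d * D.ell ^ 2 * (B x * sqSum φ') :=
              mul_le_mul_of_nonneg_left this (mul_nonneg hη.le hℓ2.le)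
          _ = P.mesh 0 ^ P.d * B x * D.ell ^ 2 * sqSum φ' := by ring
      have h2 : ∑ x ∈ D.Ω₁, P.mesh 0 ^ P.d * B x * D.ell ^ 2 * sqSum φ'
          = (P.mesh 0 ^ P.d * D.ell ^ 2 * ∑ x ∈ D.Ω₁, B x) * sqSum φ' := by
        rw [Finset.mul_sum, Finset.sum_mul]
        refine Finset.sum_congr rfl fun x _ => ?_
        ring
      have h3 := le_inv_mul_exp ht (sqSum φ')
      have hBs : 0 ≤ P.mesh 0 ^ P.d * D.ell ^ 2 * ∑ x ∈ D.Ω₁, B x :=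
        mul_nonneg (mul_nonneg hη.le hℓ2.le) (Finset.sum_nonneg fun x _ => hB0 x)
      rw [h2] at h1
      calc (1 / 2 : ℝ) * |∑ x ∈ D.Ω₁, P.mesh 0 ^ P.d * deriv (fun s => D.dm2 e' s x) s * D.ell ^ 2 * ‖φ' x‖ ^ 2|
          ≤ (1 / 2 : ℝ) * ((P.mesh 0 ^ P.d * D.ell ^ 2 * ∑ x ∈ D.Ω₁, B x) * sqSum φ') :=
            mul_le_mul_of_nonneg_left h1 (by norm_num)
        _ ≤ (1 / 2 : ℝ) * ((P.mesh 0 ^ P.d * D.ell ^ 2 * ∑ x ∈ D.Ω₁, B x) * (t⁻¹ * Real.exp (t * sqSum φ'))) :=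
            mul_le_mul_of_nonneg_left (mul_le_mul_of_nonneg_left h3 hBs) (by norm_num)
        _ = (1 / 2 : ℝ) * (P.mesh 0 ^ P.d * D.ell ^ 2 * ∑ x ∈ D.Ω₁, B x) * t⁻¹ * Real.exp (t * sqSum φ') := by ring
    have hE : |deriv (fun s => D.E1 e' s) s| ≤ B₁ * Real.exp (t * sqSum φ') :=
      (hB₁ s hs).trans (le_mul_of_one_le_right hB₁0 hex1)
    rw [lamVertex_def]
    refine (abs_add_le _ _).trans ((add_le_add ((abs_add_le _ _).trans (add_le_add hq4 hmass2)) hE).trans ?_)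
    rw [hA₀]
    ring_nf
    rfl
  -- (ii) the derivative is dominated by `bound` on `[0, δ]`
  have hPd_le : ∀ s ∈ Set.Icc (0 : ℝ) δ, ∀ z, |Pd s z| ≤ bound z := by
    intro s hs z
    have hq : 0 ≤ s * D.lamRun := mul_nonneg hs.1 hrun
    have hkern := kernel14_le D ha.le Ak e' z.1 φ z.2
    have hkern0 := D.kernel14_nonneg ha.le Ak e' z.1 φ z.2
    have hdens := density14_le_explicit D hℓ hm₀ hm₀m (hmass s hs) hq Ak z.1 (extendZero D.Ω z.2)
    have hdens0 := (D.density14_pos Ak e' s z.1 (extendZero D.Ω z.2)).le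
    have hv := hV s hs (extendZero D.Ω z.2)
    have hS : sqSum (extendZero D.Ω z.2) = ∑ x, ‖z.2 x‖ ^ 2 := sqSum_extendZero D.Ω z.2
    -- |Pd| = |V|·kernel·density
    have e1 : |Pd s z| = |lamVertex D e' s (extendZero D.Ω z.2)|
        * (D.kernel14 Ak e' z.1 φ z.2 * D.density14 Ak e' s z.1 (extendZero D.Ω z.2)) := by
      simp only [hPd, hPf]
      rw [abs_mul, abs_neg, abs_of_nonneg (mul_nonneg hkern0 hdens0)]
    rw [e1]
    have hprod : D.kernel14 Ak e' z.1 φ z.2 * D.density14 Ak e' s z.1 (extendZero D.Ω z.2)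
        ≤ Cκ * Real.exp (-D.E1 e' s - c * sqSum (extendZero D.Ω z.2)) := by
      have e2 : -D.E1 e' s - m₀ * D.ell ^ 2 * P.mesh 0 ^ P.d / 2 * sqSum (extendZero D.Ω z.2)
          = -D.E1 e' s - c * sqSum (extendZero D.Ω z.2) := by rw [hcdef]
      rw [← e2]
      exact mul_le_mul hkern hdens hdens0 hCκ0
    have hexp : Real.exp (-D.E1 e' s - c * sqSum (extendZero D.Ω z.2))
        ≤ Real.exp K₁ * Real.exp (-(c * sqSum (extendZero D.Ω z.2))) := by
      rw [← Real.exp_add, Real.exp_le_exp]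
      linarith [hK₁ s hs]
    have egauss : Real.exp (t * sqSum (extendZero D.Ω z.2)) * Real.exp (-(c * sqSum (extendZero D.Ω z.2)))
        = ∏ x, Real.exp (-t * ‖z.2 x‖ ^ 2) := by
      rw [← Real.exp_add, ← Real.exp_sum, hS, htdef, Finset.mul_sum, Finset.mul_sum, ← Finset.sum_neg_distrib,
        ← Finset.sum_add_distrib]
      refine congrArg Real.exp (Finset.sum_congr rfl fun x _ => ?_)
      ring
    calc |lamVertex D e' s (extendZero D.Ω z.2)|
          * (D.kernel14 Ak e' z.1 φ z.2 * D.density14 Ak e' s z.1 (extendZero D.Ω z.2))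
        ≤ (A₀ * Real.exp (t * sqSum (extendZero D.Ω z.2)))
            * (Cκ * (Real.exp K₁ * Real.exp (-(c * sqSum (extendZero D.Ω z.2))))) :=
          mul_le_mul hv (hprod.trans (mul_le_mul_of_nonneg_left hexp hCκ0)) (mul_nonneg hkern0 hdens0)
            (mul_nonneg hA₀0 (Real.exp_pos _).le)
      _ = Cκ * A₀ * Real.exp K₁ * (Real.exp (t * sqSum (extendZero D.Ω z.2))
            * Real.exp (-(c * sqSum (extendZero D.Ω z.2)))) := by ring
      _ = bound z := by rw [egauss]
  -- (iii) integrability: the bound, and `Pf s` for `s ∈ [0, δ]`, on the product measure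
  have hbound_int : Integrable bound (μ.prod volume) := by
    have h := (integrable_const (Cκ * A₀ * Real.exp K₁) (μ := μ)).mul_prod (integrable_gauss_fibre D ht)
    exact h
  have hPf_cont : ∀ s, Continuous (Pf s) := fun s =>
    continuous_fibre14₄ D e' s continuous_const continuous_fst continuous_const continuous_snd
  have hPd_cont : ∀ s, Continuous (Pd s) := by
    intro s
    have hV : Continuous fun z : ((j : Fin k) → HiggsLattice.VecField P j) × (↥D.Ω → EuclideanSpace ℝ (Fin N)) =>
        lamVertex D e' s (extendZero D.Ω z.2) := by
      simp only [lamVertex_def]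
      have hx : ∀ x : HiggsLattice.Site P 0, Continuous fun z : ((j : Fin k) → HiggsLattice.VecField P j)
          × (↥D.Ω → EuclideanSpace ℝ (Fin N)) => ‖extendZero D.Ω z.2 x‖ :=
        fun x => ((continuous_apply x).comp ((continuous_extendZero D.Ω).comp continuous_snd)).norm
      exact ((continuous_const.mul (continuous_finsetSum _ fun x _ => continuous_const.mul ((hx x).pow 4))).add
        (continuous_const.mul (continuous_finsetSum _ fun x _ =>
          ((continuous_const.mul continuous_const).mul continuous_const).mul ((hx x).pow 2)))).add continuous_const
    exact hV.neg.mul (hPf_cont s)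
  have hPf_int : ∀ s ∈ Set.Icc (0 : ℝ) δ, Integrable (Pf s) (μ.prod volume) := by
    intro s hs
    have hq : 0 ≤ s * D.lamRun := mul_nonneg hs.1 hrun
    have hregs : 0 < s * D.lamRun ∨ ∀ x ∈ D.Ω₁, 0 < D.m2 + D.dm2 e' s x :=
      Or.inr fun x hx => lt_of_lt_of_le hm₀ (hmass s hs x hx)
    obtain ⟨M, c', hM, hc', hle⟩ := exists_fibre14_le_unif D ha.le hm2 hℓ hq hregs
    refine (((integrable_const M (μ := μ)).mul_prod (integrable_gauss_fibre D hc')).mono'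
      (hPf_cont s).aestronglyMeasurable (Filter.Eventually.of_forall fun z => ?_))
    rw [Real.norm_eq_abs, abs_of_nonneg (mul_nonneg (D.kernel14_nonneg ha.le Ak e' z.1 φ z.2)
      (D.density14_pos Ak e' s z.1 _).le)]
    exact hle Ak z.1 φ z.2
  -- (iv) `Z(s) = ∫ Pf s d(μ ⊗ vol)` for `s ∈ [0, δ]`
  have hZ : ∀ s ∈ Set.Icc (0 : ℝ) δ,
      ∫ A', D.integrand14 e' s Ak φ A' ∂μ = ∫ z, Pf s z ∂(μ.prod volume) := by
    intro s hs
    rw [integral_prod (Pf s) (hPf_int s hs)]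
    refine integral_congr_ae (Filter.Eventually.of_forall fun A' => ?_)
    simp only [hPf]
    rw [Data14.integrand14, Data14.rt14_eq]
  -- (v) the difference quotients
  rw [← hasDerivWithinAt_Ioi_iff_Ici, hasDerivWithinAt_iff_tendsto_slope' (show (0 : ℝ) ∉ Set.Ioi 0 by simp)]
  set F : ℝ → ((j : Fin k) → HiggsLattice.VecField P j) × (↥D.Ω → EuclideanSpace ℝ (Fin N)) → ℝ :=
    fun s z => s⁻¹ * (Pf s z - Pf 0 z) with hF
  have hev : ∀ᶠ s in 𝓝[Set.Ioi (0 : ℝ)] 0, s ∈ Set.Ioo 0 δ := Ioo_mem_nhdsGT hδ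
  have h0mem : (0 : ℝ) ∈ Set.Icc (0 : ℝ) δ := ⟨le_rfl, hδ.le⟩
  have key : ∀ s ∈ Set.Ioo (0 : ℝ) δ,
      slope (fun s => ∫ A', D.integrand14 e' s Ak φ A' ∂μ) 0 s = ∫ z, F s z ∂(μ.prod volume) := by
    intro s hs
    have hsI : s ∈ Set.Icc (0 : ℝ) δ := ⟨hs.1.le, hs.2.le⟩
    rw [slope_def_field, sub_zero, hZ s hsI, hZ 0 h0mem, ← integral_sub (hPf_int s hsI) (hPf_int 0 h0mem),
      div_eq_inv_mul, ← integral_const_mul]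
  have hmeas : ∀ᶠ s in 𝓝[Set.Ioi (0 : ℝ)] 0, AEStronglyMeasurable (F s) (μ.prod volume) :=
    Filter.Eventually.of_forall fun s =>
      (continuous_const.mul ((hPf_cont s).sub (hPf_cont 0))).aestronglyMeasurable
  have hbd : ∀ᶠ s in 𝓝[Set.Ioi (0 : ℝ)] 0, ∀ᵐ z ∂(μ.prod volume), ‖F s z‖ ≤ bound z := by
    filter_upwards [hev] with s hs
    refine Filter.Eventually.of_forall fun z => ?_
    -- mean value theorem on `[0, s]`
    obtain ⟨c', hc', hc'eq⟩ := exists_hasDerivAt_eq_slope (fun s => Pf s z) (fun s => Pd s z) hs.1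
      (HasDerivAt.continuousOn fun s _ => hderiv z s) (fun s _ => hderiv z s)
    have hcI : c' ∈ Set.Icc (0 : ℝ) δ := ⟨hc'.1.le, (hc'.2.trans hs.2).le⟩
    have eF : F s z = Pd c' z := by
      rw [hc'eq, sub_zero, hF]
      simp only
      rw [div_eq_inv_mul]
    rw [Real.norm_eq_abs, eF]
    exact hPd_le c' hcI z
  have hlim : ∀ᵐ z ∂(μ.prod volume), Filter.Tendsto (fun s => F s z) (𝓝[Set.Ioi (0 : ℝ)] 0) (𝓝 (Pd 0 z)) := by
    refine Filter.Eventually.of_forall fun z => ?_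
    have htend := (hderiv z 0).tendsto_slope
    have hmono : 𝓝[Set.Ioi (0 : ℝ)] 0 ≤ 𝓝[≠] 0 := nhdsWithin_mono _ fun x hx => ne_of_gt hx
    refine (htend.mono_left hmono).congr' ?_
    filter_upwards [hev] with s hs
    rw [slope_def_field, hF]
    simp only [sub_zero, div_eq_inv_mul]
  have hT := tendsto_integral_filter_of_dominated_convergence bound hmeas hbd hbound_int hlim
  have hlim_eq : (-(∫ z, lamVertex D e' 0 (extendZero D.Ω z.2)
        * (D.kernel14 Ak e' z.1 φ z.2 * D.density14 Ak e' 0 z.1 (extendZero D.Ω z.2)) ∂(μ.prod volume)))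
      = ∫ z, Pd 0 z ∂(μ.prod volume) := by
    rw [← integral_neg]
    refine integral_congr_ae (Filter.Eventually.of_forall fun z => ?_)
    simp only [hPd, hPf]
    ring
  rw [hlim_eq]
  refine hT.congr' ?_
  filter_upwards [hev] with s hs using (key s hs).symm

/-- **`∂⁺E_k/∂λ′|_{λ′=0}` EXISTS AND IS THE NORMALIZED EXPECTATION OF THE `λ′`-VERTEX**: under the hypotheses of
`hasDerivWithinAt_integral_integrand14_lam_Ici`, `λ′ ↦ E_k(e′,λ′,Ω,A^{(k)},φ)` has the right derivative
`⟨V⟩ = (∫ V·t·exp[…]|_{λ′=0} dμ(A′)dφ′↾_Ω) / (∫ t·exp[…]|_{λ′=0} dμ(A′)dφ′↾_Ω)` at `λ′ = 0` within `[0, ∞)` — the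
`β = 1` term of the repaired (1.5) (`B3Eq15OneSidedInteraction.interaction15R`, r15's `pert15R`) is this expectation of
the `φ⁴` vertex (1.6), the differentiated mass-counterterm vertex (1.7) and `∂_{λ′}E₁`; contrast §3 of
`B3Eq15OneSidedInteraction`: the two-sided `deriv` of the unrepaired instance is `0`. (ours)
[cite: Balaban1983Higgs3, (1.4)–(1.7) pp.412–413] -/
theorem hasDerivWithinAt_auxE_lam_Ici (hmsq : 0 < D.msq) (ha : 0 < D.a) (hL : 1 < (P.L : ℝ))
    (hk1 : 1 ≤ k) (hk : k ≤ P.K) (hℓ : D.ell ≠ 0) (hrun : 0 ≤ D.lamRun) {e' δ m₀ : ℝ} (hδ : 0 < δ) (hm₀ : 0 < m₀)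
    (hm₀m : m₀ ≤ D.m2) (hmass : ∀ s ∈ Set.Icc (0 : ℝ) δ, ∀ x ∈ D.Ω₁, m₀ ≤ D.m2 + D.dm2 e' s x)
    (hdm2 : ∀ x ∈ D.Ω₁, ContDiff ℝ 1 (fun s => D.dm2 e' s x)) (hE1 : ContDiff ℝ 1 (fun s => D.E1 e' s))
    (Ak : HiggsLattice.VecField P 0) (φ : HiggsLattice.ScalarField P k N) :
    HasDerivWithinAt (fun s => D.auxE e' s Ak φ)
      ((∫ z, lamVertex D e' 0 (extendZero D.Ω z.2)
          * (D.kernel14 Ak e' z.1 φ z.2 * D.density14 Ak e' 0 z.1 (extendZero D.Ω z.2))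
          ∂((fluctFamily P D.msq D.a k).prod volume))
        / ∫ A', D.integrand14 e' 0 Ak φ A' ∂(fluctFamily P D.msq D.a k)) (Set.Ici 0) 0 := by
  have hZ := hasDerivWithinAt_integral_integrand14_lam_Ici D hmsq ha hL hk1 hk hℓ hrun hδ hm₀ hm₀m hmass hdm2 hE1 Ak φ
  have hm2 : 0 < D.m2 := lt_of_lt_of_le hm₀ hm₀m
  have hreg0 : 0 < (0 : ℝ) * D.lamRun ∨ ∀ x ∈ D.Ω₁, 0 < D.m2 + D.dm2 e' 0 x :=
    Or.inr fun x hx => lt_of_lt_of_le hm₀ (hmass 0 ⟨le_rfl, hδ.le⟩ x hx)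
  have hpos := integral_integrand14_pos D hmsq ha hL hk1 hk hm2 hℓ (le_of_eq (zero_mul _).symm) hreg0 Ak φ
  have hlog := (hZ.log hpos.ne').neg
  refine (hlog.congr_deriv ?_).congr_of_eventuallyEq (Filter.Eventually.of_forall fun s => rfl) rfl
  rw [neg_div, neg_neg]

/-- Hence the one-sided first `λ′`-derivative `derivWithin (λ′ ↦ E_k) [0,∞) 0` — the quantity entering the `β = 1`
terms of the repaired (1.5) (`iteratedDerivWithin 1 = derivWithin`) — EQUALS the normalized expectation of the
`λ′`-vertex. (ours) [cite: Balaban1983Higgs3, (1.5) p.412] -/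
theorem derivWithin_auxE_lam_Ici (hmsq : 0 < D.msq) (ha : 0 < D.a) (hL : 1 < (P.L : ℝ))
    (hk1 : 1 ≤ k) (hk : k ≤ P.K) (hℓ : D.ell ≠ 0) (hrun : 0 ≤ D.lamRun) {e' δ m₀ : ℝ} (hδ : 0 < δ) (hm₀ : 0 < m₀)
    (hm₀m : m₀ ≤ D.m2) (hmass : ∀ s ∈ Set.Icc (0 : ℝ) δ, ∀ x ∈ D.Ω₁, m₀ ≤ D.m2 + D.dm2 e' s x)
    (hdm2 : ∀ x ∈ D.Ω₁, ContDiff ℝ 1 (fun s => D.dm2 e' s x)) (hE1 : ContDiff ℝ 1 (fun s => D.E1 e' s))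
    (Ak : HiggsLattice.VecField P 0) (φ : HiggsLattice.ScalarField P k N) :
    iteratedDerivWithin 1 (fun s => D.auxE e' s Ak φ) (Set.Ici 0) 0
      = (∫ z, lamVertex D e' 0 (extendZero D.Ω z.2)
          * (D.kernel14 Ak e' z.1 φ z.2 * D.density14 Ak e' 0 z.1 (extendZero D.Ω z.2))
          ∂((fluctFamily P D.msq D.a k).prod volume))
        / ∫ A', D.integrand14 e' 0 Ak φ A' ∂(fluctFamily P D.msq D.a k) := by
  rw [iteratedDerivWithin_one]
  exact (hasDerivWithinAt_auxE_lam_Ici D hmsq ha hL hk1 hk hℓ hrun hδ hm₀ hm₀m hmass hdm2 hE1 Ak φ).derivWithin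
    (uniqueDiffOn_Ici 0 0 Set.self_mem_Ici)

end LamDerivative

/-! ## 8. The repaired (1.5) TO FIRST ORDER (v1.4): `𝒫^{(k)}_{n̄=1} = ∂_{e′}E_k|₀ + ⟨V⟩` -/

section FirstOrder

variable {k : ℕ} (D : Data14 P N k)

/-- The index set of (1.5) for `n̄ = 1` is `{(0,1), (1,0)}`. [cite: Balaban1983Higgs3, (1.5) p.412] -/
theorem idx15_one : B3Sect1Counterterms.idx15 1 = {(0, 1), (1, 0)} := by decide

/-- **THE REPAIRED INTERACTION (1.5) TO FIRST ORDER, EXPLICITLY**: under the hypotheses of §7 at the expansion point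
`e′ = 0`, `𝒫^{(k)}(Ω₁, A^{(k)}, φ)` for `n̄ = 1` in the one-sided reading (`B3Eq15OneSidedInteraction.interaction15R`,
= r15's `pert15R` at the typed `E_k`) is the charge term `∂E_k/∂e′(e′, 0⁺…)|_{e′=0}` (two-sided, as printed; its
existence is not asserted — Lean's `deriv` is `0` where it fails) PLUS the normalized expectation `⟨V⟩` of the
`λ′`-vertex: the `φ⁴` self-interaction vertex (1.6), the mass-counterterm vertex (1.7) differentiated in `λ′`, and
`∂_{λ′}E₁` — where for the unrepaired two-sided instance the second summand is `0` (`B3Eq15OneSidedInteraction`, §3).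
(ours; what the printed first-order interaction denotes for the typed instance)
[cite: Balaban1983Higgs3, (1.5)–(1.7) pp.412–413] -/
theorem interaction15R_one_eq (hmsq : 0 < D.msq) (ha : 0 < D.a) (hL : 1 < (P.L : ℝ))
    (hk1 : 1 ≤ k) (hk : k ≤ P.K) (hℓ : D.ell ≠ 0) (hrun : 0 ≤ D.lamRun) {δ m₀ : ℝ} (hδ : 0 < δ) (hm₀ : 0 < m₀)
    (hm₀m : m₀ ≤ D.m2) (hmass : ∀ s ∈ Set.Icc (0 : ℝ) δ, ∀ x ∈ D.Ω₁, m₀ ≤ D.m2 + D.dm2 0 s x)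
    (hdm2 : ∀ x ∈ D.Ω₁, ContDiff ℝ 1 (fun s => D.dm2 0 s x)) (hE1 : ContDiff ℝ 1 (fun s => D.E1 0 s))
    (Ak : HiggsLattice.VecField P 0) (φ : HiggsLattice.ScalarField P k N) :
    B3Eq15OneSidedInteraction.interaction15R D 1 Ak φ
      = deriv (fun e' => D.auxE e' 0 Ak φ) 0
        + (∫ z, lamVertex D 0 0 (extendZero D.Ω z.2)
            * (D.kernel14 Ak 0 z.1 φ z.2 * D.density14 Ak 0 0 z.1 (extendZero D.Ω z.2))
            ∂((fluctFamily P D.msq D.a k).prod volume))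
          / ∫ A', D.integrand14 0 0 Ak φ A' ∂(fluctFamily P D.msq D.a k) := by
  have hV := derivWithin_auxE_lam_Ici D hmsq ha hL hk1 hk hℓ hrun hδ hm₀ hm₀m hmass hdm2 hE1 Ak φ
  rw [B3Eq15OneSidedInteraction.interaction15R, idx15_one, Finset.sum_pair (by decide), ← hV]
  have h0 : ∀ e' : ℝ, iteratedDerivWithin 0 (fun l' => D.auxE e' l' Ak φ) (Set.Ici 0) 0 = D.auxE e' 0 Ak φ :=
    fun e' => by rw [iteratedDerivWithin_zero]
  simp only [Nat.factorial_zero, Nat.factorial_one, Nat.cast_one, mul_one, div_one, one_mul, iteratedDeriv_zero,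
    iteratedDeriv_one, h0]
  ring

/-- In particular the first-order repaired interaction DIFFERS from g4's two-sided instance `interaction15 1` by
exactly `⟨V⟩` whenever the latter's `λ′`-terms vanish (`N ≥ 1`, `a_k(L^kη)^{d−2} > 0`, `λ(L^kε) > 0`, a site of
`Ω ∩ Ω₁`; `B3Eq15OneSidedInteraction.interaction15R_sub_interaction15`). (ours)
[cite: Balaban1983Higgs3, (1.5)–(1.7) pp.412–413] -/
theorem interaction15R_one_sub_interaction15_one (hmsq : 0 < D.msq) (ha : 0 < D.a) (hL : 1 < (P.L : ℝ))
    (hk1 : 1 ≤ k) (hk : k ≤ P.K) (hℓ : D.ell ≠ 0) (hN : 1 ≤ N) (hrun : 0 < D.lamRun)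
    {x₀ : HiggsLattice.Site P 0} (hx₀Ω : x₀ ∈ D.Ω) (hx₀1 : x₀ ∈ D.Ω₁) {δ m₀ : ℝ} (hδ : 0 < δ) (hm₀ : 0 < m₀)
    (hm₀m : m₀ ≤ D.m2) (hmass : ∀ s ∈ Set.Icc (0 : ℝ) δ, ∀ x ∈ D.Ω₁, m₀ ≤ D.m2 + D.dm2 0 s x)
    (hdm2 : ∀ x ∈ D.Ω₁, ContDiff ℝ 1 (fun s => D.dm2 0 s x)) (hE1 : ContDiff ℝ 1 (fun s => D.E1 0 s))
    (Ak : HiggsLattice.VecField P 0) (φ : HiggsLattice.ScalarField P k N) :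
    B3Eq15OneSidedInteraction.interaction15R D 1 Ak φ - D.interaction15 1 Ak φ
      = (∫ z, lamVertex D 0 0 (extendZero D.Ω z.2)
            * (D.kernel14 Ak 0 z.1 φ z.2 * D.density14 Ak 0 0 z.1 (extendZero D.Ω z.2))
            ∂((fluctFamily P D.msq D.a k).prod volume))
          / ∫ A', D.integrand14 0 0 Ak φ A' ∂(fluctFamily P D.msq D.a k) := by
  have hV := derivWithin_auxE_lam_Ici D hmsq ha hL hk1 hk hℓ hrun.le hδ hm₀ hm₀m hmass hdm2 hE1 Ak φ
  rw [B3Eq15OneSidedInteraction.interaction15R_sub_interaction15 D hN (prec_pos D ha hL hk1) hrun hx₀Ω hx₀1,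
    idx15_one, Finset.sum_pair (by decide), ← hV]
  simp only [Nat.factorial_zero, Nat.factorial_one, Nat.cast_one, mul_one, div_one, one_mul, iteratedDeriv_zero,
    one_ne_zero, if_false, if_true, add_zero]

end FirstOrder

/-! ## 9. `λ′ ↦ exp(−E_k)` is `C¹` on `[0, δ]` (v1.5): the derivative at every base point and its continuity -/

section LamC1

variable {k : ℕ} (D : Data14 P N k)

/-- The nested integral of (1.4) as ONE integral over the product of the fluctuation measure with the fibre Lebesgue
measure (Fubini; regimes (A)/(B)). [cite: Balaban1983Higgs3, (1.4) p.412] -/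
theorem integral_integrand14_eq_integral_prod (hmsq : 0 < D.msq) (ha : 0 < D.a) (hL : 1 < (P.L : ℝ)) (hk : k ≤ P.K)
    (hm2 : 0 < D.m2) (hℓ : D.ell ≠ 0) {e' lam' : ℝ} (hq : 0 ≤ lam' * D.lamRun)
    (hreg : 0 < lam' * D.lamRun ∨ ∀ x ∈ D.Ω₁, 0 < D.m2 + D.dm2 e' lam' x)
    (Ak : HiggsLattice.VecField P 0) (φ : HiggsLattice.ScalarField P k N) :
    Integrable (fun z : ((j : Fin k) → HiggsLattice.VecField P j) × (↥D.Ω → EuclideanSpace ℝ (Fin N)) =>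
        D.kernel14 Ak e' z.1 φ z.2 * D.density14 Ak e' lam' z.1 (extendZero D.Ω z.2))
        ((fluctFamily P D.msq D.a k).prod volume)
    ∧ ∫ A', D.integrand14 e' lam' Ak φ A' ∂(fluctFamily P D.msq D.a k)
      = ∫ z, D.kernel14 Ak e' z.1 φ z.2 * D.density14 Ak e' lam' z.1 (extendZero D.Ω z.2)
          ∂((fluctFamily P D.msq D.a k).prod volume) := by
  haveI := HiggsFluctMeasurePos.fluctFamily_isProbability (P := P) hmsq ha hL hk
  obtain ⟨M, c', hM, hc', hle⟩ := exists_fibre14_le_unif D ha.le hm2 hℓ hq hreg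
  have hcont : Continuous fun z : ((j : Fin k) → HiggsLattice.VecField P j) × (↥D.Ω → EuclideanSpace ℝ (Fin N)) =>
      D.kernel14 Ak e' z.1 φ z.2 * D.density14 Ak e' lam' z.1 (extendZero D.Ω z.2) :=
    continuous_fibre14₄ D e' lam' continuous_const continuous_fst continuous_const continuous_snd
  have hint : Integrable (fun z : ((j : Fin k) → HiggsLattice.VecField P j) × (↥D.Ω → EuclideanSpace ℝ (Fin N)) =>
      D.kernel14 Ak e' z.1 φ z.2 * D.density14 Ak e' lam' z.1 (extendZero D.Ω z.2))
      ((fluctFamily P D.msq D.a k).prod volume) := by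
    refine (((integrable_const M (μ := fluctFamily P D.msq D.a k)).mul_prod (integrable_gauss_fibre D hc')).mono'
      hcont.aestronglyMeasurable (Filter.Eventually.of_forall fun z => ?_))
    rw [Real.norm_eq_abs, abs_of_nonneg (mul_nonneg (D.kernel14_nonneg ha.le Ak e' z.1 φ z.2)
      (D.density14_pos Ak e' lam' z.1 _).le)]
    exact hle Ak z.1 φ z.2
  refine ⟨hint, ?_⟩
  rw [integral_prod _ hint]
  refine integral_congr_ae (Filter.Eventually.of_forall fun A' => ?_)
  rw [Data14.integrand14, Data14.rt14_eq]

/-- A Gaussian MAJORANT, uniform in `λ′ ∈ [0, δ]` and integrable on the product measure, of the `λ′`-derivative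
`−V·t·exp[…]` of the integrand of (1.4) (hypotheses of §7). [cite: Balaban1983Higgs3, (1.4) p.412] -/
theorem exists_lamDeriv_majorant (hmsq : 0 < D.msq) (ha : 0 < D.a) (hL : 1 < (P.L : ℝ))
    (hk1 : 1 ≤ k) (hk : k ≤ P.K) (hℓ : D.ell ≠ 0) (hrun : 0 ≤ D.lamRun) {e' δ m₀ : ℝ} (hm₀ : 0 < m₀)
    (hm₀m : m₀ ≤ D.m2) (hmass : ∀ s ∈ Set.Icc (0 : ℝ) δ, ∀ x ∈ D.Ω₁, m₀ ≤ D.m2 + D.dm2 e' s x)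
    (hdm2 : ∀ x ∈ D.Ω₁, ContDiff ℝ 1 (fun s => D.dm2 e' s x)) (hE1 : ContDiff ℝ 1 (fun s => D.E1 e' s))
    (Ak : HiggsLattice.VecField P 0) (φ : HiggsLattice.ScalarField P k N) :
    ∃ bound : ((j : Fin k) → HiggsLattice.VecField P j) × (↥D.Ω → EuclideanSpace ℝ (Fin N)) → ℝ,
      Integrable bound ((fluctFamily P D.msq D.a k).prod volume) ∧
      ∀ s ∈ Set.Icc (0 : ℝ) δ, ∀ z : ((j : Fin k) → HiggsLattice.VecField P j) × (↥D.Ω → EuclideanSpace ℝ (Fin N)),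
        |lamVertex D e' s (extendZero D.Ω z.2)
          * (D.kernel14 Ak e' z.1 φ z.2 * D.density14 Ak e' s z.1 (extendZero D.Ω z.2))| ≤ bound z := by
  haveI := HiggsFluctMeasurePos.fluctFamily_isProbability (P := P) hmsq ha hL hk
  set μ := fluctFamily P D.msq D.a k with hμ
  have hη : 0 < P.mesh 0 ^ P.d := pow_pos (P.mesh_pos 0) _
  -- uniform bounds on `[0, δ]`
  obtain ⟨K₁, hK₁⟩ : ∃ K₁ : ℝ, ∀ s ∈ Set.Icc (0 : ℝ) δ, -D.E1 e' s ≤ K₁ := by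
    obtain ⟨C, hC⟩ := isCompact_Icc.exists_bound_of_continuousOn (hE1.continuous.neg.continuousOn (s := Set.Icc 0 δ))
    exact ⟨C, fun s hs => (le_abs_self _).trans ((Real.norm_eq_abs _).symm.le.trans (hC s hs))⟩
  have hbdx : ∀ x : HiggsLattice.Site P 0, ∃ B : ℝ, 0 ≤ B ∧ (x ∈ D.Ω₁ → ∀ s ∈ Set.Icc (0 : ℝ) δ,
      |deriv (fun s => D.dm2 e' s x) s| ≤ B) := by
    intro x
    by_cases hx : x ∈ D.Ω₁
    · obtain ⟨C, hC⟩ := isCompact_Icc.exists_bound_of_continuousOn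
        (((hdm2 x hx).continuous_deriv le_rfl).continuousOn (s := Set.Icc 0 δ))
      exact ⟨max C 0, le_max_right _ _, fun _ s hs =>
        ((Real.norm_eq_abs _).symm.le.trans (hC s hs)).trans (le_max_left _ _)⟩
    · exact ⟨0, le_rfl, fun h => absurd h hx⟩
  choose B hB0 hB using hbdx
  obtain ⟨B₁, hB₁0, hB₁⟩ : ∃ B₁ : ℝ, 0 ≤ B₁ ∧ ∀ s ∈ Set.Icc (0 : ℝ) δ, |deriv (fun s => D.E1 e' s) s| ≤ B₁ := by
    obtain ⟨C, hC⟩ := isCompact_Icc.exists_bound_of_continuousOn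
      ((hE1.continuous_deriv le_rfl).continuousOn (s := Set.Icc 0 δ))
    exact ⟨max C 0, le_max_right _ _, fun s hs => ((Real.norm_eq_abs _).symm.le.trans (hC s hs)).trans (le_max_left _ _)⟩
  set κ : ℝ := prec (B1.aSeq D.a P.L k) (P.mesh k) P.d with hκdef
  set Cκ : ℝ := ((κ / (2 * Real.pi)) ^ ((Module.finrank ℝ (EuclideanSpace ℝ (Fin N)) : ℝ) / 2))
      ^ Fintype.card ↥D.Ωk with hCκ
  have hκ0 : 0 ≤ κ := (prec_pos D ha hL hk1).le
  have hCκ0 : 0 ≤ Cκ := pow_nonneg (Real.rpow_nonneg (by positivity) _) _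
  set c : ℝ := m₀ * D.ell ^ 2 * P.mesh 0 ^ P.d / 2 with hcdef
  have hℓ2 : 0 < D.ell ^ 2 := by positivity
  have hc : 0 < c := by positivity
  set t : ℝ := c / 2 with htdef
  have ht : 0 < t := by positivity
  set A₀ : ℝ := D.lamRun * P.mesh 0 ^ P.d * (2 * (t⁻¹) ^ 2)
      + (1 / 2 : ℝ) * (P.mesh 0 ^ P.d * D.ell ^ 2 * ∑ x ∈ D.Ω₁, B x) * t⁻¹ + B₁ with hA₀
  have hA₀0 : 0 ≤ A₀ := by
    have : 0 ≤ ∑ x ∈ D.Ω₁, B x := Finset.sum_nonneg fun x _ => hB0 x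
    positivity
  refine ⟨fun z => Cκ * A₀ * Real.exp K₁ * ∏ x, Real.exp (-t * ‖z.2 x‖ ^ 2),
    (integrable_const (Cκ * A₀ * Real.exp K₁) (μ := μ)).mul_prod (integrable_gauss_fibre D ht), ?_⟩
  -- the vertex is bounded by `A₀·exp(t·Σ|φ′|²)` on `[0, δ]`
  have hV : ∀ s ∈ Set.Icc (0 : ℝ) δ, ∀ φ' : HiggsLattice.ScalarField P 0 N,
      |lamVertex D e' s φ'| ≤ A₀ * Real.exp (t * sqSum φ') := by
    intro s hs φ'
    have hS0 := sqSum_nonneg φ'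
    have hex1 : 1 ≤ Real.exp (t * sqSum φ') := Real.one_le_exp (mul_nonneg ht.le hS0)
    have hq4 : |D.lamRun * ∑ x ∈ D.Ω₁, P.mesh 0 ^ P.d * ‖φ' x‖ ^ 4|
        ≤ D.lamRun * P.mesh 0 ^ P.d * (2 * (t⁻¹) ^ 2) * Real.exp (t * sqSum φ') := by
      rw [abs_of_nonneg (mul_nonneg hrun (Finset.sum_nonneg fun x _ => by positivity))]
      have h1 := quartic_le_sqSum_sq D φ'
      have h2 := sq_le_inv_sq_mul_exp ht hS0
      calc D.lamRun * ∑ x ∈ D.Ω₁, P.mesh 0 ^ P.d * ‖φ' x‖ ^ 4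
          ≤ D.lamRun * (P.mesh 0 ^ P.d * (sqSum φ') ^ 2) := mul_le_mul_of_nonneg_left h1 hrun
        _ ≤ D.lamRun * (P.mesh 0 ^ P.d * (2 * (t⁻¹) ^ 2 * Real.exp (t * sqSum φ'))) :=
            mul_le_mul_of_nonneg_left (mul_le_mul_of_nonneg_left h2 hη.le) hrun
        _ = D.lamRun * P.mesh 0 ^ P.d * (2 * (t⁻¹) ^ 2) * Real.exp (t * sqSum φ') := by ring
    have hmass2 : |(1 / 2 : ℝ) * ∑ x ∈ D.Ω₁, P.mesh 0 ^ P.d * deriv (fun s => D.dm2 e' s x) s * D.ell ^ 2 * ‖φ' x‖ ^ 2|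
        ≤ (1 / 2 : ℝ) * (P.mesh 0 ^ P.d * D.ell ^ 2 * ∑ x ∈ D.Ω₁, B x) * t⁻¹ * Real.exp (t * sqSum φ') := by
      rw [abs_mul, abs_of_pos (by norm_num : (0 : ℝ) < 1 / 2)]
      have h1 : |∑ x ∈ D.Ω₁, P.mesh 0 ^ P.d * deriv (fun s => D.dm2 e' s x) s * D.ell ^ 2 * ‖φ' x‖ ^ 2|
          ≤ ∑ x ∈ D.Ω₁, P.mesh 0 ^ P.d * B x * D.ell ^ 2 * sqSum φ' := by
        refine (Finset.abs_sum_le_sum_abs _ _).trans (Finset.sum_le_sum fun x hx => ?_)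
        rw [abs_mul, abs_mul, abs_mul, abs_of_pos hη, abs_of_pos hℓ2, abs_of_nonneg (sq_nonneg ‖φ' x‖)]
        have hb := hB x hx s hs
        have hr := B3Eq15OneSidedInteraction.sq_le_sqSum φ' x
        have := mul_le_mul hb hr (sq_nonneg _) (hB0 x)
        calc P.mesh 0 ^ P.d * |deriv (fun s => D.dm2 e' s x) s| * D.ell ^ 2 * ‖φ' x‖ ^ 2
            = P.mesh 0 ^ P.d * D.ell ^ 2 * (|deriv (fun s => D.dm2 e' s x) s| * ‖φ' x‖ ^ 2) := by ring
          _ ≤ P.mesh 0 ^ P.d * D.ell ^ 2 * (B x * sqSum φ') :=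
              mul_le_mul_of_nonneg_left this (mul_nonneg hη.le hℓ2.le)
          _ = P.mesh 0 ^ P.d * B x * D.ell ^ 2 * sqSum φ' := by ring
      have h2 : ∑ x ∈ D.Ω₁, P.mesh 0 ^ P.d * B x * D.ell ^ 2 * sqSum φ'
          = (P.mesh 0 ^ P.d * D.ell ^ 2 * ∑ x ∈ D.Ω₁, B x) * sqSum φ' := by
        rw [Finset.mul_sum, Finset.sum_mul]
        refine Finset.sum_congr rfl fun x _ => ?_
        ring
      have h3 := le_inv_mul_exp ht (sqSum φ')
      have hBs : 0 ≤ P.mesh 0 ^ P.d * D.ell ^ 2 * ∑ x ∈ D.Ω₁, B x :=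
        mul_nonneg (mul_nonneg hη.le hℓ2.le) (Finset.sum_nonneg fun x _ => hB0 x)
      rw [h2] at h1
      calc (1 / 2 : ℝ) * |∑ x ∈ D.Ω₁, P.mesh 0 ^ P.d * deriv (fun s => D.dm2 e' s x) s * D.ell ^ 2 * ‖φ' x‖ ^ 2|
          ≤ (1 / 2 : ℝ) * ((P.mesh 0 ^ P.d * D.ell ^ 2 * ∑ x ∈ D.Ω₁, B x) * sqSum φ') :=
            mul_le_mul_of_nonneg_left h1 (by norm_num)
        _ ≤ (1 / 2 : ℝ) * ((P.mesh 0 ^ P.d * D.ell ^ 2 * ∑ x ∈ D.Ω₁, B x) * (t⁻¹ * Real.exp (t * sqSum φ'))) :=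
            mul_le_mul_of_nonneg_left (mul_le_mul_of_nonneg_left h3 hBs) (by norm_num)
        _ = (1 / 2 : ℝ) * (P.mesh 0 ^ P.d * D.ell ^ 2 * ∑ x ∈ D.Ω₁, B x) * t⁻¹ * Real.exp (t * sqSum φ') := by ring
    have hE : |deriv (fun s => D.E1 e' s) s| ≤ B₁ * Real.exp (t * sqSum φ') :=
      (hB₁ s hs).trans (le_mul_of_one_le_right hB₁0 hex1)
    rw [lamVertex_def]
    refine (abs_add_le _ _).trans ((add_le_add ((abs_add_le _ _).trans (add_le_add hq4 hmass2)) hE).trans ?_)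
    rw [hA₀]
    ring_nf
    rfl
  intro s hs z
  have hq : 0 ≤ s * D.lamRun := mul_nonneg hs.1 hrun
  have hkern := kernel14_le D ha.le Ak e' z.1 φ z.2
  have hkern0 := D.kernel14_nonneg ha.le Ak e' z.1 φ z.2
  have hdens := density14_le_explicit D hℓ hm₀ hm₀m (hmass s hs) hq Ak z.1 (extendZero D.Ω z.2)
  have hdens0 := (D.density14_pos Ak e' s z.1 (extendZero D.Ω z.2)).le
  have hv := hV s hs (extendZero D.Ω z.2)
  have hS : sqSum (extendZero D.Ω z.2) = ∑ x, ‖z.2 x‖ ^ 2 := sqSum_extendZero D.Ω z.2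
  rw [abs_mul, abs_of_nonneg (mul_nonneg hkern0 hdens0)]
  have hprod : D.kernel14 Ak e' z.1 φ z.2 * D.density14 Ak e' s z.1 (extendZero D.Ω z.2)
      ≤ Cκ * Real.exp (-D.E1 e' s - c * sqSum (extendZero D.Ω z.2)) := by
    have e2 : -D.E1 e' s - m₀ * D.ell ^ 2 * P.mesh 0 ^ P.d / 2 * sqSum (extendZero D.Ω z.2)
        = -D.E1 e' s - c * sqSum (extendZero D.Ω z.2) := by rw [hcdef]
    rw [← e2]
    exact mul_le_mul hkern hdens hdens0 hCκ0
  have hexp : Real.exp (-D.E1 e' s - c * sqSum (extendZero D.Ω z.2))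
      ≤ Real.exp K₁ * Real.exp (-(c * sqSum (extendZero D.Ω z.2))) := by
    rw [← Real.exp_add, Real.exp_le_exp]
    linarith [hK₁ s hs]
  have egauss : Real.exp (t * sqSum (extendZero D.Ω z.2)) * Real.exp (-(c * sqSum (extendZero D.Ω z.2)))
      = ∏ x, Real.exp (-t * ‖z.2 x‖ ^ 2) := by
    rw [← Real.exp_add, ← Real.exp_sum, hS, htdef, Finset.mul_sum, Finset.mul_sum, ← Finset.sum_neg_distrib,
      ← Finset.sum_add_distrib]
    refine congrArg Real.exp (Finset.sum_congr rfl fun x _ => ?_)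
    ring
  calc |lamVertex D e' s (extendZero D.Ω z.2)|
        * (D.kernel14 Ak e' z.1 φ z.2 * D.density14 Ak e' s z.1 (extendZero D.Ω z.2))
      ≤ (A₀ * Real.exp (t * sqSum (extendZero D.Ω z.2)))
          * (Cκ * (Real.exp K₁ * Real.exp (-(c * sqSum (extendZero D.Ω z.2))))) :=
        mul_le_mul hv (hprod.trans (mul_le_mul_of_nonneg_left hexp hCκ0)) (mul_nonneg hkern0 hdens0)
          (mul_nonneg hA₀0 (Real.exp_pos _).le)
    _ = Cκ * A₀ * Real.exp K₁ * (Real.exp (t * sqSum (extendZero D.Ω z.2))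
          * Real.exp (-(c * sqSum (extendZero D.Ω z.2)))) := by ring
    _ = Cκ * A₀ * Real.exp K₁ * ∏ x, Real.exp (-t * ‖z.2 x‖ ^ 2) := by rw [egauss]

/-- **The derivative of the nested integral of (1.4) in `λ′` EXISTS AT EVERY `λ′₀ ∈ [0, δ]`** (within `[0, δ]`;
two-sided at interior points) and equals `−∫∫ V(λ′₀)·t·exp[…]|_{λ′₀}` (hypotheses of §7).
[cite: Balaban1983Higgs3, (1.4)–(1.5) p.412] -/
theorem hasDerivWithinAt_integral_integrand14_lam_Icc (hmsq : 0 < D.msq) (ha : 0 < D.a) (hL : 1 < (P.L : ℝ))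
    (hk1 : 1 ≤ k) (hk : k ≤ P.K) (hℓ : D.ell ≠ 0) (hrun : 0 ≤ D.lamRun) {e' δ m₀ : ℝ} (hm₀ : 0 < m₀)
    (hm₀m : m₀ ≤ D.m2) (hmass : ∀ s ∈ Set.Icc (0 : ℝ) δ, ∀ x ∈ D.Ω₁, m₀ ≤ D.m2 + D.dm2 e' s x)
    (hdm2 : ∀ x ∈ D.Ω₁, ContDiff ℝ 1 (fun s => D.dm2 e' s x)) (hE1 : ContDiff ℝ 1 (fun s => D.E1 e' s))
    (Ak : HiggsLattice.VecField P 0) (φ : HiggsLattice.ScalarField P k N) {s₀ : ℝ} (hs₀ : s₀ ∈ Set.Icc (0 : ℝ) δ) :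
    HasDerivWithinAt (fun s => ∫ A', D.integrand14 e' s Ak φ A' ∂(fluctFamily P D.msq D.a k))
      (-(∫ z, lamVertex D e' s₀ (extendZero D.Ω z.2)
          * (D.kernel14 Ak e' z.1 φ z.2 * D.density14 Ak e' s₀ z.1 (extendZero D.Ω z.2))
          ∂((fluctFamily P D.msq D.a k).prod volume))) (Set.Icc 0 δ) s₀ := by
  haveI := HiggsFluctMeasurePos.fluctFamily_isProbability (P := P) hmsq ha hL hk
  set μ := fluctFamily P D.msq D.a k with hμ
  have hm2 : 0 < D.m2 := lt_of_lt_of_le hm₀ hm₀m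
  have hdm2d : ∀ x ∈ D.Ω₁, ∀ s, DifferentiableAt ℝ (fun s => D.dm2 e' s x) s :=
    fun x hx s => ((hdm2 x hx).differentiable one_ne_zero).differentiableAt
  have hE1d : ∀ s, DifferentiableAt ℝ (fun s => D.E1 e' s) s := fun s => (hE1.differentiable one_ne_zero).differentiableAt
  set Pf : ℝ → ((j : Fin k) → HiggsLattice.VecField P j) × (↥D.Ω → EuclideanSpace ℝ (Fin N)) → ℝ :=
    fun s z => D.kernel14 Ak e' z.1 φ z.2 * D.density14 Ak e' s z.1 (extendZero D.Ω z.2) with hPf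
  set Pd : ℝ → ((j : Fin k) → HiggsLattice.VecField P j) × (↥D.Ω → EuclideanSpace ℝ (Fin N)) → ℝ :=
    fun s z => -lamVertex D e' s (extendZero D.Ω z.2) * Pf s z with hPd
  have hderiv : ∀ z s, HasDerivAt (fun s => Pf s z) (Pd s z) s := by
    intro z s
    have h := (hasDerivAt_density14_lam D Ak e' z.1 (extendZero D.Ω z.2) (fun x hx => hdm2d x hx s)
      (hE1d s)).const_mul (D.kernel14 Ak e' z.1 φ z.2)
    refine h.congr_deriv ?_
    simp only [hPd, hPf]
    ring
  obtain ⟨bound, hbound_int, hbound⟩ :=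
    exists_lamDeriv_majorant D hmsq ha hL hk1 hk hℓ hrun hm₀ hm₀m hmass hdm2 hE1 Ak φ
  have hPd_le : ∀ s ∈ Set.Icc (0 : ℝ) δ, ∀ z, |Pd s z| ≤ bound z := by
    intro s hs z
    have h := hbound s hs z
    simp only [hPd, hPf]
    rw [neg_mul, abs_neg]
    exact h
  have hPf_cont : ∀ s, Continuous (Pf s) := fun s =>
    continuous_fibre14₄ D e' s continuous_const continuous_fst continuous_const continuous_snd
  have hreg : ∀ s ∈ Set.Icc (0 : ℝ) δ, 0 ≤ s * D.lamRun ∧ (0 < s * D.lamRun ∨ ∀ x ∈ D.Ω₁, 0 < D.m2 + D.dm2 e' s x) :=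
    fun s hs => ⟨mul_nonneg hs.1 hrun, Or.inr fun x hx => lt_of_lt_of_le hm₀ (hmass s hs x hx)⟩
  have hPf_int : ∀ s ∈ Set.Icc (0 : ℝ) δ, Integrable (Pf s) (μ.prod volume) := fun s hs =>
    (integral_integrand14_eq_integral_prod D hmsq ha hL hk hm2 hℓ (hreg s hs).1 (hreg s hs).2 Ak φ).1
  have hZ : ∀ s ∈ Set.Icc (0 : ℝ) δ, ∫ A', D.integrand14 e' s Ak φ A' ∂μ = ∫ z, Pf s z ∂(μ.prod volume) :=
    fun s hs => (integral_integrand14_eq_integral_prod D hmsq ha hL hk hm2 hℓ (hreg s hs).1 (hreg s hs).2 Ak φ).2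
  -- the difference quotients along `𝓝[[0,δ] \ {s₀}] s₀`
  rw [hasDerivWithinAt_iff_tendsto_slope]
  set F : ℝ → ((j : Fin k) → HiggsLattice.VecField P j) × (↥D.Ω → EuclideanSpace ℝ (Fin N)) → ℝ :=
    fun s z => slope (fun s => Pf s z) s₀ s with hF
  have hev : ∀ᶠ s in 𝓝[Set.Icc (0 : ℝ) δ \ {s₀}] s₀, s ∈ Set.Icc (0 : ℝ) δ \ {s₀} := self_mem_nhdsWithin
  have key : ∀ s ∈ Set.Icc (0 : ℝ) δ \ {s₀},
      slope (fun s => ∫ A', D.integrand14 e' s Ak φ A' ∂μ) s₀ s = ∫ z, F s z ∂(μ.prod volume) := by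
    intro s hs
    rw [slope_def_field, hZ s hs.1, hZ s₀ hs₀, ← integral_sub (hPf_int s hs.1) (hPf_int s₀ hs₀), ← integral_div]
    refine integral_congr_ae (Filter.Eventually.of_forall fun z => ?_)
    simp only [hF, slope_def_field]
  have hmeas : ∀ᶠ s in 𝓝[Set.Icc (0 : ℝ) δ \ {s₀}] s₀, AEStronglyMeasurable (F s) (μ.prod volume) := by
    refine Filter.Eventually.of_forall fun s => ?_
    have hc : Continuous fun z => (Pf s z - Pf s₀ z) / (s - s₀) := ((hPf_cont s).sub (hPf_cont s₀)).div_const _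
    refine (hc.congr fun z => ?_).aestronglyMeasurable
    simp only [hF, slope_def_field]
  have hbd : ∀ᶠ s in 𝓝[Set.Icc (0 : ℝ) δ \ {s₀}] s₀, ∀ᵐ z ∂(μ.prod volume), ‖F s z‖ ≤ bound z := by
    filter_upwards [hev] with s hs
    refine Filter.Eventually.of_forall fun z => ?_
    have hne : s ≠ s₀ := hs.2
    rcases lt_or_gt_of_ne hne with hlt | hgt
    · -- `s < s₀`: mean value theorem on `[s, s₀]`
      obtain ⟨c', hc', hc'eq⟩ := exists_hasDerivAt_eq_slope (fun s => Pf s z) (fun s => Pd s z) hlt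
        (HasDerivAt.continuousOn fun s _ => hderiv z s) (fun s _ => hderiv z s)
      have hcI : c' ∈ Set.Icc (0 : ℝ) δ := ⟨hs.1.1.trans hc'.1.le, (hc'.2.trans_le hs₀.2).le⟩
      have eF : F s z = Pd c' z := by
        rw [hc'eq, hF]
        simp only [slope_def_field]
        rw [show Pf s₀ z - Pf s z = -(Pf s z - Pf s₀ z) by ring, show s₀ - s = -(s - s₀) by ring, neg_div_neg_eq]
      rw [Real.norm_eq_abs, eF]
      exact hPd_le c' hcI z
    · -- `s₀ < s`: mean value theorem on `[s₀, s]`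
      obtain ⟨c', hc', hc'eq⟩ := exists_hasDerivAt_eq_slope (fun s => Pf s z) (fun s => Pd s z) hgt
        (HasDerivAt.continuousOn fun s _ => hderiv z s) (fun s _ => hderiv z s)
      have hcI : c' ∈ Set.Icc (0 : ℝ) δ := ⟨hs₀.1.trans hc'.1.le, (hc'.2.trans_le hs.1.2).le⟩
      have eF : F s z = Pd c' z := by
        rw [hc'eq, hF]
        simp only [slope_def_field]
      rw [Real.norm_eq_abs, eF]
      exact hPd_le c' hcI z
  have hlim : ∀ᵐ z ∂(μ.prod volume),
      Filter.Tendsto (fun s => F s z) (𝓝[Set.Icc (0 : ℝ) δ \ {s₀}] s₀) (𝓝 (Pd s₀ z)) := by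
    refine Filter.Eventually.of_forall fun z => ?_
    have htend := (hderiv z s₀).tendsto_slope
    have hmono : 𝓝[Set.Icc (0 : ℝ) δ \ {s₀}] s₀ ≤ 𝓝[≠] s₀ := nhdsWithin_mono _ fun x hx => hx.2
    exact htend.mono_left hmono
  have hT := tendsto_integral_filter_of_dominated_convergence bound hmeas hbd hbound_int hlim
  have hlim_eq : (-(∫ z, lamVertex D e' s₀ (extendZero D.Ω z.2)
        * (D.kernel14 Ak e' z.1 φ z.2 * D.density14 Ak e' s₀ z.1 (extendZero D.Ω z.2)) ∂(μ.prod volume)))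
      = ∫ z, Pd s₀ z ∂(μ.prod volume) := by
    rw [← integral_neg]
    refine integral_congr_ae (Filter.Eventually.of_forall fun z => ?_)
    simp only [hPd, hPf]
    ring
  rw [hlim_eq]
  refine hT.congr' ?_
  filter_upwards [hev] with s hs using (key s hs).symm

/-- **… and the derivative is CONTINUOUS on `[0, δ]`**: `λ′ ↦ ∫∫ V(λ′)·t·exp[…]|_{λ′}` is continuous (dominated
convergence with the majorant of `exists_lamDeriv_majorant`); so `λ′ ↦ exp(−E_k)` is `C¹` on `[0, δ]`.
[cite: Balaban1983Higgs3, (1.4)–(1.5) p.412] -/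
theorem continuousOn_integral_lamVertex_mul (hmsq : 0 < D.msq) (ha : 0 < D.a) (hL : 1 < (P.L : ℝ))
    (hk1 : 1 ≤ k) (hk : k ≤ P.K) (hℓ : D.ell ≠ 0) (hrun : 0 ≤ D.lamRun) {e' δ m₀ : ℝ} (hm₀ : 0 < m₀)
    (hm₀m : m₀ ≤ D.m2) (hmass : ∀ s ∈ Set.Icc (0 : ℝ) δ, ∀ x ∈ D.Ω₁, m₀ ≤ D.m2 + D.dm2 e' s x)
    (hdm2 : ∀ x ∈ D.Ω₁, ContDiff ℝ 1 (fun s => D.dm2 e' s x)) (hE1 : ContDiff ℝ 1 (fun s => D.E1 e' s))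
    (Ak : HiggsLattice.VecField P 0) (φ : HiggsLattice.ScalarField P k N) :
    ContinuousOn (fun s => ∫ z, lamVertex D e' s (extendZero D.Ω z.2)
        * (D.kernel14 Ak e' z.1 φ z.2 * D.density14 Ak e' s z.1 (extendZero D.Ω z.2))
        ∂((fluctFamily P D.msq D.a k).prod volume)) (Set.Icc 0 δ) := by
  haveI := HiggsFluctMeasurePos.fluctFamily_isProbability (P := P) hmsq ha hL hk
  obtain ⟨bound, hbound_int, hbound⟩ :=
    exists_lamDeriv_majorant D hmsq ha hL hk1 hk hℓ hrun hm₀ hm₀m hmass hdm2 hE1 Ak φ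
  -- joint continuity of `(s, z) ↦ V(s, φ′↾_Ω)·fibre(s, z)`: in `z` for measurability, in `s` for the limit
  have hVz : ∀ s, Continuous fun z : ((j : Fin k) → HiggsLattice.VecField P j) × (↥D.Ω → EuclideanSpace ℝ (Fin N)) =>
      lamVertex D e' s (extendZero D.Ω z.2) := by
    intro s
    simp only [lamVertex_def]
    have hx : ∀ x : HiggsLattice.Site P 0, Continuous fun z : ((j : Fin k) → HiggsLattice.VecField P j)
        × (↥D.Ω → EuclideanSpace ℝ (Fin N)) => ‖extendZero D.Ω z.2 x‖ :=
      fun x => ((continuous_apply x).comp ((continuous_extendZero D.Ω).comp continuous_snd)).norm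
    exact ((continuous_const.mul (continuous_finsetSum _ fun x _ => continuous_const.mul ((hx x).pow 4))).add
      (continuous_const.mul (continuous_finsetSum _ fun x _ =>
        ((continuous_const.mul continuous_const).mul continuous_const).mul ((hx x).pow 2)))).add continuous_const
  have hVs : ∀ φ' : HiggsLattice.ScalarField P 0 N, Continuous fun s : ℝ => lamVertex D e' s φ' := by
    intro φ'
    simp only [lamVertex_def]
    refine (continuous_const.add (continuous_const.mul (continuous_finsetSum _ fun x hx => ?_))).add
      (hE1.continuous_deriv le_rfl)
    exact ((continuous_const.mul ((hdm2 x hx).continuous_deriv le_rfl)).mul continuous_const).mul continuous_const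
  have hdens_s : ∀ (A' : (j : Fin k) → HiggsLattice.VecField P j) (φ' : HiggsLattice.ScalarField P 0 N),
      Continuous fun s : ℝ => D.density14 Ak e' s A' φ' := by
    intro A' φ'
    simp only [Data14.density14_eq]
    refine (((continuous_const.sub ((continuous_id.mul continuous_const).mul continuous_const)).sub
      (continuous_const.mul (continuous_finsetSum _ fun x hx => ?_))).sub hE1.continuous).rexp
    by_cases hx1 : x ∈ D.Ω₁
    · exact ((continuous_const.mul (hdm2 x hx1).continuous).mul continuous_const).mul continuous_const
    · exact absurd hx hx1
  refine MeasureTheory.continuousOn_of_dominated (bound := bound) (fun s _ => ((hVz s).mul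
      (continuous_fibre14₄ D e' s continuous_const continuous_fst continuous_const
        continuous_snd)).aestronglyMeasurable)
    (fun s hs => Filter.Eventually.of_forall fun z => ?_) hbound_int
    (Filter.Eventually.of_forall fun z => ?_)
  · rw [Real.norm_eq_abs]
    exact hbound s hs z
  · exact ((hVs _).mul (continuous_const.mul (hdens_s z.1 _))).continuousOn

/-- **`∂E_k/∂λ′` exists at every `λ′₀ ∈ [0, δ]` (within `[0, δ]`) and equals the normalized expectation `⟨V⟩_{λ′₀}`
of the `λ′`-vertex in the `λ′₀`-measure.** [cite: Balaban1983Higgs3, (1.4)–(1.5) p.412] -/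
theorem hasDerivWithinAt_auxE_lam_Icc (hmsq : 0 < D.msq) (ha : 0 < D.a) (hL : 1 < (P.L : ℝ))
    (hk1 : 1 ≤ k) (hk : k ≤ P.K) (hℓ : D.ell ≠ 0) (hrun : 0 ≤ D.lamRun) {e' δ m₀ : ℝ} (hm₀ : 0 < m₀)
    (hm₀m : m₀ ≤ D.m2) (hmass : ∀ s ∈ Set.Icc (0 : ℝ) δ, ∀ x ∈ D.Ω₁, m₀ ≤ D.m2 + D.dm2 e' s x)
    (hdm2 : ∀ x ∈ D.Ω₁, ContDiff ℝ 1 (fun s => D.dm2 e' s x)) (hE1 : ContDiff ℝ 1 (fun s => D.E1 e' s))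
    (Ak : HiggsLattice.VecField P 0) (φ : HiggsLattice.ScalarField P k N) {s₀ : ℝ} (hs₀ : s₀ ∈ Set.Icc (0 : ℝ) δ) :
    HasDerivWithinAt (fun s => D.auxE e' s Ak φ)
      ((∫ z, lamVertex D e' s₀ (extendZero D.Ω z.2)
          * (D.kernel14 Ak e' z.1 φ z.2 * D.density14 Ak e' s₀ z.1 (extendZero D.Ω z.2))
          ∂((fluctFamily P D.msq D.a k).prod volume))
        / ∫ A', D.integrand14 e' s₀ Ak φ A' ∂(fluctFamily P D.msq D.a k)) (Set.Icc 0 δ) s₀ := by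
  have hZ := hasDerivWithinAt_integral_integrand14_lam_Icc D hmsq ha hL hk1 hk hℓ hrun hm₀ hm₀m hmass hdm2 hE1 Ak φ hs₀
  have hm2 : 0 < D.m2 := lt_of_lt_of_le hm₀ hm₀m
  have hreg0 : 0 < s₀ * D.lamRun ∨ ∀ x ∈ D.Ω₁, 0 < D.m2 + D.dm2 e' s₀ x :=
    Or.inr fun x hx => lt_of_lt_of_le hm₀ (hmass s₀ hs₀ x hx)
  have hpos := integral_integrand14_pos D hmsq ha hL hk1 hk hm2 hℓ (mul_nonneg hs₀.1 hrun) hreg0 Ak φ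
  have hlog := (hZ.log hpos.ne').neg
  refine (hlog.congr_deriv ?_).congr_of_eventuallyEq (Filter.Eventually.of_forall fun s => rfl) rfl
  rw [neg_div, neg_neg]

end LamC1

/-! ## 10. The SECOND right `λ′`-derivative at `0⁺` (v1.6): the `β = 2` term of the repaired (1.5) —
`∂⁺²E_k/∂λ′²|₀ = ⟨∂_{λ′}V⟩ − (⟨V²⟩ − ⟨V⟩²)`, the first PROPAGATOR structure (a connected two-vertex expectation) -/

section LamSecond

variable {k : ℕ} (D : Data14 P N k)

/-- The `λ′`-DERIVATIVE OF THE `λ′`-VERTEX: `∂_{λ′}V(e′,l,φ′) = ½Σ_{x∈Ω₁}η^d(∂²_{λ′}δm²)(e′,l,x)(L^kε)²|φ′(x)|² +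
(∂²_{λ′}E₁)(e′,l)` (the quartic carries no further `λ′`). (ours) [cite: Balaban1983Higgs3, (1.4)–(1.7) pp.412–413] -/
noncomputable def lamVertex2 (e' l : ℝ) (φ' : HiggsLattice.ScalarField P 0 N) : ℝ :=
  (1 / 2 : ℝ) * ∑ x ∈ D.Ω₁, P.mesh 0 ^ P.d * iteratedDeriv 2 (fun s => D.dm2 e' s x) l * D.ell ^ 2 * ‖φ' x‖ ^ 2
    + iteratedDeriv 2 (fun s => D.E1 e' s) l

/-- Unfolding of `lamVertex2`. [cite: Balaban1983Higgs3, (1.4)–(1.7) pp.412–413] -/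
theorem lamVertex2_def (e' l : ℝ) (φ' : HiggsLattice.ScalarField P 0 N) :
    lamVertex2 D e' l φ' = (1 / 2 : ℝ) * ∑ x ∈ D.Ω₁, P.mesh 0 ^ P.d
        * iteratedDeriv 2 (fun s => D.dm2 e' s x) l * D.ell ^ 2 * ‖φ' x‖ ^ 2
      + iteratedDeriv 2 (fun s => D.E1 e' s) l := rfl

/-- `C²` data: the first derivative is `C¹` and has derivative the second iterated derivative. [folklore] -/
private theorem hasDerivAt_deriv_of_contDiff_two {f : ℝ → ℝ} (h : ContDiff ℝ 2 f) (s : ℝ) :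
    HasDerivAt (deriv f) (iteratedDeriv 2 f s) s := by
  have hd : Differentiable ℝ (iteratedDeriv 1 f) := h.differentiable_iteratedDeriv 1 (by norm_num)
  rw [iteratedDeriv_one] at hd
  have h2 : iteratedDeriv 2 f = deriv (deriv f) := by
    rw [show (2 : ℕ) = 1 + 1 from rfl, iteratedDeriv_succ, iteratedDeriv_one]
  rw [h2]
  exact (hd s).hasDerivAt

/-- [folklore] -/
private theorem contDiff_one_of_two {f : ℝ → ℝ} (h : ContDiff ℝ 2 f) : ContDiff ℝ 1 f :=
  h.of_le (by norm_num)

/-- **The vertex is differentiable in `λ′`** for `C²` data, with derivative `lamVertex2`.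
[cite: Balaban1983Higgs3, (1.4)–(1.7) pp.412–413] -/
theorem hasDerivAt_lamVertex (e' : ℝ) (φ' : HiggsLattice.ScalarField P 0 N) {l : ℝ}
    (hdm2 : ∀ x ∈ D.Ω₁, ContDiff ℝ 2 (fun s => D.dm2 e' s x)) (hE1 : ContDiff ℝ 2 (fun s => D.E1 e' s)) :
    HasDerivAt (fun s => lamVertex D e' s φ') (lamVertex2 D e' l φ') l := by
  have h3 : HasDerivAt (fun s : ℝ => ∑ x ∈ D.Ω₁, P.mesh 0 ^ P.d * deriv (fun u => D.dm2 e' u x) s * D.ell ^ 2 * ‖φ' x‖ ^ 2)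
      (∑ x ∈ D.Ω₁, P.mesh 0 ^ P.d * iteratedDeriv 2 (fun u => D.dm2 e' u x) l * D.ell ^ 2 * ‖φ' x‖ ^ 2) l := by
    refine HasDerivAt.fun_sum (u := D.Ω₁)
      (A := fun x s => P.mesh 0 ^ P.d * deriv (fun u => D.dm2 e' u x) s * D.ell ^ 2 * ‖φ' x‖ ^ 2)
      (A' := fun x => P.mesh 0 ^ P.d * iteratedDeriv 2 (fun u => D.dm2 e' u x) l * D.ell ^ 2 * ‖φ' x‖ ^ 2)
      fun x hx => ?_
    exact (((hasDerivAt_deriv_of_contDiff_two (hdm2 x hx) l).const_mul (P.mesh 0 ^ P.d)).mul_const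
      (D.ell ^ 2)).mul_const (‖φ' x‖ ^ 2)
  have h : HasDerivAt (fun s : ℝ => D.lamRun * ∑ x ∈ D.Ω₁, P.mesh 0 ^ P.d * ‖φ' x‖ ^ 4
      + (1 / 2 : ℝ) * ∑ x ∈ D.Ω₁, P.mesh 0 ^ P.d * deriv (fun u => D.dm2 e' u x) s * D.ell ^ 2 * ‖φ' x‖ ^ 2
      + deriv (fun u => D.E1 e' u) s)
      (0 + (1 / 2 : ℝ) * ∑ x ∈ D.Ω₁, P.mesh 0 ^ P.d * iteratedDeriv 2 (fun u => D.dm2 e' u x) l * D.ell ^ 2 * ‖φ' x‖ ^ 2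
      + iteratedDeriv 2 (fun u => D.E1 e' u) l) l :=
    ((hasDerivAt_const l (D.lamRun * ∑ x ∈ D.Ω₁, P.mesh 0 ^ P.d * ‖φ' x‖ ^ 4)).add
      (h3.const_mul (1 / 2 : ℝ))).add (hasDerivAt_deriv_of_contDiff_two hE1 l)
  have e : (fun s => lamVertex D e' s φ') = fun s : ℝ => D.lamRun * ∑ x ∈ D.Ω₁, P.mesh 0 ^ P.d * ‖φ' x‖ ^ 4
      + (1 / 2 : ℝ) * ∑ x ∈ D.Ω₁, P.mesh 0 ^ P.d * deriv (fun u => D.dm2 e' u x) s * D.ell ^ 2 * ‖φ' x‖ ^ 2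
      + deriv (fun u => D.E1 e' u) s := by
    funext s; rw [lamVertex_def]
  rw [e]
  refine h.congr_deriv ?_
  rw [lamVertex2_def]; ring

/-- A vertex-shaped function of `φ′` with coefficients bounded on `[0, δ]` is `≤ A·exp(tΣ|φ′|²)` there, for every
`t > 0`. [folklore] -/
private theorem exists_vertexShape_bound (hrun : 0 ≤ D.lamRun) {t : ℝ} (ht : 0 < t) {δ q : ℝ} (hq : 0 ≤ q)
    (hqr : q ≤ D.lamRun) {g : HiggsLattice.Site P 0 → ℝ → ℝ} {h : ℝ → ℝ}
    (hg : ∀ x ∈ D.Ω₁, ContinuousOn (g x) (Set.Icc 0 δ)) (hh : ContinuousOn h (Set.Icc 0 δ)) :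
    ∃ A : ℝ, 0 ≤ A ∧ ∀ s ∈ Set.Icc (0 : ℝ) δ, ∀ φ' : HiggsLattice.ScalarField P 0 N,
      |q * ∑ x ∈ D.Ω₁, P.mesh 0 ^ P.d * ‖φ' x‖ ^ 4
        + (1 / 2 : ℝ) * ∑ x ∈ D.Ω₁, P.mesh 0 ^ P.d * g x s * D.ell ^ 2 * ‖φ' x‖ ^ 2 + h s|
        ≤ A * Real.exp (t * sqSum φ') := by
  have hη : 0 < P.mesh 0 ^ P.d := pow_pos (P.mesh_pos 0) _
  have hℓ2 : 0 ≤ D.ell ^ 2 := sq_nonneg _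
  have hbdx : ∀ x : HiggsLattice.Site P 0, ∃ B : ℝ, 0 ≤ B ∧ (x ∈ D.Ω₁ → ∀ s ∈ Set.Icc (0 : ℝ) δ, |g x s| ≤ B) := by
    intro x
    by_cases hx : x ∈ D.Ω₁
    · obtain ⟨C, hC⟩ := isCompact_Icc.exists_bound_of_continuousOn (hg x hx)
      exact ⟨max C 0, le_max_right _ _, fun _ s hs =>
        ((Real.norm_eq_abs _).symm.le.trans (hC s hs)).trans (le_max_left _ _)⟩
    · exact ⟨0, le_rfl, fun h => absurd h hx⟩
  choose B hB0 hB using hbdx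
  obtain ⟨B₁, hB₁0, hB₁⟩ : ∃ B₁ : ℝ, 0 ≤ B₁ ∧ ∀ s ∈ Set.Icc (0 : ℝ) δ, |h s| ≤ B₁ := by
    obtain ⟨C, hC⟩ := isCompact_Icc.exists_bound_of_continuousOn hh
    exact ⟨max C 0, le_max_right _ _, fun s hs => ((Real.norm_eq_abs _).symm.le.trans (hC s hs)).trans (le_max_left _ _)⟩
  set A₀ : ℝ := q * P.mesh 0 ^ P.d * (2 * (t⁻¹) ^ 2)
      + (1 / 2 : ℝ) * (P.mesh 0 ^ P.d * D.ell ^ 2 * ∑ x ∈ D.Ω₁, B x) * t⁻¹ + B₁ with hA₀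
  have hA₀0 : 0 ≤ A₀ := by
    have : 0 ≤ ∑ x ∈ D.Ω₁, B x := Finset.sum_nonneg fun x _ => hB0 x
    positivity
  refine ⟨A₀, hA₀0, fun s hs φ' => ?_⟩
  have hS0 := sqSum_nonneg φ'
  have hex1 : 1 ≤ Real.exp (t * sqSum φ') := Real.one_le_exp (mul_nonneg ht.le hS0)
  have hq4 : |q * ∑ x ∈ D.Ω₁, P.mesh 0 ^ P.d * ‖φ' x‖ ^ 4|
      ≤ q * P.mesh 0 ^ P.d * (2 * (t⁻¹) ^ 2) * Real.exp (t * sqSum φ') := by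
    rw [abs_of_nonneg (mul_nonneg hq (Finset.sum_nonneg fun x _ => by positivity))]
    have h1 := quartic_le_sqSum_sq D φ'
    have h2 := sq_le_inv_sq_mul_exp ht hS0
    calc q * ∑ x ∈ D.Ω₁, P.mesh 0 ^ P.d * ‖φ' x‖ ^ 4
        ≤ q * (P.mesh 0 ^ P.d * (sqSum φ') ^ 2) := mul_le_mul_of_nonneg_left h1 hq
      _ ≤ q * (P.mesh 0 ^ P.d * (2 * (t⁻¹) ^ 2 * Real.exp (t * sqSum φ'))) :=
          mul_le_mul_of_nonneg_left (mul_le_mul_of_nonneg_left h2 hη.le) hq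
      _ = q * P.mesh 0 ^ P.d * (2 * (t⁻¹) ^ 2) * Real.exp (t * sqSum φ') := by ring
  have hmass2 : |(1 / 2 : ℝ) * ∑ x ∈ D.Ω₁, P.mesh 0 ^ P.d * g x s * D.ell ^ 2 * ‖φ' x‖ ^ 2|
      ≤ (1 / 2 : ℝ) * (P.mesh 0 ^ P.d * D.ell ^ 2 * ∑ x ∈ D.Ω₁, B x) * t⁻¹ * Real.exp (t * sqSum φ') := by
    rw [abs_mul, abs_of_pos (by norm_num : (0 : ℝ) < 1 / 2)]
    have h1 : |∑ x ∈ D.Ω₁, P.mesh 0 ^ P.d * g x s * D.ell ^ 2 * ‖φ' x‖ ^ 2|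
        ≤ ∑ x ∈ D.Ω₁, P.mesh 0 ^ P.d * B x * D.ell ^ 2 * sqSum φ' := by
      refine (Finset.abs_sum_le_sum_abs _ _).trans (Finset.sum_le_sum fun x hx => ?_)
      rw [abs_mul, abs_mul, abs_mul, abs_of_pos hη, abs_of_nonneg hℓ2, abs_of_nonneg (sq_nonneg ‖φ' x‖)]
      have hb := hB x hx s hs
      have hr := B3Eq15OneSidedInteraction.sq_le_sqSum φ' x
      have := mul_le_mul hb hr (sq_nonneg _) (hB0 x)
      calc P.mesh 0 ^ P.d * |g x s| * D.ell ^ 2 * ‖φ' x‖ ^ 2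
          = P.mesh 0 ^ P.d * D.ell ^ 2 * (|g x s| * ‖φ' x‖ ^ 2) := by ring
        _ ≤ P.mesh 0 ^ P.d * D.ell ^ 2 * (B x * sqSum φ') :=
            mul_le_mul_of_nonneg_left this (mul_nonneg hη.le hℓ2)
        _ = P.mesh 0 ^ P.d * B x * D.ell ^ 2 * sqSum φ' := by ring
    have h2 : ∑ x ∈ D.Ω₁, P.mesh 0 ^ P.d * B x * D.ell ^ 2 * sqSum φ'
        = (P.mesh 0 ^ P.d * D.ell ^ 2 * ∑ x ∈ D.Ω₁, B x) * sqSum φ' := by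
      rw [Finset.mul_sum, Finset.sum_mul]
      refine Finset.sum_congr rfl fun x _ => ?_
      ring
    have h3 := le_inv_mul_exp ht (sqSum φ')
    have hBs : 0 ≤ P.mesh 0 ^ P.d * D.ell ^ 2 * ∑ x ∈ D.Ω₁, B x :=
      mul_nonneg (mul_nonneg hη.le hℓ2) (Finset.sum_nonneg fun x _ => hB0 x)
    rw [h2] at h1
    calc (1 / 2 : ℝ) * |∑ x ∈ D.Ω₁, P.mesh 0 ^ P.d * g x s * D.ell ^ 2 * ‖φ' x‖ ^ 2|
        ≤ (1 / 2 : ℝ) * ((P.mesh 0 ^ P.d * D.ell ^ 2 * ∑ x ∈ D.Ω₁, B x) * sqSum φ') :=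
          mul_le_mul_of_nonneg_left h1 (by norm_num)
      _ ≤ (1 / 2 : ℝ) * ((P.mesh 0 ^ P.d * D.ell ^ 2 * ∑ x ∈ D.Ω₁, B x) * (t⁻¹ * Real.exp (t * sqSum φ'))) :=
          mul_le_mul_of_nonneg_left (mul_le_mul_of_nonneg_left h3 hBs) (by norm_num)
      _ = (1 / 2 : ℝ) * (P.mesh 0 ^ P.d * D.ell ^ 2 * ∑ x ∈ D.Ω₁, B x) * t⁻¹ * Real.exp (t * sqSum φ') := by ring
  have hE : |h s| ≤ B₁ * Real.exp (t * sqSum φ') := (hB₁ s hs).trans (le_mul_of_one_le_right hB₁0 hex1)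
  refine (abs_add_le _ _).trans ((add_le_add ((abs_add_le _ _).trans (add_le_add hq4 hmass2)) hE).trans ?_)
  have _ := hrun; have _ := hqr
  rw [hA₀]
  ring_nf
  rfl

/-- Dominated differentiation of a parameter integral at a point of `[0, δ]`, within `[0, δ]` (mean-value majorant
on both sides of the base point). [folklore] -/
private theorem hasDerivWithinAt_integral_Icc_of_dominated {Z : Type*} [MeasurableSpace Z] {ν : Measure Z}
    {F F' : ℝ → Z → ℝ} {bound : Z → ℝ} {δ s₀ : ℝ} (hs₀ : s₀ ∈ Set.Icc (0 : ℝ) δ)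
    (hF_meas : ∀ s, AEStronglyMeasurable (F s) ν) (hF_int : ∀ s ∈ Set.Icc (0 : ℝ) δ, Integrable (F s) ν)
    (hderiv : ∀ z s, HasDerivAt (fun s => F s z) (F' s z) s)
    (hbound : ∀ s ∈ Set.Icc (0 : ℝ) δ, ∀ z, |F' s z| ≤ bound z) (hbound_int : Integrable bound ν) :
    HasDerivWithinAt (fun s => ∫ z, F s z ∂ν) (∫ z, F' s₀ z ∂ν) (Set.Icc 0 δ) s₀ := by
  rw [hasDerivWithinAt_iff_tendsto_slope]
  set G : ℝ → Z → ℝ := fun s z => slope (fun s => F s z) s₀ s with hG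
  have hev : ∀ᶠ s in 𝓝[Set.Icc (0 : ℝ) δ \ {s₀}] s₀, s ∈ Set.Icc (0 : ℝ) δ \ {s₀} := self_mem_nhdsWithin
  have key : ∀ s ∈ Set.Icc (0 : ℝ) δ \ {s₀},
      slope (fun s => ∫ z, F s z ∂ν) s₀ s = ∫ z, G s z ∂ν := by
    intro s hs
    rw [slope_def_field, ← integral_sub (hF_int s hs.1) (hF_int s₀ hs₀), ← integral_div]
    refine integral_congr_ae (Filter.Eventually.of_forall fun z => ?_)
    simp only [hG, slope_def_field]
  have hmeas : ∀ᶠ s in 𝓝[Set.Icc (0 : ℝ) δ \ {s₀}] s₀, AEStronglyMeasurable (G s) ν := by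
    refine Filter.Eventually.of_forall fun s => ?_
    have h : AEStronglyMeasurable (fun z => (s - s₀)⁻¹ * (F s z - F s₀ z)) ν :=
      ((hF_meas s).sub (hF_meas s₀)).const_mul _
    refine h.congr (Filter.Eventually.of_forall fun z => ?_)
    simp only [hG, slope_def_field, div_eq_inv_mul]
  have hbd : ∀ᶠ s in 𝓝[Set.Icc (0 : ℝ) δ \ {s₀}] s₀, ∀ᵐ z ∂ν, ‖G s z‖ ≤ bound z := by
    filter_upwards [hev] with s hs
    refine Filter.Eventually.of_forall fun z => ?_
    rcases lt_or_gt_of_ne (show s ≠ s₀ from hs.2) with hlt | hgt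
    · obtain ⟨c', hc', hc'eq⟩ := exists_hasDerivAt_eq_slope (fun s => F s z) (fun s => F' s z) hlt
        (HasDerivAt.continuousOn fun s _ => hderiv z s) (fun s _ => hderiv z s)
      have hcI : c' ∈ Set.Icc (0 : ℝ) δ := ⟨hs.1.1.trans hc'.1.le, (hc'.2.trans_le hs₀.2).le⟩
      have eG : G s z = F' c' z := by
        rw [hc'eq, hG]
        simp only [slope_def_field]
        rw [show F s₀ z - F s z = -(F s z - F s₀ z) by ring, show s₀ - s = -(s - s₀) by ring, neg_div_neg_eq]
      rw [Real.norm_eq_abs, eG]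
      exact hbound c' hcI z
    · obtain ⟨c', hc', hc'eq⟩ := exists_hasDerivAt_eq_slope (fun s => F s z) (fun s => F' s z) hgt
        (HasDerivAt.continuousOn fun s _ => hderiv z s) (fun s _ => hderiv z s)
      have hcI : c' ∈ Set.Icc (0 : ℝ) δ := ⟨hs₀.1.trans hc'.1.le, (hc'.2.trans_le hs.1.2).le⟩
      have eG : G s z = F' c' z := by
        rw [hc'eq, hG]
        simp only [slope_def_field]
      rw [Real.norm_eq_abs, eG]
      exact hbound c' hcI z
  have hlim : ∀ᵐ z ∂ν, Filter.Tendsto (fun s => G s z) (𝓝[Set.Icc (0 : ℝ) δ \ {s₀}] s₀) (𝓝 (F' s₀ z)) := by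
    refine Filter.Eventually.of_forall fun z => ?_
    exact (hderiv z s₀).tendsto_slope.mono_left (nhdsWithin_mono _ fun x hx => hx.2)
  exact (tendsto_integral_filter_of_dominated_convergence bound hmeas hbd hbound_int hlim).congr'
    (by filter_upwards [hev] with s hs using (key s hs).symm)

/-- **THE SECOND `λ′`-DERIVATIVE OF THE NESTED INTEGRAL**: for data of class `C²` in `λ′` (and the hypotheses of
§7), `λ′ ↦ ∫∫ V(λ′)·t·exp[…]|_{λ′}` — minus the first derivative of `exp(−E_k)` (§9) — is differentiable at every
`λ′₀ ∈ [0, δ]` within `[0, δ]`, with derivative `∫∫ (∂_{λ′}V − V²)(λ′₀)·t·exp[…]|_{λ′₀}`.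
[cite: Balaban1983Higgs3, (1.4)–(1.5) p.412] -/
theorem hasDerivWithinAt_integral_lamVertex_mul_Icc (hmsq : 0 < D.msq) (ha : 0 < D.a) (hL : 1 < (P.L : ℝ))
    (hk1 : 1 ≤ k) (hk : k ≤ P.K) (hℓ : D.ell ≠ 0) (hrun : 0 ≤ D.lamRun) {e' δ m₀ : ℝ} (hm₀ : 0 < m₀)
    (hm₀m : m₀ ≤ D.m2) (hmass : ∀ s ∈ Set.Icc (0 : ℝ) δ, ∀ x ∈ D.Ω₁, m₀ ≤ D.m2 + D.dm2 e' s x)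
    (hdm2 : ∀ x ∈ D.Ω₁, ContDiff ℝ 2 (fun s => D.dm2 e' s x)) (hE1 : ContDiff ℝ 2 (fun s => D.E1 e' s))
    (Ak : HiggsLattice.VecField P 0) (φ : HiggsLattice.ScalarField P k N) {s₀ : ℝ} (hs₀ : s₀ ∈ Set.Icc (0 : ℝ) δ) :
    HasDerivWithinAt (fun s => ∫ z, lamVertex D e' s (extendZero D.Ω z.2)
        * (D.kernel14 Ak e' z.1 φ z.2 * D.density14 Ak e' s z.1 (extendZero D.Ω z.2))
        ∂((fluctFamily P D.msq D.a k).prod volume))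
      (∫ z, (lamVertex2 D e' s₀ (extendZero D.Ω z.2) - lamVertex D e' s₀ (extendZero D.Ω z.2) ^ 2)
        * (D.kernel14 Ak e' z.1 φ z.2 * D.density14 Ak e' s₀ z.1 (extendZero D.Ω z.2))
        ∂((fluctFamily P D.msq D.a k).prod volume)) (Set.Icc 0 δ) s₀ := by
  haveI := HiggsFluctMeasurePos.fluctFamily_isProbability (P := P) hmsq ha hL hk
  set μ := fluctFamily P D.msq D.a k with hμ
  have hη : 0 < P.mesh 0 ^ P.d := pow_pos (P.mesh_pos 0) _
  have hm2 : 0 < D.m2 := lt_of_lt_of_le hm₀ hm₀m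
  have hdm2₁ : ∀ x ∈ D.Ω₁, ContDiff ℝ 1 (fun s => D.dm2 e' s x) := fun x hx => contDiff_one_of_two (hdm2 x hx)
  have hE1₁ : ContDiff ℝ 1 (fun s => D.E1 e' s) := contDiff_one_of_two hE1
  have hdm2d : ∀ x ∈ D.Ω₁, ∀ s, DifferentiableAt ℝ (fun s => D.dm2 e' s x) s :=
    fun x hx s => ((hdm2₁ x hx).differentiable one_ne_zero).differentiableAt
  have hE1d : ∀ s, DifferentiableAt ℝ (fun s => D.E1 e' s) s :=
    fun s => (hE1₁.differentiable one_ne_zero).differentiableAt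
  -- the integrand `G = V·Pf` and its derivative `(W − V²)·Pf`
  set Pf : ℝ → ((j : Fin k) → HiggsLattice.VecField P j) × (↥D.Ω → EuclideanSpace ℝ (Fin N)) → ℝ :=
    fun s z => D.kernel14 Ak e' z.1 φ z.2 * D.density14 Ak e' s z.1 (extendZero D.Ω z.2) with hPf
  set G : ℝ → ((j : Fin k) → HiggsLattice.VecField P j) × (↥D.Ω → EuclideanSpace ℝ (Fin N)) → ℝ :=
    fun s z => lamVertex D e' s (extendZero D.Ω z.2) * Pf s z with hG
  set G' : ℝ → ((j : Fin k) → HiggsLattice.VecField P j) × (↥D.Ω → EuclideanSpace ℝ (Fin N)) → ℝ :=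
    fun s z => (lamVertex2 D e' s (extendZero D.Ω z.2) - lamVertex D e' s (extendZero D.Ω z.2) ^ 2) * Pf s z
    with hG'
  have hderivP : ∀ z s, HasDerivAt (fun s => Pf s z) (-lamVertex D e' s (extendZero D.Ω z.2) * Pf s z) s := by
    intro z s
    have h := (hasDerivAt_density14_lam D Ak e' z.1 (extendZero D.Ω z.2) (fun x hx => hdm2d x hx s)
      (hE1d s)).const_mul (D.kernel14 Ak e' z.1 φ z.2)
    refine h.congr_deriv ?_
    simp only [hPf]
    ring
  have hderiv : ∀ z s, HasDerivAt (fun s => G s z) (G' s z) s := by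
    intro z s
    have h := (hasDerivAt_lamVertex D e' (extendZero D.Ω z.2) (l := s) hdm2 hE1).mul (hderivP z s)
    refine h.congr_deriv ?_
    simp only [hG', hPf]
    ring
  -- majorant: |W| ≤ A₁e^{tS}, |V| ≤ A₀e^{tS} with t = c/4, kernel·density ≤ Cκ e^{K₁} e^{−cS}
  obtain ⟨K₁, hK₁⟩ : ∃ K₁ : ℝ, ∀ s ∈ Set.Icc (0 : ℝ) δ, -D.E1 e' s ≤ K₁ := by
    obtain ⟨C, hC⟩ := isCompact_Icc.exists_bound_of_continuousOn (hE1.continuous.neg.continuousOn (s := Set.Icc 0 δ))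
    exact ⟨C, fun s hs => (le_abs_self _).trans ((Real.norm_eq_abs _).symm.le.trans (hC s hs))⟩
  set κ : ℝ := prec (B1.aSeq D.a P.L k) (P.mesh k) P.d with hκdef
  set Cκ : ℝ := ((κ / (2 * Real.pi)) ^ ((Module.finrank ℝ (EuclideanSpace ℝ (Fin N)) : ℝ) / 2))
      ^ Fintype.card ↥D.Ωk with hCκ
  have hκ0 : 0 ≤ κ := (prec_pos D ha hL hk1).le
  have hCκ0 : 0 ≤ Cκ := pow_nonneg (Real.rpow_nonneg (by positivity) _) _
  set c : ℝ := m₀ * D.ell ^ 2 * P.mesh 0 ^ P.d / 2 with hcdef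
  have hℓ2 : 0 < D.ell ^ 2 := by positivity
  have hc : 0 < c := by positivity
  set t : ℝ := c / 4 with htdef
  have ht : 0 < t := by positivity
  obtain ⟨A₀, hA₀0, hA₀⟩ := exists_vertexShape_bound D hrun ht hrun le_rfl (δ := δ)
    (g := fun x s => deriv (fun u => D.dm2 e' u x) s) (h := fun s => deriv (fun u => D.E1 e' u) s)
    (fun x hx => ((hdm2₁ x hx).continuous_deriv le_rfl).continuousOn) (hE1₁.continuous_deriv le_rfl).continuousOn
  obtain ⟨A₁, hA₁0, hA₁⟩ := exists_vertexShape_bound D hrun ht le_rfl hrun (δ := δ)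
    (g := fun x s => iteratedDeriv 2 (fun u => D.dm2 e' u x) s) (h := fun s => iteratedDeriv 2 (fun u => D.E1 e' u) s)
    (fun x hx => ((hdm2 x hx).continuous_iteratedDeriv 2 le_rfl).continuousOn)
    (hE1.continuous_iteratedDeriv 2 le_rfl).continuousOn
  have hV : ∀ s ∈ Set.Icc (0 : ℝ) δ, ∀ φ' : HiggsLattice.ScalarField P 0 N,
      |lamVertex D e' s φ'| ≤ A₀ * Real.exp (t * sqSum φ') := by
    intro s hs φ'
    have h := hA₀ s hs φ'
    rw [lamVertex_def]
    exact h
  have hW : ∀ s ∈ Set.Icc (0 : ℝ) δ, ∀ φ' : HiggsLattice.ScalarField P 0 N,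
      |lamVertex2 D e' s φ'| ≤ A₁ * Real.exp (t * sqSum φ') := by
    intro s hs φ'
    have h := hA₁ s hs φ'
    rw [zero_mul, zero_add] at h
    rw [lamVertex2_def]
    exact h
  set bound : ((j : Fin k) → HiggsLattice.VecField P j) × (↥D.Ω → EuclideanSpace ℝ (Fin N)) → ℝ :=
    fun z => Cκ * (A₁ + A₀ ^ 2) * Real.exp K₁ * ∏ x, Real.exp (-(c / 2) * ‖z.2 x‖ ^ 2) with hbound
  have hbound_int : Integrable bound (μ.prod volume) :=
    (integrable_const (Cκ * (A₁ + A₀ ^ 2) * Real.exp K₁) (μ := μ)).mul_prod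
      (integrable_gauss_fibre D (by positivity : 0 < c / 2))
  have hG'_le : ∀ s ∈ Set.Icc (0 : ℝ) δ, ∀ z, |G' s z| ≤ bound z := by
    intro s hs z
    have hq : 0 ≤ s * D.lamRun := mul_nonneg hs.1 hrun
    have hkern := kernel14_le D ha.le Ak e' z.1 φ z.2
    have hkern0 := D.kernel14_nonneg ha.le Ak e' z.1 φ z.2
    have hdens := density14_le_explicit D hℓ hm₀ hm₀m (hmass s hs) hq Ak z.1 (extendZero D.Ω z.2)
    have hdens0 := (D.density14_pos Ak e' s z.1 (extendZero D.Ω z.2)).le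
    set S := sqSum (extendZero D.Ω z.2) with hSdef
    have hS0 : 0 ≤ S := sqSum_nonneg _
    have hS : S = ∑ x, ‖z.2 x‖ ^ 2 := sqSum_extendZero D.Ω z.2
    have hv := hV s hs (extendZero D.Ω z.2)
    have hw := hW s hs (extendZero D.Ω z.2)
    have hex1 : 1 ≤ Real.exp (t * S) := Real.one_le_exp (mul_nonneg ht.le hS0)
    -- |W − V²| ≤ (A₁ + A₀²) e^{2tS}
    have hWV : |lamVertex2 D e' s (extendZero D.Ω z.2) - lamVertex D e' s (extendZero D.Ω z.2) ^ 2|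
        ≤ (A₁ + A₀ ^ 2) * Real.exp (2 * t * S) := by
      have e2 : Real.exp (2 * t * S) = Real.exp (t * S) * Real.exp (t * S) := by
        rw [← Real.exp_add]; ring_nf
      have h1 : |lamVertex D e' s (extendZero D.Ω z.2) ^ 2| ≤ A₀ ^ 2 * Real.exp (2 * t * S) := by
        rw [abs_pow, e2, show A₀ ^ 2 * (Real.exp (t * S) * Real.exp (t * S))
          = (A₀ * Real.exp (t * S)) * (A₀ * Real.exp (t * S)) by ring, sq]
        exact mul_le_mul hv hv (abs_nonneg _) (mul_nonneg hA₀0 (Real.exp_pos _).le)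
      have h2 : |lamVertex2 D e' s (extendZero D.Ω z.2)| ≤ A₁ * Real.exp (2 * t * S) :=
        hw.trans (by rw [e2]; exact mul_le_mul_of_nonneg_left (le_mul_of_one_le_right (Real.exp_pos _).le hex1) hA₁0)
      calc |lamVertex2 D e' s (extendZero D.Ω z.2) - lamVertex D e' s (extendZero D.Ω z.2) ^ 2|
          ≤ |lamVertex2 D e' s (extendZero D.Ω z.2)| + |lamVertex D e' s (extendZero D.Ω z.2) ^ 2| := abs_sub _ _
        _ ≤ A₁ * Real.exp (2 * t * S) + A₀ ^ 2 * Real.exp (2 * t * S) := add_le_add h2 h1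
        _ = (A₁ + A₀ ^ 2) * Real.exp (2 * t * S) := by ring
    have hprod : Pf s z ≤ Cκ * (Real.exp K₁ * Real.exp (-(c * S))) := by
      have e3 : -D.E1 e' s - m₀ * D.ell ^ 2 * P.mesh 0 ^ P.d / 2 * S = -D.E1 e' s - c * S := by rw [hcdef]
      have h1 : Pf s z ≤ Cκ * Real.exp (-D.E1 e' s - c * S) := by
        rw [← e3]; exact mul_le_mul hkern hdens hdens0 hCκ0
      have h2 : Real.exp (-D.E1 e' s - c * S) ≤ Real.exp K₁ * Real.exp (-(c * S)) := by
        rw [← Real.exp_add, Real.exp_le_exp]; linarith [hK₁ s hs]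
      exact h1.trans (mul_le_mul_of_nonneg_left h2 hCκ0)
    have hPf0 : 0 ≤ Pf s z := mul_nonneg hkern0 hdens0
    have egauss : Real.exp (2 * t * S) * Real.exp (-(c * S)) = ∏ x, Real.exp (-(c / 2) * ‖z.2 x‖ ^ 2) := by
      rw [← Real.exp_add, ← Real.exp_sum, hS, htdef, Finset.mul_sum, Finset.mul_sum, ← Finset.sum_neg_distrib,
        ← Finset.sum_add_distrib]
      refine congrArg Real.exp (Finset.sum_congr rfl fun x _ => ?_)
      ring
    simp only [hG']
    rw [abs_mul, abs_of_nonneg hPf0]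
    calc |lamVertex2 D e' s (extendZero D.Ω z.2) - lamVertex D e' s (extendZero D.Ω z.2) ^ 2| * Pf s z
        ≤ ((A₁ + A₀ ^ 2) * Real.exp (2 * t * S)) * (Cκ * (Real.exp K₁ * Real.exp (-(c * S)))) :=
          mul_le_mul hWV hprod hPf0 (mul_nonneg (by positivity) (Real.exp_pos _).le)
      _ = Cκ * (A₁ + A₀ ^ 2) * Real.exp K₁ * (Real.exp (2 * t * S) * Real.exp (-(c * S))) := by ring
      _ = bound z := by rw [egauss]
  -- integrability and measurability of `G s`
  have hPf_cont : ∀ s, Continuous (Pf s) := fun s =>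
    continuous_fibre14₄ D e' s continuous_const continuous_fst continuous_const continuous_snd
  have hVz : ∀ s, Continuous fun z : ((j : Fin k) → HiggsLattice.VecField P j) × (↥D.Ω → EuclideanSpace ℝ (Fin N)) =>
      lamVertex D e' s (extendZero D.Ω z.2) := by
    intro s
    simp only [lamVertex_def]
    have hx : ∀ x : HiggsLattice.Site P 0, Continuous fun z : ((j : Fin k) → HiggsLattice.VecField P j)
        × (↥D.Ω → EuclideanSpace ℝ (Fin N)) => ‖extendZero D.Ω z.2 x‖ :=
      fun x => ((continuous_apply x).comp ((continuous_extendZero D.Ω).comp continuous_snd)).norm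
    exact ((continuous_const.mul (continuous_finsetSum _ fun x _ => continuous_const.mul ((hx x).pow 4))).add
      (continuous_const.mul (continuous_finsetSum _ fun x _ =>
        ((continuous_const.mul continuous_const).mul continuous_const).mul ((hx x).pow 2)))).add continuous_const
  have hG_meas : ∀ s, AEStronglyMeasurable (G s) (μ.prod volume) := fun s =>
    ((hVz s).mul (hPf_cont s)).aestronglyMeasurable
  obtain ⟨bound₁, hbound₁_int, hbound₁⟩ :=
    exists_lamDeriv_majorant D hmsq ha hL hk1 hk hℓ hrun hm₀ hm₀m hmass hdm2₁ hE1₁ Ak φ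
  have hG_int : ∀ s ∈ Set.Icc (0 : ℝ) δ, Integrable (G s) (μ.prod volume) := by
    intro s hs
    refine hbound₁_int.mono' (hG_meas s) (Filter.Eventually.of_forall fun z => ?_)
    rw [Real.norm_eq_abs]
    exact hbound₁ s hs z
  exact hasDerivWithinAt_integral_Icc_of_dominated hs₀ hG_meas hG_int hderiv hG'_le hbound_int

/-- **`∂⁺²E_k/∂λ′²|_{λ′=0} = ⟨∂_{λ′}V⟩₀ − (⟨V²⟩₀ − ⟨V⟩₀²)`** — what the `β = 2` term of the repaired (1.5) denotes for
the typed instance: the expectation of the differentiated vertex minus the VARIANCE of the `λ′`-vertex (the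
connected two-vertex function: "vertices and propagators", p. 412), in the normalized `λ′ = 0` measure
`Z₀⁻¹·t·exp[…]dμ(A′)dφ′↾_Ω`.  Hypotheses of §7 with `C²` data.  (`iteratedDerivWithin 2 · [0,∞) 0`, the quantity
in `B3Eq15OneSidedInteraction.interaction15R`.) (ours) [cite: Balaban1983Higgs3, (1.4)–(1.7) pp.412–413] -/
theorem iteratedDerivWithin_two_auxE_lam_Ici (hmsq : 0 < D.msq) (ha : 0 < D.a) (hL : 1 < (P.L : ℝ))
    (hk1 : 1 ≤ k) (hk : k ≤ P.K) (hℓ : D.ell ≠ 0) (hrun : 0 ≤ D.lamRun) {e' δ m₀ : ℝ} (hδ : 0 < δ) (hm₀ : 0 < m₀)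
    (hm₀m : m₀ ≤ D.m2) (hmass : ∀ s ∈ Set.Icc (0 : ℝ) δ, ∀ x ∈ D.Ω₁, m₀ ≤ D.m2 + D.dm2 e' s x)
    (hdm2 : ∀ x ∈ D.Ω₁, ContDiff ℝ 2 (fun s => D.dm2 e' s x)) (hE1 : ContDiff ℝ 2 (fun s => D.E1 e' s))
    (Ak : HiggsLattice.VecField P 0) (φ : HiggsLattice.ScalarField P k N) :
    iteratedDerivWithin 2 (fun s => D.auxE e' s Ak φ) (Set.Ici 0) 0
      = (∫ z, lamVertex2 D e' 0 (extendZero D.Ω z.2)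
            * (D.kernel14 Ak e' z.1 φ z.2 * D.density14 Ak e' 0 z.1 (extendZero D.Ω z.2))
            ∂((fluctFamily P D.msq D.a k).prod volume))
          / (∫ A', D.integrand14 e' 0 Ak φ A' ∂(fluctFamily P D.msq D.a k))
        - ((∫ z, lamVertex D e' 0 (extendZero D.Ω z.2) ^ 2
              * (D.kernel14 Ak e' z.1 φ z.2 * D.density14 Ak e' 0 z.1 (extendZero D.Ω z.2))
              ∂((fluctFamily P D.msq D.a k).prod volume))
            / (∫ A', D.integrand14 e' 0 Ak φ A' ∂(fluctFamily P D.msq D.a k))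
          - ((∫ z, lamVertex D e' 0 (extendZero D.Ω z.2)
                * (D.kernel14 Ak e' z.1 φ z.2 * D.density14 Ak e' 0 z.1 (extendZero D.Ω z.2))
                ∂((fluctFamily P D.msq D.a k).prod volume))
              / (∫ A', D.integrand14 e' 0 Ak φ A' ∂(fluctFamily P D.msq D.a k))) ^ 2) := by
  haveI := HiggsFluctMeasurePos.fluctFamily_isProbability (P := P) hmsq ha hL hk
  have hm2 : 0 < D.m2 := lt_of_lt_of_le hm₀ hm₀m
  have hdm2₁ : ∀ x ∈ D.Ω₁, ContDiff ℝ 1 (fun s => D.dm2 e' s x) := fun x hx => contDiff_one_of_two (hdm2 x hx)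
  have hE1₁ : ContDiff ℝ 1 (fun s => D.E1 e' s) := contDiff_one_of_two hE1
  have h0 : (0 : ℝ) ∈ Set.Icc (0 : ℝ) δ := ⟨le_rfl, hδ.le⟩
  -- integrability of `W·Pf₀` and `V²·Pf₀` (Gaussian majorants as in §9/§10)
  have hPf_cont : Continuous fun z : ((j : Fin k) → HiggsLattice.VecField P j) × (↥D.Ω → EuclideanSpace ℝ (Fin N)) =>
      D.kernel14 Ak e' z.1 φ z.2 * D.density14 Ak e' 0 z.1 (extendZero D.Ω z.2) :=
    continuous_fibre14₄ D e' 0 continuous_const continuous_fst continuous_const continuous_snd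
  have hxz : ∀ x : HiggsLattice.Site P 0, Continuous fun z : ((j : Fin k) → HiggsLattice.VecField P j)
      × (↥D.Ω → EuclideanSpace ℝ (Fin N)) => ‖extendZero D.Ω z.2 x‖ :=
    fun x => ((continuous_apply x).comp ((continuous_extendZero D.Ω).comp continuous_snd)).norm
  have hVz : Continuous fun z : ((j : Fin k) → HiggsLattice.VecField P j) × (↥D.Ω → EuclideanSpace ℝ (Fin N)) =>
      lamVertex D e' 0 (extendZero D.Ω z.2) := by
    simp only [lamVertex_def]
    exact ((continuous_const.mul (continuous_finsetSum _ fun x _ => continuous_const.mul ((hxz x).pow 4))).add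
      (continuous_const.mul (continuous_finsetSum _ fun x _ =>
        ((continuous_const.mul continuous_const).mul continuous_const).mul ((hxz x).pow 2)))).add continuous_const
  have hWz : Continuous fun z : ((j : Fin k) → HiggsLattice.VecField P j) × (↥D.Ω → EuclideanSpace ℝ (Fin N)) =>
      lamVertex2 D e' 0 (extendZero D.Ω z.2) := by
    simp only [lamVertex2_def]
    exact (continuous_const.mul (continuous_finsetSum _ fun x _ =>
        ((continuous_const.mul continuous_const).mul continuous_const).mul ((hxz x).pow 2))).add continuous_const
  have hη : 0 < P.mesh 0 ^ P.d := pow_pos (P.mesh_pos 0) _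
  set c : ℝ := m₀ * D.ell ^ 2 * P.mesh 0 ^ P.d / 2 with hcdef
  have hℓ2 : 0 < D.ell ^ 2 := by positivity
  have hc : 0 < c := by positivity
  set κ : ℝ := prec (B1.aSeq D.a P.L k) (P.mesh k) P.d with hκdef
  set Cκ : ℝ := ((κ / (2 * Real.pi)) ^ ((Module.finrank ℝ (EuclideanSpace ℝ (Fin N)) : ℝ) / 2))
      ^ Fintype.card ↥D.Ωk with hCκ
  have hκ0 : 0 ≤ κ := (prec_pos D ha hL hk1).le
  have hCκ0 : 0 ≤ Cκ := pow_nonneg (Real.rpow_nonneg (by positivity) _) _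
  -- the common estimate: `f·Pf₀ ≤ Cκ·A·e^{−E₁}·Πexp(−(c/2)|·|²)` whenever `|f| ≤ A·e^{(c/2)S}`
  have hdom : ∀ {A : ℝ} (f : (↥D.Ω → EuclideanSpace ℝ (Fin N)) → ℝ), 0 ≤ A →
      (∀ φΩ, |f φΩ| ≤ A * Real.exp (c / 2 * sqSum (extendZero D.Ω φΩ))) →
      ∀ z : ((j : Fin k) → HiggsLattice.VecField P j) × (↥D.Ω → EuclideanSpace ℝ (Fin N)),
        |f z.2 * (D.kernel14 Ak e' z.1 φ z.2 * D.density14 Ak e' 0 z.1 (extendZero D.Ω z.2))|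
          ≤ Cκ * A * Real.exp (-D.E1 e' 0) * ∏ x, Real.exp (-(c / 2) * ‖z.2 x‖ ^ 2) := by
    intro A f hA hf z
    have hkern := kernel14_le D ha.le Ak e' z.1 φ z.2
    have hkern0 := D.kernel14_nonneg ha.le Ak e' z.1 φ z.2
    have hdens := density14_le_explicit D hℓ hm₀ hm₀m (hmass 0 h0) (by rw [zero_mul]) Ak z.1 (extendZero D.Ω z.2)
    have hdens0 := (D.density14_pos Ak e' 0 z.1 (extendZero D.Ω z.2)).le
    have hS : sqSum (extendZero D.Ω z.2) = ∑ x, ‖z.2 x‖ ^ 2 := sqSum_extendZero D.Ω z.2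
    have e3 : -D.E1 e' 0 - m₀ * D.ell ^ 2 * P.mesh 0 ^ P.d / 2 * sqSum (extendZero D.Ω z.2)
        = -D.E1 e' 0 - c * sqSum (extendZero D.Ω z.2) := by rw [hcdef]
    rw [e3] at hdens
    have egauss : Real.exp (c / 2 * sqSum (extendZero D.Ω z.2)) * Real.exp (-D.E1 e' 0 - c * sqSum (extendZero D.Ω z.2))
        = Real.exp (-D.E1 e' 0) * ∏ x, Real.exp (-(c / 2) * ‖z.2 x‖ ^ 2) := by
      rw [← Real.exp_sum, ← Real.exp_add, ← Real.exp_add, hS, Finset.mul_sum, Finset.mul_sum]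
      refine congrArg Real.exp ?_
      have h1 : ∑ x : ↥D.Ω, -(c / 2) * ‖z.2 x‖ ^ 2
          = ∑ x : ↥D.Ω, c / 2 * ‖z.2 x‖ ^ 2 - ∑ x : ↥D.Ω, c * ‖z.2 x‖ ^ 2 := by
        rw [← Finset.sum_sub_distrib]; exact Finset.sum_congr rfl fun x _ => by ring
      linarith [h1]
    rw [abs_mul, abs_of_nonneg (mul_nonneg hkern0 hdens0)]
    calc |f z.2| * (D.kernel14 Ak e' z.1 φ z.2 * D.density14 Ak e' 0 z.1 (extendZero D.Ω z.2))
        ≤ (A * Real.exp (c / 2 * sqSum (extendZero D.Ω z.2)))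
            * (Cκ * Real.exp (-D.E1 e' 0 - c * sqSum (extendZero D.Ω z.2))) :=
          mul_le_mul (hf z.2) (mul_le_mul hkern hdens hdens0 hCκ0) (mul_nonneg hkern0 hdens0)
            (mul_nonneg hA (Real.exp_pos _).le)
      _ = Cκ * A * (Real.exp (c / 2 * sqSum (extendZero D.Ω z.2))
            * Real.exp (-D.E1 e' 0 - c * sqSum (extendZero D.Ω z.2))) := by ring
      _ = Cκ * A * Real.exp (-D.E1 e' 0) * ∏ x, Real.exp (-(c / 2) * ‖z.2 x‖ ^ 2) := by rw [egauss]; ring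
  have hW_int : Integrable (fun z : ((j : Fin k) → HiggsLattice.VecField P j) × (↥D.Ω → EuclideanSpace ℝ (Fin N)) =>
      lamVertex2 D e' 0 (extendZero D.Ω z.2)
        * (D.kernel14 Ak e' z.1 φ z.2 * D.density14 Ak e' 0 z.1 (extendZero D.Ω z.2)))
      ((fluctFamily P D.msq D.a k).prod volume) := by
    obtain ⟨A₁, hA₁0, hA₁⟩ := exists_vertexShape_bound D hrun (half_pos hc) le_rfl hrun (δ := δ)
      (g := fun x s => iteratedDeriv 2 (fun u => D.dm2 e' u x) s) (h := fun s => iteratedDeriv 2 (fun u => D.E1 e' u) s)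
      (fun x hx => ((hdm2 x hx).continuous_iteratedDeriv 2 le_rfl).continuousOn)
      (hE1.continuous_iteratedDeriv 2 le_rfl).continuousOn
    refine (((integrable_const (Cκ * A₁ * Real.exp (-D.E1 e' 0)) (μ := fluctFamily P D.msq D.a k)).mul_prod
      (integrable_gauss_fibre D (half_pos hc))).mono' (hWz.mul hPf_cont).aestronglyMeasurable
      (Filter.Eventually.of_forall fun z => ?_))
    rw [Real.norm_eq_abs]
    refine hdom (fun φΩ => lamVertex2 D e' 0 (extendZero D.Ω φΩ)) hA₁0 (fun φΩ => ?_) z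
    have hw := hA₁ 0 h0 (extendZero D.Ω φΩ)
    rw [zero_mul, zero_add, ← lamVertex2_def] at hw
    exact hw
  have hV2_int : Integrable (fun z : ((j : Fin k) → HiggsLattice.VecField P j) × (↥D.Ω → EuclideanSpace ℝ (Fin N)) =>
      lamVertex D e' 0 (extendZero D.Ω z.2) ^ 2
        * (D.kernel14 Ak e' z.1 φ z.2 * D.density14 Ak e' 0 z.1 (extendZero D.Ω z.2)))
      ((fluctFamily P D.msq D.a k).prod volume) := by
    have hc4 : 0 < c / 4 := by positivity
    obtain ⟨A₀, hA₀0, hA₀⟩ := exists_vertexShape_bound D hrun hc4 hrun le_rfl (δ := δ)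
      (g := fun x s => deriv (fun u => D.dm2 e' u x) s) (h := fun s => deriv (fun u => D.E1 e' u) s)
      (fun x hx => ((hdm2₁ x hx).continuous_deriv le_rfl).continuousOn) (hE1₁.continuous_deriv le_rfl).continuousOn
    refine (((integrable_const (Cκ * A₀ ^ 2 * Real.exp (-D.E1 e' 0)) (μ := fluctFamily P D.msq D.a k)).mul_prod
      (integrable_gauss_fibre D (half_pos hc))).mono' ((hVz.pow 2).mul hPf_cont).aestronglyMeasurable
      (Filter.Eventually.of_forall fun z => ?_))
    rw [Real.norm_eq_abs]
    refine hdom (fun φΩ => lamVertex D e' 0 (extendZero D.Ω φΩ) ^ 2) (sq_nonneg A₀) (fun φΩ => ?_) z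
    have hv := hA₀ 0 h0 (extendZero D.Ω φΩ)
    rw [← lamVertex_def] at hv
    have e2 : A₀ ^ 2 * Real.exp (c / 2 * sqSum (extendZero D.Ω φΩ))
        = (A₀ * Real.exp (c / 4 * sqSum (extendZero D.Ω φΩ))) ^ 2 := by
      rw [mul_pow, sq (Real.exp _), ← Real.exp_add]; ring_nf
    rw [abs_pow, e2]
    exact pow_le_pow_left₀ (abs_nonneg _) hv 2
  -- names for the four numbers and the two functions
  set R₀ : ℝ := ∫ z, lamVertex2 D e' 0 (extendZero D.Ω z.2)
      * (D.kernel14 Ak e' z.1 φ z.2 * D.density14 Ak e' 0 z.1 (extendZero D.Ω z.2))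
      ∂((fluctFamily P D.msq D.a k).prod volume) with hR₀
  set Q₀ : ℝ := ∫ z, lamVertex D e' 0 (extendZero D.Ω z.2) ^ 2
      * (D.kernel14 Ak e' z.1 φ z.2 * D.density14 Ak e' 0 z.1 (extendZero D.Ω z.2))
      ∂((fluctFamily P D.msq D.a k).prod volume) with hQ₀
  set N₀ : ℝ := ∫ z, lamVertex D e' 0 (extendZero D.Ω z.2)
      * (D.kernel14 Ak e' z.1 φ z.2 * D.density14 Ak e' 0 z.1 (extendZero D.Ω z.2))
      ∂((fluctFamily P D.msq D.a k).prod volume) with hN₀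
  set Z₀ : ℝ := ∫ A', D.integrand14 e' 0 Ak φ A' ∂(fluctFamily P D.msq D.a k) with hZ₀
  set M₀ : ℝ := ∫ z, (lamVertex2 D e' 0 (extendZero D.Ω z.2) - lamVertex D e' 0 (extendZero D.Ω z.2) ^ 2)
      * (D.kernel14 Ak e' z.1 φ z.2 * D.density14 Ak e' 0 z.1 (extendZero D.Ω z.2))
      ∂((fluctFamily P D.msq D.a k).prod volume) with hM₀
  have hsplit : M₀ = R₀ - Q₀ := by
    rw [hM₀, hR₀, hQ₀, ← integral_sub hW_int hV2_int]
    refine integral_congr_ae (Filter.Eventually.of_forall fun z => ?_)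
    ring
  set Zf : ℝ → ℝ := fun s => ∫ A', D.integrand14 e' s Ak φ A' ∂(fluctFamily P D.msq D.a k) with hZf
  set Nf : ℝ → ℝ := fun s => ∫ z, lamVertex D e' s (extendZero D.Ω z.2)
      * (D.kernel14 Ak e' z.1 φ z.2 * D.density14 Ak e' s z.1 (extendZero D.Ω z.2))
      ∂((fluctFamily P D.msq D.a k).prod volume) with hNf
  have hreg : ∀ s ∈ Set.Icc (0 : ℝ) δ, 0 ≤ s * D.lamRun ∧ (0 < s * D.lamRun ∨ ∀ x ∈ D.Ω₁, 0 < D.m2 + D.dm2 e' s x) :=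
    fun s hs => ⟨mul_nonneg hs.1 hrun, Or.inr fun x hx => lt_of_lt_of_le hm₀ (hmass s hs x hx)⟩
  have hZpos : ∀ s ∈ Set.Icc (0 : ℝ) δ, 0 < Zf s := fun s hs =>
    integral_integrand14_pos D hmsq ha hL hk1 hk hm2 hℓ (hreg s hs).1 (hreg s hs).2 Ak φ
  -- Step 1: on `[0, δ)`, `derivWithin E_k (Ici 0) s = N(s)/Z(s)`
  have hD1 : ∀ s ∈ Set.Ico (0 : ℝ) δ, derivWithin (fun s => D.auxE e' s Ak φ) (Set.Ici 0) s = (Nf / Zf) s := by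
    intro s hs
    have hsI : s ∈ Set.Icc (0 : ℝ) δ := ⟨hs.1, hs.2.le⟩
    have h : HasDerivWithinAt (fun s => D.auxE e' s Ak φ) (Nf s / Zf s) (Set.Icc 0 δ) s :=
      hasDerivWithinAt_auxE_lam_Icc D hmsq ha hL hk1 hk hℓ hrun hm₀ hm₀m hmass hdm2₁ hE1₁ Ak φ hsI
    have hnhds : Set.Icc (0 : ℝ) δ ∈ 𝓝[Set.Ici 0] s := by
      rw [mem_nhdsWithin]
      exact ⟨Set.Iio δ, isOpen_Iio, hs.2, fun x hx => ⟨hx.2, hx.1.le⟩⟩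
    exact (h.mono_of_mem_nhdsWithin hnhds).derivWithin (uniqueDiffOn_Ici 0 s hs.1)
  -- Step 2: derivatives of N and Z at 0 within Icc 0 δ, and of the quotient
  have hN : HasDerivWithinAt Nf M₀ (Set.Icc 0 δ) 0 :=
    hasDerivWithinAt_integral_lamVertex_mul_Icc D hmsq ha hL hk1 hk hℓ hrun hm₀ hm₀m hmass hdm2 hE1 Ak φ h0
  have hZ : HasDerivWithinAt Zf (-N₀) (Set.Icc 0 δ) 0 :=
    hasDerivWithinAt_integral_integrand14_lam_Icc D hmsq ha hL hk1 hk hℓ hrun hm₀ hm₀m hmass hdm2₁ hE1₁ Ak φ h0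
  have hquot := hN.div hZ (hZpos 0 h0).ne'
  have hIcc : Set.Icc (0 : ℝ) δ ∈ 𝓝[Set.Ici 0] (0 : ℝ) := Icc_mem_nhdsGE hδ
  have hfin := (hquot.mono_of_mem_nhdsWithin hIcc).derivWithin (uniqueDiffOn_Ici 0 0 Set.self_mem_Ici)
  -- Step 3: iteratedDerivWithin 2 = derivWithin of derivWithin; replace the inner function on `[0, δ)`
  rw [iteratedDerivWithin_succ, iteratedDerivWithin_one]
  have hcongr : derivWithin (derivWithin (fun s => D.auxE e' s Ak φ) (Set.Ici 0)) (Set.Ici 0) 0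
      = derivWithin (Nf / Zf) (Set.Ici 0) 0 := by
    refine Filter.EventuallyEq.derivWithin_eq ?_ (hD1 0 ⟨le_rfl, hδ⟩)
    have hmem : Set.Ico (0 : ℝ) δ ∈ 𝓝[Set.Ici 0] (0 : ℝ) := by
      rw [mem_nhdsWithin]
      exact ⟨Set.Iio δ, isOpen_Iio, hδ, fun x hx => ⟨hx.2, hx.1⟩⟩
    filter_upwards [hmem] with s hs using hD1 s hs
  rw [hcongr, hfin]
  -- Step 4: algebra `(M₀·Z₀ − N₀·(−N₀))/Z₀² = R₀/Z₀ − (Q₀/Z₀ − (N₀/Z₀)²)`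
  have eZ : Zf 0 = Z₀ := rfl
  have eN : Nf 0 = N₀ := rfl
  rw [eZ, eN, hsplit]
  have hZ0 : Z₀ ≠ 0 := by rw [← eZ]; exact (hZpos 0 h0).ne'
  field_simp
  ring

end LamSecond

end

end Literature.MathematicalPhysics.QuantumFieldTheory.Balaban1983to89.B3Eq14Finite
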